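import Summits.QuantumFields.YangMills.Theorems.BackwardLiouvilleRigidityHeightwiseRealisation
import Literature.MathematicalPhysics.QuantumFieldTheory.Balaban1983to89.T3MinimiserStabilityReduction
import Literature.MathematicalPhysics.QuantumFieldTheory.Balaban1983to89.T3PrintedRegularMinimiser
import Summits.QuantumFields.YangMills.Theorems.FluctuationComparisonRegPrIntLRunPairOrganIntegralOfTV
import Summits.QuantumFields.YangMills.Theorems.FluctuationComparisonRegPrIntLRunPairOrganWindowTV
import Summits.QuantumFields.YangMills.Theorems.FluctuationComparisonRegPrIntLRunPairOrganFiniteChain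
import Summits.QuantumFields.YangMills.Theorems.FluctuationComparisonRegPrIntLRunPairOrganInnerWindowChains
import Summits.QuantumFields.YangMills.Theorems.FluctuationComparisonRegPrIntLRunPairOrganRunWindowTailsOfFirstExit
import Summits.QuantumFields.YangMills.Theses.FirstExitWindow
import Summits.QuantumFields.YangMills.Theorems.FluctuationComparisonRegPrIntLRunPairOrganWindowTVOfSupOsc
import Summits.QuantumFields.YangMills.Theorems.FluctuationComparisonRegPrIntLOrganTangentAnchorFreeOscillation
import Summits.QuantumFields.YangMills.Theorems.FluctuationComparisonRegPrIntLOrganTangentWindowGaugeInvariance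
import Summits.QuantumFields.YangMills.Theorems.FluctuationComparisonRegPrIntLOrganTangentFlatAnchorEven
import Summits.QuantumFields.YangMills.Theorems.FluctuationComparisonRegPrIntLOrganTangentSmallStepChordPath
import Summits.QuantumFields.YangMills.Theorems.FluctuationComparisonRegPrIntLOrganTangentSeedHTriple
import Summits.QuantumFields.YangMills.Theorems.FluctuationComparisonRegPrIntLOrganTangentSeedBudget
import Literature.MathematicalPhysics.QuantumFieldTheory.Balaban1983to89.T4CubeChartExp
import Literature.MathematicalPhysics.QuantumFieldTheory.Balaban1983to89.T4ExpWindowSmallField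
import Literature.MathematicalPhysics.QuantumFieldTheory.Balaban1983to89.T4SmallFieldWindowSandwich
import Literature.MathematicalPhysics.QuantumFieldTheory.Balaban1983to89.T3InteriorExcision
import Literature.MathematicalPhysics.QuantumFieldTheory.Balaban1983to89.T3ThresholdSmallness
import Literature.MathematicalPhysics.QuantumFieldTheory.Balaban1983to89.T3PrintedMinimiserExistence
import Literature.MathematicalPhysics.QuantumFieldTheory.Balaban1983to89.B10Eq41TorusHistories

/-!
v18 DRAFT (2026-08-31, ideator ym-r3-idea-1 g27 — the v18 PEN per ★★OWNER №264; emission spec = LEAD w3 g24 №11 ∕ ★★OWNER №283; NOT the registry: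
`Lines/runpair_organ.lean` stays v17.2 00c0706780fcab78 until idea-crit-5 BC2∕BC7 → LEAD census → OWNER emission census → `skeleton check`).
THE H-CURRENCY RE-KEY.  v17.2's sup-currency organ O1 (`OneStepContractionRun`, κ-ceiling O1-R1) and S1a are RE-TYPED, not closed: the open
stubs become S1aᴴ `stub_runClassMembershipH : RunClassMembershipH` (S1a VERBATIM + the per-height analyticity clause (β) `AnalyticPairWindowAt
(θ_j∕2) rA (CB·β_jθ_j²)`, [Balaban1985UV3] p.263 (c); L) and O1ᵘ-H v2 `stub_oneStepTransportUH : OneStepTransportUH` (uniform multi-step transport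
of the SCALED one-bond-pair clause `HClauseSq` — Hessian currency, letters `k b b′·(‖v‖∕θ)(‖v′‖∕θ)`; XL, NOT PRINTED as a theorem).  S3 becomes S3ᴴ
`BackwardStabilityFinSupH` (conclusion = inner-window SUP-OSCILLATION of `h_j − h_j(1)` at path profile `b₀∕8`, RHS `(Cs·x_T + δ_j)·β_j(2#Plaq_j +
#PBond_j²)`) and is DERIVED: `backwardStabilityFinSupH_of_stubs := backwardStabilityFinSupH_of_oneStepTransportUH stub_oneStepTransportUH` — the
kernel-checked JUNCTION (§V18.J below, BY TEXT = crux workfile `JunctionDirectTransport.lean` v1.2 §C–§F (px19's five `linarith only` budget edits carried) until px19 g18's Theorems lift;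
its §B is ✓p799177 `…OrganTangentAnchorFreeOscillation` BY NAME) over ✓p798086 (P-b′) small-step chord paths, ✓p797413 brick T, ✓p794698 gauge
invariance, ✓p793256 flat evenness.  S4b becomes S4bᴼ `WindowTVOsc` (= ✓p798125 `RunPairOrganWindowTVOfSupOsc.windowTV_of_supOsc` VERBATIM, closed BY
NAME); S4a `InnerWindowChains` and S4b `WindowTV` stay closed-by-name but are no longer consumed.  The composition `unitLawCauchy_perL_of_H (h1a :
RunClassMembershipH) (h1b : RunWindowTails) (h2 : RunPairSeed) (h3 : BackwardStabilityFinSupH) (h4b : WindowTVOsc) (h4c : IntegralOfTV)` replaces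
`unitLawCauchy_perL_of`: the seed of S2 (v17.2 :248 VERBATIM; its `J K·σ K → 0` clause goes idle — LEAD census №4 N1, RATE-FREE) is docked at the
seed height `T = J K₀` into S3ᴴ's H-triple by px5 g18's `OrganTangentSeedHTriple.seedTriple_of_seed_of_analytic_three` at weight rate `κ := κs∕5 <
κs∕4` (FLAG (c-κ)), radius `rA ≤ 1∕12` and letter `CB·β_jθ_j²` straight from S1aᴴ v0.3 (LEAD №15 (A) N2 TEXT-SIDE), normalised size
`x_T = wT∕(β_Tθ_T²) ≤ M₂·⁴√(σ K₀ + 1∕(K₀+1)) → 0` by ✓p800785 px5 `OrganTangentSeedBudget.normalisedSeed_div_four_le` + `b₀_sq_le_beta_mul_θBal_sq` BY NAME; termination by S4bᴼ on the inner window `θBal (√(b₀∕8)) (p₀∕2) j ≤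
θ_j∕8` (✓p652443 `FlatRatioTermination.stub_thresholds` at `b₀∕8` + `θBal_div8`), inner tails = S1b at `(√(b₀∕8), p₀∕2)`, SF-towers ∕ `tv_transfer` ∕
S4c VERBATIM.  REMOVED as stubs (texts stay for the record): `stub_runClassMembership`, `stub_oneStepContractionRun`, `stub_finiteChain`,
`backwardStabilityFinSup_of_stubs` (`finiteChain_supR : OneStepContractionRun → BackwardStabilityFinSup` stays, PROVED).  Sorries = 5 = {S1aᴴ, 26243,
S2α′, S2β, O1ᵘ-H v2} — the same COUNT as v17.2 (re-typings of open stubs; count-neutral); every other byte of v17.2 outside the named hunks is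
VERBATIM.  HONEST: nothing of Bałaban's is asserted; S1aᴴ (L) and O1ᵘ-H v2 (XL) carry 20520's analysis and are NOT proved; 26243 shared and open;
20520 ∕ `YM3TorusSU2` NOT proved; rung R3 = SU(2) YM₃ on T³ — NOT d = 4, NOT infinite volume, NOT a mass gap, NOT Clay; no summit is proved by this file.



[SCRATCH-ONLY ELISION S0 — NOT A HUNK OF THE EMISSION: v17.2's module-docstring version history (v17.2 ll. 12–153, 142 lines ≈ 20 KB:
R-CUT-χ … v10 paragraphs) is elided in THIS crux-workfile copy only, because `ledger crux write` caps a workfile at 200 000 bytes and the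
full-text draft is 211 563 bytes; the EMISSION restores those lines VERBATIM — it imports px19 g18's Theorems lifts of §V18.J (junction) and
§V18.U (composition) instead of carrying them by text (projected ≈ 145 KB). Every Lean byte below is the full draft's.]

-/

open MeasureTheory Filter Topology
open Literature.MathematicalPhysics.QuantumFieldTheory.Balaban1983to89 T3ContinuumYM3Torus T3NestedUnitLaws
  T3UnitLawDensityEML T4Continuum BalabanUVClass T3UnitScaleTilt T3PrintedRegularMinimiser

namespace Summit.QuantumFields.YangMills.Cruxes.FluctuationComparisonRegPrIntL.RunPairOrgan

/-! ### v17.2 (R-CUT-χ) · the smooth small-field cutoff of the rows (BY TEXT = `OrganTangent.sfCut`), used as the tower-cut weight -/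

/-- The rows' smooth small-field cutoff (text identical with `Lines/organ_tangent.lean`'s `sfCut`): `1` where every plaquette distance is
`≤ θ/2`, `0` as soon as one is `≥ (24/25)θ`, a product of clipped linear ramps in between (R-CUT-χ numerals (½, 24∕25)). -/
noncomputable def sfCut {P : Params} {k : ℕ} (θ : ℝ) (U : GaugeField P k ↥(Matrix.specialUnitaryGroup (Fin 2) ℂ)) : ℝ :=
  ∏ p : Plaq P k, max 0 (min 1 ((24 / 25 * θ - dist1 (GaugeField.plaqHol U p)) / ((24 / 25 - 1 / 2) * θ)))

theorem sfCut_nonneg {P : Params} {k : ℕ} (θ : ℝ) (U : GaugeField P k ↥(Matrix.specialUnitaryGroup (Fin 2) ℂ)) :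
    0 ≤ sfCut θ U :=
  Finset.prod_nonneg fun _ _ => le_max_left _ _

theorem sfCut_le_one {P : Params} {k : ℕ} (θ : ℝ) (U : GaugeField P k ↥(Matrix.specialUnitaryGroup (Fin 2) ℂ)) :
    sfCut θ U ≤ 1 :=
  Finset.prod_le_one (fun _ _ => le_max_left _ _) fun _ _ => max_le zero_le_one (min_le_left _ _)

/-- `{sfCut θ < 1} ⊆ {¬ PlaqSmall (θ/2)}`: the deficit of the smooth cut is read at the HALF window profile. -/
theorem not_plaqSmall_of_sfCut_lt_one {P : Params} {k : ℕ} {θ : ℝ} (hθ : 0 < θ)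
    {U : GaugeField P k ↥(Matrix.specialUnitaryGroup (Fin 2) ℂ)} (h : sfCut θ U < 1) : ¬ PlaqSmall (θ / 2) U := by
  intro hs
  refine (not_le.mpr h) (le_of_eq ?_)
  unfold sfCut
  refine (Finset.prod_eq_one fun p _ => ?_).symm
  have hp : dist1 (GaugeField.plaqHol U p) < θ / 2 := hs p
  have hden : 0 < (24 / 25 - 1 / 2) * θ := mul_pos (by norm_num) hθ
  have h1 : (1 : ℝ) ≤ (24 / 25 * θ - dist1 (GaugeField.plaqHol U p)) / ((24 / 25 - 1 / 2) * θ) := by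
    rw [le_div_iff₀ hden]; linarith
  rw [min_eq_left h1, max_eq_right zero_le_one]

theorem measurable_sfCut {P : Params} {k : ℕ} (θ : ℝ) :
    Measurable fun U : GaugeField P k ↥(Matrix.specialUnitaryGroup (Fin 2) ℂ) => sfCut θ U := by
  unfold sfCut
  refine Finset.measurable_prod _ fun p _ => ?_
  exact measurable_const.max (measurable_const.min ((measurable_const.sub
    (RegularGaugeGroup.measurable_dist1.comp (Missing.measurable_plaqHol p))).div_const ((24 / 25 - 1 / 2) * θ)))

/-- `θBal` is linear in `b₀` (`pFun b₀ p₀ g = b₀ · (1 + log g⁻¹)^{p₀}`). -/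
theorem θBal_half (L : ℕ) (γ b₀ p₀ : ℝ) (i : ℕ) : θBal L γ (b₀ / 2) p₀ i = θBal L γ b₀ p₀ i / 2 := by
  unfold θBal B10.pFun; ring

/-- S1a · RUN CLASS MEMBERSHIP (Bałaban's UV3 representation theorem, read on every run): for every large exponent `p₀` there are a
window constant `b₀`, a coupling threshold and an admissible parameter schedule such that for EVERY cut-off `K` the nested law of run `K`
at every height `j₀ ≤ j ≤ K` has a density (w.r.t. product Haar) that is positive and continuous on Bałaban's window and lies in the
class read on run `K` (`MemOfRun`).  Printed: [Balaban1985UV3] Thms 1–3, [Balaban1988RG2] Thm 1 (representation (0.3)–(0.12)). XL (port).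
v17 (R-a): stated for the SF-PROJECTED TOWER of run `K` below ANY seed height `Ts ≤ K` (the run itself at and above `Ts`, cut-consistency
`μ j = descend_* (sfCut θ_{j+1} · μ (j+1))` below (v17.1: smooth cut); the tower is determined by the run): its densities are window-positive,
window-continuous, carry the laws, and lie in the class read on run `K` MODULO A CONSTANT FACTOR `e^κ` (R-n4, critic g14 #527 Q1:
a (sub-)probability Haar-density concentrated on the window has log-height `≍ |T| log θ_j⁻¹`, while `Mem`'s `large`∕`stability` cap it at
`c5·|T| ≤ C₀|T|` — so membership of the NORMALISED density is false from a height on; Bałaban's densities (5)∕(47)∕(65) are not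
probability-normalised, and PATH B's one-bond ∕ 4-point differences never see the constant) — [Balaban1985UV3] (47)'s leading term. -/
def RunClassMembership : Prop :=
  ∀ (L : ℕ), ∃ pm : ℝ, 0 < pm ∧ ∀ (p₀ : ℝ), pm ≤ p₀ → ∃ b₀ : ℝ, 0 < b₀ ∧ ∃ γ₁ : ℝ, 0 < γ₁ ∧ ∀ (F : T3Family) (γ : ℝ), F.L = L → 0 < γ → γ ≤ γ₁ →
    ∃ (j₀ : ℕ) (prm : ℕ → ClassParams), AdmissibleClassParams F γ b₀ p₀ prm ∧
      ∀ (ν : ℕ → (j : ℕ) → Measure (GaugeField (F.P j) 0 (Matrix.specialUnitaryGroup (Fin 2) ℂ))),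
        (∀ K, ν K K = T4GenFunBounds.gibbsMeasure (F.P K) ((F.scheme ℰp γ).β K)) →
        (∀ K j, j < K → ν K j = Measure.map (descend F ℰp j) (ν K (j + 1))) →
        ∀ (K Ts : ℕ), Ts ≤ K → ∀ (μ : (j : ℕ) → Measure (GaugeField (F.P j) 0 (Matrix.specialUnitaryGroup (Fin 2) ℂ))),
          (∀ j, Ts ≤ j → μ j = ν K j) →
          (∀ j, j < Ts → μ j = Measure.map (descend F ℰp j) ((μ (j + 1)).withDensity (fun U => ENNReal.ofReal (sfCut (θBal F.L γ b₀ p₀ (j + 1)) U)))) →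
          ∃ ρ : (j : ℕ) → GaugeField (F.P j) 0 (Matrix.specialUnitaryGroup (Fin 2) ℂ) → ℝ,
            ∀ (j : ℕ) (hjK : j ≤ K), j₀ ≤ j →
              (∀ U, PlaqSmall (θBal F.L γ b₀ p₀ j) U → 0 < ρ j U) ∧
              μ j = (fieldMeasure _ _ _).withDensity (fun U => ENNReal.ofReal (ρ j U)) ∧
              (∃ κ : ℝ, MemOfRun F ℰp hjK (prm j) (fun U => Real.exp κ * ρ j U)) ∧
              ContinuousOn (ρ j) {U | PlaqSmall (θBal F.L γ b₀ p₀ j) U}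

/-- S1b · RUN WINDOW TAILS (per height, uniformly in the cut-off): the nested laws give Bałaban's window complement at height `j` a mass
`≤ η j`, summable in `j`, for every run `K ≥ j`.  Per block size this is the union bound over the FIRST-EXIT events of
`FirstExitWindow.FirstExitWindowTailL` (stmt 26243) summed over the finer heights; not printed as a probability estimate
([Balaban1985UV3] (71) p.46 gives the density-level large-field smallness). M given 26243 / L–XL outright. -/
def RunWindowTails : Prop :=
  ∃ pT : ℝ, 0 < pT ∧ ∀ (L : ℕ) (b₀ p₀ : ℝ), 0 < b₀ → pT ≤ p₀ → ∃ γ₁ : ℝ, 0 < γ₁ ∧ ∀ (F : T3Family) (γ : ℝ), F.L = L → 0 < γ → γ ≤ γ₁ →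
    ∃ η : ℕ → ℝ, (∀ j, 0 ≤ η j) ∧ Summable η ∧
      Summable (fun i => ∑' k, η (k + i)) ∧ Tendsto (fun j => (∑' k, η (k + j)) * ((1 + 2 * ((F.L : ℝ) ^ j / γ) * (Fintype.card (Plaq (F.P j) 0) : ℝ)) * (Fintype.card (PBond (F.P j) 0) : ℝ) ^ 2)) atTop (𝓝 0) ∧
      ∀ (ν : ℕ → (j : ℕ) → Measure (GaugeField (F.P j) 0 (Matrix.specialUnitaryGroup (Fin 2) ℂ))),
        (∀ K, ν K K = T4GenFunBounds.gibbsMeasure (F.P K) ((F.scheme ℰp γ).β K)) →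
        (∀ K j, j < K → ν K j = Measure.map (descend F ℰp j) (ν K (j + 1))) →
        ∀ (K j : ℕ), j ≤ K → ν K j {U | ¬ PlaqSmall (θBal F.L γ b₀ p₀ j) U} ≤ ENNReal.ofReal (η j)

/-- S2 · RUN-PAIR SEED (near-top universality, RATE-FREE): there are seed heights `J K ≤ K`, `J K → ∞`, and seed sizes `σ K → 0` with
`J K · σ K → 0`, such that for every pair of cut-offs `K ≤ K'` the log-ratio of the two runs' densities AT HEIGHT `J K` has `κ`-clustered
one-bond second differences `≤ σ K` on the window.  Mechanism: at depth `n = K − J K → ∞` below its own top, run `K`'s effective action is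
the `n`-step image of the Wilson action; two such images (depths `n ≤ n'`) differ by the tail `n ↦ ∞` of the CONVERGENT sequence of
`n`-step backgrounds / propagators ([Balaban1984PropagatorsI/II], [Balaban1985Variational]) plus irrelevant activities of size
`O(g_{J K}² p(g_{J K})^q)`; choosing `J K` adaptively (slowly) makes `J K · σ K → 0` WITHOUT any rate — only convergence is used.
Why it might fail: the convergence of the `n`-step quadratic forms is printed for propagators, not verbatim for the constrained minimal
ACTION as a functional of the window field (one-bond-oscillation currency). L. -/
def RunPairSeed : Prop :=
  ∀ (L : ℕ), ∃ pS : ℝ, ∀ (b₀ p₀ : ℝ), 0 < b₀ → pS ≤ p₀ → 0 < p₀ → ∃ γ₁ : ℝ, 0 < γ₁ ∧ ∃ κ : ℝ, 0 < κ ∧ ∀ (F : T3Family) (γ : ℝ), F.L = L → 0 < γ → γ ≤ γ₁ →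
    ∃ (J : ℕ → ℕ) (σ : ℕ → ℝ), (∀ K, 1 ≤ K → J K < K) ∧ (∀ K, J K ≤ K) ∧ Tendsto J atTop atTop ∧ (∀ K, 0 ≤ σ K) ∧
      Tendsto σ atTop (𝓝 0) ∧
      Tendsto (fun K => (J K : ℝ) * σ K) atTop (𝓝 0) ∧
      ∀ (ν : ℕ → (j : ℕ) → Measure (GaugeField (F.P j) 0 (Matrix.specialUnitaryGroup (Fin 2) ℂ))),
        (∀ K, ν K K = T4GenFunBounds.gibbsMeasure (F.P K) ((F.scheme ℰp γ).β K)) →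
        (∀ K j, j < K → ν K j = Measure.map (descend F ℰp j) (ν K (j + 1))) →
        ∀ (K K' : ℕ), K ≤ K' → ∀ (ρ₁ ρ₂ : GaugeField (F.P (J K)) 0 (Matrix.specialUnitaryGroup (Fin 2) ℂ) → ℝ),
          (∀ U, PlaqSmall (θBal F.L γ b₀ p₀ (J K)) U → 0 < ρ₁ U ∧ 0 < ρ₂ U) →
          ν K (J K) = (fieldMeasure _ _ _).withDensity (fun U => ENNReal.ofReal (ρ₁ U)) →
          ν K' (J K) = (fieldMeasure _ _ _).withDensity (fun U => ENNReal.ofReal (ρ₂ U)) →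
          ContinuousOn ρ₁ {U | PlaqSmall (θBal F.L γ b₀ p₀ (J K)) U} →
          ContinuousOn ρ₂ {U | PlaqSmall (θBal F.L γ b₀ p₀ (J K)) U} →
          ∀ (b b' : PBond (F.P (J K)) 0) (U V W Z : GaugeField (F.P (J K)) 0 (Matrix.specialUnitaryGroup (Fin 2) ℂ)),
            PlaqSmall (θBal F.L γ b₀ p₀ (J K)) U → PlaqSmall (θBal F.L γ b₀ p₀ (J K)) V →
            PlaqSmall (θBal F.L γ b₀ p₀ (J K)) W → PlaqSmall (θBal F.L γ b₀ p₀ (J K)) Z →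
            (∀ e, e ≠ b → U e = V e) → (∀ e, e ≠ b' → U e = W e) → (∀ e, e ≠ b' → V e = Z e) → (∀ e, e ≠ b → W e = Z e) →
            |(Real.log (ρ₁ U) - Real.log (ρ₂ U)) - (Real.log (ρ₁ V) - Real.log (ρ₂ V)) -
                ((Real.log (ρ₁ W) - Real.log (ρ₂ W)) - (Real.log (ρ₁ Z) - Real.log (ρ₂ Z)))|
              ≤ σ K * Real.exp (-(κ * (b.src.tdist b'.src : ℝ)))

/-- S2α · CLASSICAL TWO-DEPTH EQUILIBRATION (L; the load-bearing half of the seed S2 — v6 stage table): at EVERY height `J` the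
constrained minimal Wilson actions of two runs `K ≤ K'` over the SAME height-`J` datum, each in its own inverse temperature
(`β_K · minActionRegPr F J K`, print's minimum (8) over the regular space (6) [Balaban1985Variational]), have κ-clustered connected
4-point DISCREPANCY on Bałaban's window bounded by `P J · τ (K - J)`: an ARBITRARY height profile `P ≥ 0` (no uniformity in `J` is asked —
the diagonal schedule below absorbs any growth) times an antitone null DEPTH rate `τ`.  Heuristic: `β_K·min_{J,K} = β_J·Q_{K−J}` with the
`n`-step effective quadratic forms `Q_n → Q_∞` geometrically in `n` ([Balaban1985PropagatorsII] (1.33), convergence of the `k`-step Green's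
functions; abelian: [King1986] Prop. 3.10, in-tree `King1986.EffectiveLaplacianRate.prop310_uniform_bound`); second differences under
window moves `θ_J` give `P J ≈ C·p(g_J)²`, `τ n ≈ L^{-cn}`.  Classical ONLY: no densities, no laws.  Why it might fail: the printed convergence
is for the propagators / the linearisation, not verbatim for the NON-LINEAR constrained minimum over print's space (6) in 4-point currency,
and it needs the analyticity domain of `U_k(V)` ([Balaban1985Variational] Thm 1) uniform in `k` on the whole window. -/
def ClassicalTwoDepth : Prop :=
  ∀ (L : ℕ) (b₀ p₀ : ℝ), 0 < b₀ → 0 < p₀ → ∃ ε₁ : ℝ, 0 < ε₁ ∧ ∀ (ε₀ : ℝ), 0 < ε₀ → ε₀ ≤ ε₁ →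
    ∃ γ₁ : ℝ, 0 < γ₁ ∧ ∃ κ : ℝ, 0 < κ ∧ ∀ (F : T3Family) (γ : ℝ), F.L = L → 0 < γ → γ ≤ γ₁ →
      ∃ (P τ : ℕ → ℝ), (∀ n, 0 ≤ P n) ∧ (∀ n, 0 ≤ τ n) ∧ Antitone τ ∧ Tendsto τ atTop (𝓝 0) ∧
        ∀ (J K K' : ℕ) (hJK : J ≤ K) (hJK' : J ≤ K'), K ≤ K' →
          ∀ (b b' : PBond (F.P J) 0) (U V W Z : GaugeField (F.P J) 0 (Matrix.specialUnitaryGroup (Fin 2) ℂ)),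
            PlaqSmall (θBal F.L γ b₀ p₀ J) U → PlaqSmall (θBal F.L γ b₀ p₀ J) V →
            PlaqSmall (θBal F.L γ b₀ p₀ J) W → PlaqSmall (θBal F.L γ b₀ p₀ J) Z →
            (∀ e, e ≠ b → U e = V e) → (∀ e, e ≠ b' → U e = W e) → (∀ e, e ≠ b' → V e = Z e) → (∀ e, e ≠ b → W e = Z e) →
            |((F.scheme ℰp γ).β K * minActionRegPr F J K hJK ε₀ U - (F.scheme ℰp γ).β K' * minActionRegPr F J K' hJK' ε₀ U)
              - ((F.scheme ℰp γ).β K * minActionRegPr F J K hJK ε₀ V - (F.scheme ℰp γ).β K' * minActionRegPr F J K' hJK' ε₀ V)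
              - (((F.scheme ℰp γ).β K * minActionRegPr F J K hJK ε₀ W - (F.scheme ℰp γ).β K' * minActionRegPr F J K' hJK' ε₀ W)
                - ((F.scheme ℰp γ).β K * minActionRegPr F J K hJK ε₀ Z - (F.scheme ℰp γ).β K' * minActionRegPr F J K' hJK' ε₀ Z))|
              ≤ P J * τ (K - J) * Real.exp (-(κ * (b.src.tdist b'.src : ℝ)))

/-- S2α′ · CLASSICAL PER-HEIGHT EQUILIBRATION (L; v9 — the PLAIN form of S2α identified by idea-crit-5 #207(a)): at EVERY FIXED height `J`
the 4-point window discrepancy of the two runs' tree-level parts `β_K · minActionRegPr F J K` (print's constrained minimum (8) over the regular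
space (6) [Balaban1985Variational]) is bounded by a NULL DEPTH PROFILE `A_J (K − J)` of that height: `A_J ≥ 0`, `A_J → 0` — no uniformity in
`J`, no clustering factor, nothing else.  `classicalTwoDepth_of_perHeight` below PROVES S2α from it (tail suprema `Ā_J`, weights
`2^{-J}/(Ā_J 0 + 1)`, one summed antitone rate `τ` by dominated convergence, the clustering factor absorbed into `P J` through the finite
diameter of `PBond (F.P J) 0`).  This is the classical per-height convergence of renormalised constrained minima ([Balaban1985Variational] Thm 1,
[Balaban1985PropagatorsII] (1.33) for the quadratic part; abelian: `King1986.EffectiveLaplacianRate.prop310_uniform_bound`).  Why it might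
fail: as S2α — the printed convergence is for the propagators / the linearisation, not verbatim for the NON-LINEAR constrained minimum in
4-point currency on the whole window (analyticity domain of `U_k(V)` uniform in `k`); and boundedness of the discrepancy at SMALL depths is part
of the claim (`A_J 0 < ∞`), not only the Cauchy tail. -/
def ClassicalPerHeight : Prop :=
  ∀ (L : ℕ) (b₀ p₀ : ℝ), 0 < b₀ → 0 < p₀ → ∃ ε₁ : ℝ, 0 < ε₁ ∧ ∀ (ε₀ : ℝ), 0 < ε₀ → ε₀ ≤ ε₁ →
    ∃ γ₁ : ℝ, 0 < γ₁ ∧ ∀ (F : T3Family) (γ : ℝ), F.L = L → 0 < γ → γ ≤ γ₁ →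
      ∀ J : ℕ, ∃ A : ℕ → ℝ, (∀ n, 0 ≤ A n) ∧ Tendsto A atTop (𝓝 0) ∧
        ∀ (K K' : ℕ) (hJK : J ≤ K) (hJK' : J ≤ K'), K ≤ K' →
          ∀ (b b' : PBond (F.P J) 0) (U V W Z : GaugeField (F.P J) 0 (Matrix.specialUnitaryGroup (Fin 2) ℂ)),
            PlaqSmall (θBal F.L γ b₀ p₀ J) U → PlaqSmall (θBal F.L γ b₀ p₀ J) V →
            PlaqSmall (θBal F.L γ b₀ p₀ J) W → PlaqSmall (θBal F.L γ b₀ p₀ J) Z →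
            (∀ e, e ≠ b → U e = V e) → (∀ e, e ≠ b' → U e = W e) → (∀ e, e ≠ b' → V e = Z e) → (∀ e, e ≠ b → W e = Z e) →
            |((F.scheme ℰp γ).β K * minActionRegPr F J K hJK ε₀ U - (F.scheme ℰp γ).β K' * minActionRegPr F J K' hJK' ε₀ U)
              - ((F.scheme ℰp γ).β K * minActionRegPr F J K hJK ε₀ V - (F.scheme ℰp γ).β K' * minActionRegPr F J K' hJK' ε₀ V)
              - (((F.scheme ℰp γ).β K * minActionRegPr F J K hJK ε₀ W - (F.scheme ℰp γ).β K' * minActionRegPr F J K' hJK' ε₀ W)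
                - ((F.scheme ℰp γ).β K * minActionRegPr F J K hJK ε₀ Z - (F.scheme ℰp γ).β K' * minActionRegPr F J K' hJK' ε₀ Z))|
              ≤ A (K - J)

/-- S2β · FLUCTUATION PART SMALL IN 4-POINT CURRENCY (M–L; ONE run, CRUDE — no convergence in the depth is asked): for every run `K` and
height `J ≤ K`, the window log-density of the nested law MINUS its tree-level part, `log ρ + β_K · minActionRegPr F J K` ([Balaban1985UV3]
(41) expands around exactly this background), has κ-clustered connected 4-point size `≤ φ J` on the window, uniformly in the depth `K − J`,
with `J · φ J → 0`, for EVERY positive continuous density representative (representative-independent: two continuous versions agree on the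
window).  Heuristic: all quantum activities — the one-loop determinants included — are smooth local functionals with `O(1)` second derivatives
per unit volume in lattice units ([Balaban1985UV3] (45)–(47), [Balaban1988LargeField] (19)–(24)), so second differences under window moves are
`O(θ_J²·p^q) = O(γ L^{-J} p(g_J)^{q+2})` and `J·φ J → 0` with room to spare.  This is where the seed is CHEAP (B-9: at a height `J K → ∞`
anything `o(1/J)` suffices; no loop order has to converge).  Why it might fail: uniformity in the depth of the SECOND differences of the
activities (printed as bounds on the activities themselves, [Balaban1985UV3] (46)), and the large-field contributions to the window density
(relative weight `e^{-c p(g_j)²}` summed over heights above `J`, [Balaban1988LargeField] (24)) must also be `o(1/J)` in 4-point currency.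
WHERE THE EXTRA DERIVATIVE COMES FROM (idea-crit-5 #207 (ii), for the reader's docstring): the printed effective interaction terms
`ℰ^(k)(g₀, X, U₁)` are (a) gauge invariant (26), (b) localised in `X̃`, and (c) ANALYTIC in the coarse field `U₁` on the complexified small-field
window — [Balaban1985UV3] p.263, «the third property is the analyticity with respect to U₁ … these properties follow from the results of previous
papers» — with the sup-bounds (45)–(47) holding on that complex neighbourhood; one-bond SECOND differences of `log ρ + β_K·minAction` are then
Cauchy estimates (two derivatives × move size `θ_J`) applied term by term to the cluster expansion, the `e^{-κ·dist}` factor being the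
localisation (b) summed over clusters containing both bonds; the explicit one-loop determinant is differentiated through the background-field
propagator bounds of [Balaban1985-cmp99 «Propagators for lattice gauge theories in a background field»].  The reader must display the ratio
(move size / analyticity radius) at each height — if it is not small, the gain is only the sup-size of the `U₁`-DEPENDENT irrelevant terms. -/
def FluctuationPartSmall : Prop :=
  ∀ (L : ℕ), ∃ pS : ℝ, ∀ (b₀ p₀ : ℝ), 0 < b₀ → pS ≤ p₀ → 0 < p₀ → ∃ ε₁ : ℝ, 0 < ε₁ ∧ ∀ (ε₀ : ℝ), 0 < ε₀ → ε₀ ≤ ε₁ →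
    ∃ γ₁ : ℝ, 0 < γ₁ ∧ ∃ κ : ℝ, 0 < κ ∧ ∀ (F : T3Family) (γ : ℝ), F.L = L → 0 < γ → γ ≤ γ₁ →
      ∃ (φ : ℕ → ℝ), (∀ J, 0 ≤ φ J) ∧ Tendsto (fun J : ℕ => (J : ℝ) * φ J) atTop (𝓝 0) ∧
        ∀ (ν : ℕ → (j : ℕ) → Measure (GaugeField (F.P j) 0 (Matrix.specialUnitaryGroup (Fin 2) ℂ))),
          (∀ K, ν K K = T4GenFunBounds.gibbsMeasure (F.P K) ((F.scheme ℰp γ).β K)) →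
          (∀ K j, j < K → ν K j = Measure.map (descend F ℰp j) (ν K (j + 1))) →
          ∀ (J K : ℕ) (hJK : J ≤ K) (ρ : GaugeField (F.P J) 0 (Matrix.specialUnitaryGroup (Fin 2) ℂ) → ℝ),
            (∀ U, PlaqSmall (θBal F.L γ b₀ p₀ J) U → 0 < ρ U) →
            ν K J = (fieldMeasure _ _ _).withDensity (fun U => ENNReal.ofReal (ρ U)) →
            ContinuousOn ρ {U | PlaqSmall (θBal F.L γ b₀ p₀ J) U} →
            ∀ (b b' : PBond (F.P J) 0) (U V W Z : GaugeField (F.P J) 0 (Matrix.specialUnitaryGroup (Fin 2) ℂ)),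
              PlaqSmall (θBal F.L γ b₀ p₀ J) U → PlaqSmall (θBal F.L γ b₀ p₀ J) V →
              PlaqSmall (θBal F.L γ b₀ p₀ J) W → PlaqSmall (θBal F.L γ b₀ p₀ J) Z →
              (∀ e, e ≠ b → U e = V e) → (∀ e, e ≠ b' → U e = W e) → (∀ e, e ≠ b' → V e = Z e) → (∀ e, e ≠ b → W e = Z e) →
              |((Real.log (ρ U) + (F.scheme ℰp γ).β K * minActionRegPr F J K hJK ε₀ U)
                  - (Real.log (ρ V) + (F.scheme ℰp γ).β K * minActionRegPr F J K hJK ε₀ V))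
                - ((Real.log (ρ W) + (F.scheme ℰp γ).β K * minActionRegPr F J K hJK ε₀ W)
                  - (Real.log (ρ Z) + (F.scheme ℰp γ).β K * minActionRegPr F J K hJK ε₀ Z))|
                ≤ φ J * Real.exp (-(κ * (b.src.tdist b'.src : ℝ)))

/-- S3 · BACKWARD STABILITY ON FINITE RUNS, UNIFORM CONSTANTS (the ORGAN of route BackwardLiouvilleRigidity in its run-pair form): the
statement of `BackwardStabilityAdm` (stmt 23331) with (i) the towers only required to be consistent up to a finite TOP `T` and in the
admissible class on `j₀ ≤ j ≤ T`, (ii) the `κ`-clustered 4-point hypothesis only AT the top `T` (size `ωT`), and (iii) the constants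
`θ, C, w₀, ε, δ, j₁` chosen BEFORE the pair of towers (uniformity over pairs — automatic for any structural proof of the one-step organ
23156, whose registered lines `organ_fibre_laplace` / `backward_stability_adm` produce class constants), and (iv, v5) the tails
profile `η` hypothesised in the FLOOR CLASS (KT-η repair), and (v, v8 = repair R2 of width seat ym-line-sfw-p2-w3 g32) the towers carried
STRICTLY ABOVE the seed height: `∀ T Tt, T < Tt →` with consistency / class clauses up to `Tt` (O1's input at `T` is then the descent of
admissible height-`T+1` data, B-8(a); in the composition `Tt :=` the run's cut-off `K > J K`, for infinite towers `Tt := T + 1`).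
v16 text = `Summit.QuantumFields.YangMills.Theorems.FluctuationComparisonRegPrIntL.RunPairOrgan.BackwardStabilityFinSup` (p683255), kept below as
`BackwardStabilityFinSupGen`.  v17 (R-c + R-a): ANCHORED to the run family `ν` and a pair `K ≤ K'`, block top `Tt ≤ K`, towers = the runs on
`[T, Tt]` and their SF-projections below the seed∕input height `T` (cut-consistency); per-height clauses, the top 4-point hypothesis and the
one-bond conclusion BYTE-IDENTICAL to v16; membership clauses modulo constants (R-n4, as in O1).  DERIVED from O1 + FC
(`backwardStabilityFinSup_of_stubs`).  NOT PRINTED. XL. -/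
def BackwardStabilityFinSup : Prop :=
  ∃ γ₁ : ℝ, 0 < γ₁ ∧ ∀ (F : T3Family) (γ : ℝ), 0 < γ → γ ≤ γ₁ → ∀ (b₀ p₀ κ : ℝ) (j₀ : ℕ) (prm : ℕ → ClassParams) (η : ℕ → ℝ), 0 < b₀ → 0 < p₀ → AdmissibleClassParams F γ b₀ p₀ prm → 0 < κ → (∀ j, 0 ≤ η j) → Summable η → Summable (fun i => ∑' k, η (k + i)) → Tendsto (fun j => (∑' k, η (k + j)) * ((1 + 2 * ((F.L : ℝ) ^ j / γ) * (Fintype.card (Plaq (F.P j) 0) : ℝ)) * (Fintype.card (PBond (F.P j) 0) : ℝ) ^ 2)) atTop (𝓝 0) → ∃ (θ C w₀ : ℝ) (ε δ : ℕ → ℝ) (j₁ : ℕ), 0 < θ ∧ 0 ≤ C ∧ 0 < w₀ ∧ (∀ j, 0 ≤ ε j ∧ 0 ≤ δ j) ∧ Summable ε ∧ Summable δ ∧ Summable (fun i => ∑' k, δ (k + i)) ∧ Tendsto (fun j => (∑' k, δ (k + j)) * ((1 + 2 * ((F.L : ℝ) ^ j / γ) * (Fintype.card (Plaq (F.P j)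 0) : ℝ)) * (Fintype.card (PBond (F.P j) 0) : ℝ) ^ 2)) atTop (𝓝 0) ∧ j₀ ≤ j₁ ∧ ∀ (ν : ℕ → (j : ℕ) → MeasureTheory.Measure (GaugeField (F.P j) 0 ↥(Matrix.specialUnitaryGroup (Fin 2) ℂ))), (∀ K, ν K K = T4GenFunBounds.gibbsMeasure (F.P K) ((F.scheme ℰp γ).β K)) → (∀ K j, j < K → ν K j = Measure.map (descend F ℰp j) (ν K (j + 1))) → ∀ (K K' : ℕ), K ≤ K' → ∀ (T Tt : ℕ) (ωT : ℝ), T < Tt → Tt ≤ K → 0 ≤ ωT → ∀ (μ μ' : ((j : ℕ) → MeasureTheory.Measure (GaugeField (F.P j) 0 ↥(Matrix.specialUnitaryGroup (Fin 2) ℂ)))) (ρ ρ' : ((j : ℕ) → GaugeField (F.P j) 0 ↥(Matrix.specialUnitaryGroup (Fin 2) ℂ) → ℝ)), (∀ j : ℕ, T ≤ j → j ≤ Tt → μ j = ν K j ∧ μ' j = ν K' j) → (∀ j : ℕ, j < T → μ j = Measure.map (descend F ℰp j) ((μ (j + 1)).withDensity (fun U => ENNReal.ofReal (sfCut (θBal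 F.L γ b₀ p₀ (j + 1)) U))) ∧ μ' j = Measure.map (descend F ℰp j) ((μ' (j + 1)).withDensity (fun U => ENNReal.ofReal (sfCut (θBal F.L γ b₀ p₀ (j + 1)) U)))) → (∀ j : ℕ, T ≤ j → j < Tt → μ j = Measure.map (descend F ℰp j) (μ (j + 1)) ∧ μ' j = Measure.map (descend F ℰp j) (μ' (j + 1))) → (∀ j : ℕ, j ≤ Tt → IsFiniteMeasure (μ j) ∧ IsFiniteMeasure (μ' j)) → (∀ j : ℕ, j₀ ≤ j → j ≤ Tt → ((∀ U, PlaqSmall (θBal F.L γ b₀ p₀ j) U → 0 < ρ j U ∧ 0 < ρ' j U) ∧ μ j = (fieldMeasure _ _ _).withDensity (fun U => ENNReal.ofReal (ρ j U)) ∧ μ' j = (fieldMeasure _ _ _).withDensity (fun U => ENNReal.ofReal (ρ' j U)) ∧ (∃ κ : ℝ, MemAtHeight F ℰp j (prm j) (fun U => Real.exp κ * ρ j U)) ∧ (∃ κ : ℝ, MemAtHeight F ℰp j (prm j) (fun U => Real.exp κ * ρ' j U)) ∧ μ j {U | ¬ PlaqSmall (θBal F.L γ b₀ p₀ j) U} ≤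 ENNReal.ofReal (η j) ∧ μ' j {U | ¬ PlaqSmall (θBal F.L γ b₀ p₀ j) U} ≤ ENNReal.ofReal (η j) ∧ (ContinuousOn (ρ j) {U | PlaqSmall (θBal F.L γ b₀ p₀ j) U} ∧ ContinuousOn (ρ' j) {U | PlaqSmall (θBal F.L γ b₀ p₀ j) U}))) → (∀ (b b' : PBond (F.P T) 0) U V W Z, PlaqSmall (θBal F.L γ b₀ p₀ T) U → PlaqSmall (θBal F.L γ b₀ p₀ T) V → PlaqSmall (θBal F.L γ b₀ p₀ T) W → PlaqSmall (θBal F.L γ b₀ p₀ T) Z → (∀ e, e ≠ b → U e = V e) → (∀ e, e ≠ b' → U e = W e) → (∀ e, e ≠ b' → V e = Z e) → (∀ e, e ≠ b → W e = Z e) → |(Real.log (ρ T U) - Real.log (ρ' T U)) - (Real.log (ρ T V) - Real.log (ρ' T V)) - ((Real.log (ρ T W) - Real.log (ρ' T W)) - (Real.log (ρ T Z) - Real.log (ρ' T Z)))| ≤ ωT * Real.exp (-(κ * (b.src.tdist b'.src : ℝ)))) → ∀ (j : ℕ), j₁ ≤ j → j ≤ T → Real.exp (∑' k, ε k + 1)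 * (θ * ωT + (∑' k, δ (k + j))) ≤ w₀ → C * (Real.exp (∑' k, ε k + 1) * ((T : ℝ) * (θ * ωT) + (∑' i, ∑' k, δ (k + (i + j))))) ≤ 1 → ∀ (b : PBond (F.P j) 0) U V, PlaqSmall (θBal F.L γ b₀ p₀ j) U → PlaqSmall (θBal F.L γ b₀ p₀ j) V → (∀ e, e ≠ b → U e = V e) → |(Real.log (ρ j U) - Real.log (ρ' j U)) - (Real.log (ρ j V) - Real.log (ρ' j V))| ≤ Real.exp (∑' k, ε k + 1) * (θ * ωT + (∑' k, δ (k + j))) * (1 / θ + 2 * ((F.L : ℝ) ^ j / γ) * (Fintype.card (Plaq (F.P j) 0) : ℝ))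

/-- S3-GEN · the v16 ALL-TOWER text of S3, kept for the record and for the BLR edge `backwardStabilityAdmF_of_gen` (23877 BY NAME).
NOT derived in v17 (it would need the generic one-step organ, which typing note D25-8 reads as vacuous-or-false as typed); no stub asserts it. -/
def BackwardStabilityFinSupGen : Prop :=
  ∃ γ₁ : ℝ, 0 < γ₁ ∧ ∀ (F : T3Family) (γ : ℝ), 0 < γ → γ ≤ γ₁ → ∀ (b₀ p₀ κ : ℝ) (j₀ : ℕ) (prm : ℕ → ClassParams) (η : ℕ → ℝ), 0 < b₀ → 0 < p₀ → AdmissibleClassParams F γ b₀ p₀ prm → 0 < κ → (∀ j, 0 ≤ η j) → Summable η → Summable (fun i => ∑' k, η (k + i)) → Tendsto (fun j => (∑' k, η (k + j)) * ((1 + 2 * ((F.L : ℝ) ^ j / γ) * (Fintype.card (Plaq (F.P j) 0) : ℝ)) * (Fintype.card (PBond (F.P j) 0) : ℝ) ^ 2)) atTop (𝓝 0) → ∃ (θ C w₀ : ℝ) (ε δ : ℕ → ℝ) (j₁ : ℕ), 0 < θ ∧ 0 ≤ C ∧ 0 < w₀ ∧ (∀ j, 0 ≤ ε j ∧ 0 ≤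 δ j) ∧ Summable ε ∧ Summable δ ∧ Summable (fun i => ∑' k, δ (k + i)) ∧ Tendsto (fun j => (∑' k, δ (k + j)) * ((1 + 2 * ((F.L : ℝ) ^ j / γ) * (Fintype.card (Plaq (F.P j) 0) : ℝ)) * (Fintype.card (PBond (F.P j) 0) : ℝ) ^ 2)) atTop (𝓝 0) ∧ j₀ ≤ j₁ ∧ ∀ (T Tt : ℕ) (ωT : ℝ), T < Tt → 0 ≤ ωT → ∀ (μ μ' : ((j : ℕ) → MeasureTheory.Measure (GaugeField (F.P j) 0 ↥(Matrix.specialUnitaryGroup (Fin 2) ℂ)))) (ρ ρ' : ((j : ℕ) → GaugeField (F.P j) 0 ↥(Matrix.specialUnitaryGroup (Fin 2) ℂ) → ℝ)), (∀ j : ℕ, j ≤ Tt → IsProbabilityMeasure (μ j) ∧ IsProbabilityMeasure (μ' j)) → (∀ j : ℕ, j < Tt → μ j = Measure.map (descend F ℰp j) (μ (j + 1)) ∧ μ' j = Measure.map (descend F ℰp j) (μ' (j + 1))) → (∀ j : ℕ, j₀ ≤ j → j ≤ Tt → ((∀ U, PlaqSmall (θBal F.L γ b₀ p₀ j) U → 0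 < ρ j U ∧ 0 < ρ' j U) ∧ μ j = (fieldMeasure _ _ _).withDensity (fun U => ENNReal.ofReal (ρ j U)) ∧ μ' j = (fieldMeasure _ _ _).withDensity (fun U => ENNReal.ofReal (ρ' j U)) ∧ MemAtHeight F ℰp j (prm j) (ρ j) ∧ MemAtHeight F ℰp j (prm j) (ρ' j) ∧ μ j {U | ¬ PlaqSmall (θBal F.L γ b₀ p₀ j) U} ≤ ENNReal.ofReal (η j) ∧ μ' j {U | ¬ PlaqSmall (θBal F.L γ b₀ p₀ j) U} ≤ ENNReal.ofReal (η j) ∧ (ContinuousOn (ρ j) {U | PlaqSmall (θBal F.L γ b₀ p₀ j) U} ∧ ContinuousOn (ρ' j) {U | PlaqSmall (θBal F.L γ b₀ p₀ j) U}))) → (∀ (b b' : PBond (F.P T) 0) U V W Z, PlaqSmall (θBal F.L γ b₀ p₀ T) U → PlaqSmall (θBal F.L γ b₀ p₀ T) V → PlaqSmall (θBal F.L γ b₀ p₀ T) W → PlaqSmall (θBal F.L γ b₀ p₀ T) Z → (∀ e, e ≠ b → U e = V e) → (∀ e, e ≠ b' → U e = W e) → (∀ e, e ≠ b' → V e = Z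 e) → (∀ e, e ≠ b → W e = Z e) → |(Real.log (ρ T U) - Real.log (ρ' T U)) - (Real.log (ρ T V) - Real.log (ρ' T V)) - ((Real.log (ρ T W) - Real.log (ρ' T W)) - (Real.log (ρ T Z) - Real.log (ρ' T Z)))| ≤ ωT * Real.exp (-(κ * (b.src.tdist b'.src : ℝ)))) → ∀ (j : ℕ), j₁ ≤ j → j ≤ T → Real.exp (∑' k, ε k + 1) * (θ * ωT + (∑' k, δ (k + j))) ≤ w₀ → C * (Real.exp (∑' k, ε k + 1) * ((T : ℝ) * (θ * ωT) + (∑' i, ∑' k, δ (k + (i + j))))) ≤ 1 → ∀ (b : PBond (F.P j) 0) U V, PlaqSmall (θBal F.L γ b₀ p₀ j) U → PlaqSmall (θBal F.L γ b₀ p₀ j) V → (∀ e, e ≠ b → U e = V e) → |(Real.log (ρ j U) - Real.log (ρ' j U)) - (Real.log (ρ j V) - Real.log (ρ' j V))| ≤ Real.exp (∑' k, ε k + 1) * (θ * ωT + (∑' k, δ (k + j))) * (1 / θ + 2 * ((F.L : ℝ) ^ j / γ) * (Fintype.card (Plaq (F.P j) 0) : ℝ))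

/-- O1 · LOCAL ONE-STEP ORGAN ON FINITE TOWERS (g15 cut of S3; the organ reader's target).  UNIFORM constants
`θ, C, w₀, ε, εd, δ, j₁` (chosen before the towers), towers consistent and A♯-admissible on `[j₀, T]`, the step `j+1 → j` demanded only
for `j + 2 ≤ T` (the input at `j+1` is itself a descent of admissible height-`j+2` data: B-8(a) «a proof must use membership at two
consecutive heights»), input/output in the (c, a, w) currency of 23156 but with the irrelevant size `w` weighted in MARGINAL UNITS
`θ·w/(β_{j}θBal_j²) = θ·w/p(g_j)²` (KT-W: with a fixed absolute weight a Wilson-exact input jumps by `θ·m₁·p(g_j)²`; in marginal units the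
jump is the one-time `O(1)` loss `εd 0`), and losses `ε j` (height: one-loop coupling discrepancy `O(γL^{-j})`) PLUS `εd (T−(j+2))`
(DEPTH below the top: equilibration of the off-Wilson quadratic form, `‖Q_{n+1} − Q_n‖ = O(L^{-2n})`, [Balaban1984PropagatorsII],
[Balaban1985Variational]) — both summable — and a floor `δ` in the super-polynomial class, with the tails profile `η` hypothesised in the
SAME class (KT-η repair, `KT-ETA-summable-tails-g15.md`).  Why it might fail: the irrelevant→marginal mixing constant must be `O(1)` in
marginal units uniformly on the window (else no uniform θ), and the depth loss must not depend on the height.  XL.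
v16 (g25; LEAD WORD 16:09:38Z; typing note P25-1 «κ-CEILING»): the clustering rate is CAPPED — `∃ κ₀ > 0` (class constant = the response rate
`κ_cl(L)` of the step, chosen before `κ` and before the towers) and the step is claimed only for `0 < κ ≤ κ₀`, the SAME `κ` in the input clause
(height `j+1`) and the output clause (height `j`) as before.  FL-17's `κ*_∞(L)` (instrument, GUIDANCE) is the number `κ₀` would be typed from.
v17 (g25; ★★OWNER №139, LEAD w3 g22; typing note D25-8 «lf-transplant»): R-c — ANCHORED to the run family `ν` (tops = Gibbs, descents) and a pair
`K ≤ K'`; R-a — towers = the runs on `[Ts, T]` (`Ts` = seed height, `T ≤ K` = block top) and their SMALL-FIELD PROJECTIONS below `Ts`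
(cut-consistency `μ j = descend_* (sfCut θ_{j+1} · μ (j+1))`, v17.1 smooth cut), the step asked only for `j + 1 ≤ Ts`; per-height clauses and the
(c, a, w) input∕output texts byte-identical to v16 (they now read in PATH B's `h^{sf}` currency: `ρ_j = ∫ sfCut_{j+1}·ρ_{j+1} dσ`);
R-n4 (critic g14 #527 Q1) — the two class-membership clauses of the window block read MODULO A CONSTANT FACTOR
(`∃ κ, MemAtHeight … (e^κ·ρ_j)`): normalised densities cannot be members from a height on (`large`∕`stability` vs. window volume). -/
def OneStepContractionRun : Prop :=
  ∃ γ₁ : ℝ, 0 < γ₁ ∧ ∀ (F : T3Family) (γ : ℝ), 0 < γ → γ ≤ γ₁ → ∀ (b₀ p₀ : ℝ) (j₀ : ℕ) (prm : ℕ → ClassParams) (η : ℕ → ℝ), 0 < b₀ → 0 < p₀ → AdmissibleClassParams F γ b₀ p₀ prm → (∀ j, 0 ≤ η j) → Summable η → Summable (fun i => ∑' k, η (k + i)) → Tendsto (fun j => (∑' k, η (k + j)) * ((1 + 2 * ((F.L : ℝ) ^ j / γ) * (Fintype.card (Plaq (F.P j) 0) : ℝ)) * (Fintype.card (PBond (F.P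 j) 0) : ℝ) ^ 2)) atTop (𝓝 0) → ∃ κ₀ : ℝ, 0 < κ₀ ∧ ∀ (κ : ℝ), 0 < κ → κ ≤ κ₀ → ∃ (θ C w₀ : ℝ) (ε εd δ : ℕ → ℝ) (j₁ : ℕ), 0 < θ ∧ 0 ≤ C ∧ 0 < w₀ ∧ (∀ j, 0 ≤ ε j ∧ 0 ≤ εd j ∧ 0 ≤ δ j) ∧ Summable ε ∧ Summable εd ∧ Summable δ ∧ Summable (fun i => ∑' k, δ (k + i)) ∧ Tendsto (fun j => (∑' k, δ (k + j)) * ((1 + 2 * ((F.L : ℝ) ^ j / γ) * (Fintype.card (Plaq (F.P j) 0) : ℝ)) * (Fintype.card (PBond (F.P j) 0) : ℝ) ^ 2)) atTop (𝓝 0) ∧ j₀ ≤ j₁ ∧ ∀ (ν : ℕ → (j : ℕ) → MeasureTheory.Measure (GaugeField (F.P j) 0 ↥(Matrix.specialUnitaryGroup (Fin 2) ℂ))), (∀ K, ν K K = T4GenFunBounds.gibbsMeasure (F.P K) ((F.scheme ℰp γ).β K)) → (∀ K j, j < K → ν K j = Measure.map (descend F ℰp j) (ν K (j + 1))) → ∀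 (K K' : ℕ), K ≤ K' → ∀ (Ts T : ℕ), Ts < T → T ≤ K → ∀ (μ μ' : ((j : ℕ) → MeasureTheory.Measure (GaugeField (F.P j) 0 ↥(Matrix.specialUnitaryGroup (Fin 2) ℂ)))) (ρ ρ' : ((j : ℕ) → GaugeField (F.P j) 0 ↥(Matrix.specialUnitaryGroup (Fin 2) ℂ) → ℝ)), (∀ j : ℕ, Ts ≤ j → j ≤ T → μ j = ν K j ∧ μ' j = ν K' j) → (∀ j : ℕ, j < Ts → μ j = Measure.map (descend F ℰp j) ((μ (j + 1)).withDensity (fun U => ENNReal.ofReal (sfCut (θBal F.L γ b₀ p₀ (j + 1)) U))) ∧ μ' j = Measure.map (descend F ℰp j) ((μ' (j + 1)).withDensity (fun U => ENNReal.ofReal (sfCut (θBal F.L γ b₀ p₀ (j + 1)) U)))) → (∀ j : ℕ, Ts ≤ j → j < T → μ j = Measure.map (descend F ℰp j) (μ (j + 1)) ∧ μ' j = Measure.map (descend F ℰp j) (μ' (j + 1))) → (∀ j : ℕ, j ≤ T → IsFiniteMeasure (μ j) ∧ IsFiniteMeasure (μ' j)) → (∀ j : ℕ, j₀ ≤ j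 → j ≤ T → ((∀ U, PlaqSmall (θBal F.L γ b₀ p₀ j) U → 0 < ρ j U ∧ 0 < ρ' j U) ∧ μ j = (fieldMeasure _ _ _).withDensity (fun U => ENNReal.ofReal (ρ j U)) ∧ μ' j = (fieldMeasure _ _ _).withDensity (fun U => ENNReal.ofReal (ρ' j U)) ∧ (∃ κ : ℝ, MemAtHeight F ℰp j (prm j) (fun U => Real.exp κ * ρ j U)) ∧ (∃ κ : ℝ, MemAtHeight F ℰp j (prm j) (fun U => Real.exp κ * ρ' j U)) ∧ μ j {U | ¬ PlaqSmall (θBal F.L γ b₀ p₀ j) U} ≤ ENNReal.ofReal (η j) ∧ μ' j {U | ¬ PlaqSmall (θBal F.L γ b₀ p₀ j) U} ≤ ENNReal.ofReal (η j) ∧ (ContinuousOn (ρ j) {U | PlaqSmall (θBal F.L γ b₀ p₀ j) U} ∧ ContinuousOn (ρ' j) {U | PlaqSmall (θBal F.L γ b₀ p₀ j) U}))) → ∀ (j : ℕ), j₁ ≤ j → j + 2 ≤ T → j + 1 ≤ Ts → ∀ (c : Plaq (F.P (j + 1)) 0 → ℝ) (a w : ℝ), 0 ≤ a → 0 ≤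 w → a + θ / (((F.L : ℝ) ^ (j + 1) / γ) * θBal F.L γ b₀ p₀ (j + 1) ^ 2) * w ≤ w₀ → ((∀ p, |c p| ≤ a) ∧ (∀ (b b' : PBond (F.P (j + 1)) 0) U V W Z, PlaqSmall (θBal F.L γ b₀ p₀ (j + 1)) U → PlaqSmall (θBal F.L γ b₀ p₀ (j + 1)) V → PlaqSmall (θBal F.L γ b₀ p₀ (j + 1)) W → PlaqSmall (θBal F.L γ b₀ p₀ (j + 1)) Z → (∀ e, e ≠ b → U e = V e) → (∀ e, e ≠ b' → U e = W e) → (∀ e, e ≠ b' → V e = Z e) → (∀ e, e ≠ b → W e = Z e) → |(Real.log (ρ (j + 1) U) - Real.log (ρ' (j + 1) U) - ((F.L : ℝ) ^ (j + 1) / γ) * ∑ p, c p * (1 - reTr (GaugeField.plaqHol U p))) - (Real.log (ρ (j + 1) V) - Real.log (ρ' (j + 1) V) - ((F.L : ℝ) ^ (j + 1) / γ) * ∑ p, c p * (1 - reTr (GaugeField.plaqHol V p))) - ((Real.log (ρ (j + 1) W) - Real.log (ρ' (j + 1) W) - ((F.L : ℝ) ^ (j + 1) / γ) * ∑ p, c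 p * (1 - reTr (GaugeField.plaqHol W p))) - (Real.log (ρ (j + 1) Z) - Real.log (ρ' (j + 1) Z) - ((F.L : ℝ) ^ (j + 1) / γ) * ∑ p, c p * (1 - reTr (GaugeField.plaqHol Z p))))| ≤ w * Real.exp (-(κ * (b.src.tdist b'.src : ℝ))))) → ∃ (c' : Plaq (F.P j) 0 → ℝ) (a' w' : ℝ), 0 ≤ a' ∧ 0 ≤ w' ∧ a' + θ / (((F.L : ℝ) ^ j / γ) * θBal F.L γ b₀ p₀ j ^ 2) * w' ≤ (1 + ε j + εd (T - (j + 2)) + C * (a + θ / (((F.L : ℝ) ^ (j + 1) / γ) * θBal F.L γ b₀ p₀ (j + 1) ^ 2) * w)) * (a + θ / (((F.L : ℝ) ^ (j + 1) / γ) * θBal F.L γ b₀ p₀ (j + 1) ^ 2) * w) + δ j ∧ ((∀ p, |c' p| ≤ a') ∧ (∀ (b b' : PBond (F.P j) 0) U V W Z, PlaqSmall (θBal F.L γ b₀ p₀ j) U → PlaqSmall (θBal F.L γ b₀ p₀ j) V → PlaqSmall (θBal F.L γ b₀ p₀ j) W → PlaqSmall (θBal F.L γ b₀ p₀ j) Z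 → (∀ e, e ≠ b → U e = V e) → (∀ e, e ≠ b' → U e = W e) → (∀ e, e ≠ b' → V e = Z e) → (∀ e, e ≠ b → W e = Z e) → |(Real.log (ρ j U) - Real.log (ρ' j U) - ((F.L : ℝ) ^ j / γ) * ∑ p, c' p * (1 - reTr (GaugeField.plaqHol U p))) - (Real.log (ρ j V) - Real.log (ρ' j V) - ((F.L : ℝ) ^ j / γ) * ∑ p, c' p * (1 - reTr (GaugeField.plaqHol V p))) - ((Real.log (ρ j W) - Real.log (ρ' j W) - ((F.L : ℝ) ^ j / γ) * ∑ p, c' p * (1 - reTr (GaugeField.plaqHol W p))) - (Real.log (ρ j Z) - Real.log (ρ' j Z) - ((F.L : ℝ) ^ j / γ) * ∑ p, c' p * (1 - reTr (GaugeField.plaqHol Z p))))| ≤ w' * Real.exp (-(κ * (b.src.tdist b'.src : ℝ)))))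

/-- S4a · INNER-WINDOW CHAINS (= the derived theorem `innerWindowChains` of `Lines/flat_ratio_termination.lean`, BY STATEMENT; its three
registered stubs `stub_innerWindowGaugeSmall`, `stub_gaugeSmallChains`, `stub_thresholds` prove it there): every configuration of the inner
window `θBal F.L γ (√b₀) (p₀/2) j` is joined to `1` by `≤ #PBond_j²` one-bond moves inside the window. M/L (geometric). -/
def InnerWindowChains : Prop :=
  ∃ pW : ℝ, ∀ (p₀ : ℝ), pW ≤ p₀ → ∀ (F : T3Family) (γ b₀ : ℝ), 0 < γ → γ ≤ 1 → 0 < b₀ → ∃ jW : ℕ, ∀ j : ℕ, jW ≤ j → (∀ U : GaugeField (F.P j) 0 ↥(Matrix.specialUnitaryGroup (Fin 2) ℂ), PlaqSmall (θBal F.L γ (Real.sqrt b₀) (p₀ / 2) j) U → ∃ (n : ℕ) (W : ℕ → GaugeField (F.P j) 0 ↥(Matrix.specialUnitaryGroup (Fin 2) ℂ)), n ≤ Fintype.card (PBond (F.P j) 0) ^ 2 ∧ (∀ e, W 0 e = 1) ∧ W n = U ∧ (∀ i, i ≤ n → PlaqSmall (θBal F.L γ b₀ p₀ j) (W i)) ∧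 (∀ i, i < n → ∃ b : PBond (F.P j) 0, ∀ e, e ≠ b → W i e = W (i + 1) e))

/-- S4b · SINGLE-HEIGHT TV BOUND (= `stub_windowTV` of `Lines/flat_ratio_termination.lean`, BY STATEMENT): positivity on the window,
chains from the inner window, one-bond oscillation `τ` with `τ·D ≤ δ₀` and inner tails `≤ δ₀` force `|μ A − μ' A| ≤ ε`. M. -/
def WindowTV : Prop :=
  ∀ ε : ℝ, 0 < ε → ∃ δ₀ : ℝ, 0 < δ₀ ∧ ∀ (F : T3Family) (j D : ℕ) (θin θ τ ηr : ℝ), 0 < θin → 0 ≤ τ → τ * (D : ℝ) ≤ δ₀ → 0 ≤ ηr → ηr ≤ δ₀ → ∀ (μ μ' : MeasureTheory.Measure (GaugeField (F.P j) 0 ↥(Matrix.specialUnitaryGroup (Fin 2) ℂ))) (ρ ρ' : GaugeField (F.P j) 0 ↥(Matrix.specialUnitaryGroup (Fin 2) ℂ) → ℝ), IsProbabilityMeasure μ → IsProbabilityMeasure μ' → (∀ U, PlaqSmall θ U → 0 < ρ U ∧ 0 < ρ' U) → μ = (fieldMeasure _ _ _).withDensity (fun U => ENNReal.ofReal (ρ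 U)) → μ' = (fieldMeasure _ _ _).withDensity (fun U => ENNReal.ofReal (ρ' U)) → (∀ U : GaugeField (F.P j) 0 ↥(Matrix.specialUnitaryGroup (Fin 2) ℂ), PlaqSmall (θin) U → ∃ (n : ℕ) (W : ℕ → GaugeField (F.P j) 0 ↥(Matrix.specialUnitaryGroup (Fin 2) ℂ)), n ≤ D ∧ (∀ e, W 0 e = 1) ∧ W n = U ∧ (∀ i, i ≤ n → PlaqSmall (θ) (W i)) ∧ (∀ i, i < n → ∃ b : PBond (F.P j) 0, ∀ e, e ≠ b → W i e = W (i + 1) e)) → (∀ (b : PBond (F.P j) 0) U V, PlaqSmall θ U → PlaqSmall θ V → (∀ e, e ≠ b → U e = V e) → |(Real.log (ρ U) - Real.log (ρ' U)) - (Real.log (ρ V) - Real.log (ρ' V))| ≤ τ) → μ {U | ¬ PlaqSmall θin U} ≤ ENNReal.ofReal ηr → μ' {U | ¬ PlaqSmall θin U} ≤ ENNReal.ofReal ηr → ∀ A : Set (GaugeField (F.P j) 0 ↥(Matrix.specialUnitaryGroup (Fin 2) ℂ)), MeasurableSet A → |μ.real A - μ'.real A| ≤ ε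

/-- S4c · SET-CLOSENESS ⇒ INTEGRAL-CLOSENESS for observables bounded by one (layer cake on `f⁺`, `f⁻`). S. -/
def IntegralOfTV : Prop :=
  ∀ (F : T3Family) (j : ℕ) (μ μ' : MeasureTheory.Measure (GaugeField (F.P j) 0 ↥(Matrix.specialUnitaryGroup (Fin 2) ℂ))),
    IsProbabilityMeasure μ → IsProbabilityMeasure μ' → ∀ ε : ℝ, 0 ≤ ε →
    (∀ A : Set (GaugeField (F.P j) 0 ↥(Matrix.specialUnitaryGroup (Fin 2) ℂ)), MeasurableSet A → |μ.real A - μ'.real A| ≤ ε) →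
    ∀ f : GaugeField (F.P j) 0 ↥(Matrix.specialUnitaryGroup (Fin 2) ℂ) → ℝ, Measurable f → (∀ u, |f u| ≤ 1) →
      |(∫ u, f u ∂μ) - (∫ u, f u ∂μ')| ≤ 2 * ε

/-! ## §V18.T THE H-CURRENCY TEXTS (== crux workfile `V18DraftTexts.lean` v0.2 73b6764578c8b629 §-for-§; BC7 5∕5 CLEAN) -/

section V18Texts

open Function (update)
open T4CubeChartExp (expPt)
open scoped BigOperators


/-- `HClauseSq θ r k R` · THE SCALED ONE-BOND-PAIR CLAUSE (tree text: ✓p797413 `firstDiff_window_path`'s hypothesis `h`, byte-identical body). -/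
def HClauseSq {P : Params} {j : ℕ} (θ r : ℝ) (k : PBond P j → PBond P j → ℝ)
    (R : GaugeField P j ↥(Matrix.specialUnitaryGroup (Fin 2) ℂ) → ℝ) : Prop :=
  ∀ (b b' : PBond P j) (v v' : Fin 3 → ℝ) (U V W Z : GaugeField P j ↥(Matrix.specialUnitaryGroup (Fin 2) ℂ)),
    ‖v‖ ≤ r * θ → ‖v'‖ ≤ r * θ → PlaqSmall θ U → PlaqSmall θ V → PlaqSmall θ W → PlaqSmall θ Z →
    (∀ e, e ≠ b → V e = U e) → V b = U b * expPt v → (∀ e, e ≠ b' → W e = U e) → W b' = U b' * expPt v' →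
    (∀ e, e ≠ b' → Z e = V e) → Z b' = V b' * expPt v' →
    |R Z - R V - R W + R U| ≤ k b b' * (‖v‖ / θ) * (‖v'‖ / θ)

/-- `AnalyticPairWindowAt θ r B f` · THE ANALYTICITY PREDICATE (β) — LEAD spec §1 text VERBATIM ([Balaban1985UV3] p.263 (c)): an INTERFACE. -/
def AnalyticPairWindowAt {P : Params} {j : ℕ} (θ r B : ℝ) (f : GaugeField P j ↥(Matrix.specialUnitaryGroup (Fin 2) ℂ) → ℝ) : Prop :=
  ∀ (U : GaugeField P j ↥(Matrix.specialUnitaryGroup (Fin 2) ℂ)), PlaqSmall θ U →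
    ∀ (b b' : PBond P j) (v v' : Fin 3 → ℝ), ‖v‖ ≤ 1 → ‖v'‖ ≤ 1 →
      ∃ g : ℂ × ℂ → ℂ, DifferentiableOn ℂ g (Metric.ball (0 : ℂ) (r * θ) ×ˢ Metric.ball (0 : ℂ) (r * θ)) ∧
        (∀ (s t : ℝ) (V Z : GaugeField P j ↥(Matrix.specialUnitaryGroup (Fin 2) ℂ)), |s| < r * θ → |t| < r * θ →
          (∀ e, e ≠ b → V e = U e) → V b = U b * expPt (s • v) → (∀ e, e ≠ b' → Z e = V e) → Z b' = V b' * expPt (t • v') →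
          g ((s : ℂ), (t : ℂ)) = ((f Z : ℝ) : ℂ)) ∧
        ∀ z ∈ Metric.ball (0 : ℂ) (r * θ) ×ˢ Metric.ball (0 : ℂ) (r * θ), ‖g z - g 0‖ ≤ B

/-- S1aᴴ · RUN CLASS MEMBERSHIP WITH ANALYTICITY — S1a `RunClassMembership` (v17.2 :211) VERBATIM plus, for the SAME density `ρ`, the
per-height (β) clause at window parameter `θBal∕2` with a radius `rA > 0` and the print-shaped oscillation bound `CB·β_j·θ_j² = CB·p(g_j)²`
(LEAD spec §1 caveat: the honest oscillation of `log ρ_j` on the `rA·θ_j`-bidisc is `≍ rA·p(g_j)²`), `rA, CB` chosen with `(j₀, prm)` (before the runs), normalised TEXT-SIDE (LEAD w3 g24 №15 (A) N2 ruling, v0.3): `rA ≤ 1∕12` and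
`0 < CB` (analyticity at radius `rA` restricts to any smaller radius; `CB ↦ max CB 1`) so the composition feeds ✓px5 `seedTriple_of_seed_of_analytic_three`
by `exact`.
`RunClassMembershipH → RunClassMembership` by dropping the conjunct.  L (print: [Balaban1985UV3] p.263 (c), analyticity of the effective
densities on the complexified small-field domain; the stub is the v18 L-debt `stub_runClassMembershipH`). -/
def RunClassMembershipH : Prop :=
  ∀ (L : ℕ), ∃ pm : ℝ, 0 < pm ∧ ∀ (p₀ : ℝ), pm ≤ p₀ → ∃ b₀ : ℝ, 0 < b₀ ∧ ∃ γ₁ : ℝ, 0 < γ₁ ∧ ∀ (F : T3Family) (γ : ℝ), F.L = L → 0 < γ → γ ≤ γ₁ →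
    ∃ (j₀ : ℕ) (prm : ℕ → ClassParams) (rA CB : ℝ), AdmissibleClassParams F γ b₀ p₀ prm ∧ 0 < rA ∧ rA ≤ 1 / 12 ∧ 0 < CB ∧
      ∀ (ν : ℕ → (j : ℕ) → Measure (GaugeField (F.P j) 0 (Matrix.specialUnitaryGroup (Fin 2) ℂ))),
        (∀ K, ν K K = T4GenFunBounds.gibbsMeasure (F.P K) ((F.scheme ℰp γ).β K)) →
        (∀ K j, j < K → ν K j = Measure.map (descend F ℰp j) (ν K (j + 1))) →
        ∀ (K Ts : ℕ), Ts ≤ K → ∀ (μ : (j : ℕ) → Measure (GaugeField (F.P j) 0 (Matrix.specialUnitaryGroup (Fin 2) ℂ))),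
          (∀ j, Ts ≤ j → μ j = ν K j) →
          (∀ j, j < Ts → μ j = Measure.map (descend F ℰp j) ((μ (j + 1)).withDensity (fun U => ENNReal.ofReal (sfCut (θBal F.L γ b₀ p₀ (j + 1)) U)))) →
          ∃ ρ : (j : ℕ) → GaugeField (F.P j) 0 (Matrix.specialUnitaryGroup (Fin 2) ℂ) → ℝ,
            ∀ (j : ℕ) (hjK : j ≤ K), j₀ ≤ j →
              (∀ U, PlaqSmall (θBal F.L γ b₀ p₀ j) U → 0 < ρ j U) ∧
              μ j = (fieldMeasure _ _ _).withDensity (fun U => ENNReal.ofReal (ρ j U)) ∧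
              (∃ κ : ℝ, MemOfRun F ℰp hjK (prm j) (fun U => Real.exp κ * ρ j U)) ∧
              ContinuousOn (ρ j) {U | PlaqSmall (θBal F.L γ b₀ p₀ j) U} ∧
              AnalyticPairWindowAt (θBal F.L γ b₀ p₀ j / 2) rA (CB * (((F.L : ℝ) ^ j / γ) * θBal F.L γ b₀ p₀ j ^ 2)) (fun U => Real.log (ρ j U))

/-- O1ᵘ-H v2 · UNIFORM MULTI-STEP (DIRECT) TRANSPORT in the Hessian currency (see the module doc for the four conventions). XL; NOT PRINTED as a
theorem — [Balaban1985UV3] p.263 (c) + [Balaban1988RG2] (0.3)–(0.12) give the analyticity∕localisation it would be assembled from. -/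
def OneStepTransportUH : Prop :=
  ∃ γ₁ : ℝ, 0 < γ₁ ∧ ∀ (F : T3Family) (γ : ℝ), 0 < γ → γ ≤ γ₁ →
  ∀ (b₀ p₀ : ℝ) (j₀ : ℕ) (prm : ℕ → ClassParams) (η : ℕ → ℝ) (rA : ℝ) (Bρ : ℕ → ℝ), 0 < b₀ → 0 < p₀ → AdmissibleClassParams F γ b₀ p₀ prm →
  (∀ j, 0 ≤ η j) → Summable η → Summable (fun i => ∑' k, η (k + i)) →
  Tendsto (fun j => (∑' k, η (k + j)) * ((1 + 2 * ((F.L : ℝ) ^ j / γ) * (Fintype.card (Plaq (F.P j) 0) : ℝ)) * (Fintype.card (PBond (F.P j) 0) : ℝ) ^ 2)) atTop (𝓝 0) →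
  0 < rA →
  ∃ κ₀ : ℝ, 0 < κ₀ ∧ ∀ (κ : ℝ), 0 < κ → κ ≤ κ₀ →
  ∃ (θ r Ctr C w₀ : ℝ) (εd δ : ℕ → ℝ) (j₁ : ℕ), 0 < θ ∧ 0 < r ∧ 1 ≤ Ctr ∧ 0 ≤ C ∧ 0 < w₀ ∧ (∀ j, 0 ≤ εd j ∧ 0 ≤ δ j) ∧ Summable εd ∧ Summable δ ∧
  Summable (fun i => ∑' k, δ (k + i)) ∧
  Tendsto (fun j => (∑' k, δ (k + j)) * ((1 + 2 * ((F.L : ℝ) ^ j / γ) * (Fintype.card (Plaq (F.P j) 0) : ℝ)) * (Fintype.card (PBond (F.P j) 0) : ℝ) ^ 2)) atTop (𝓝 0) ∧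
  j₀ ≤ j₁ ∧
  ∀ (ν : ℕ → (j : ℕ) → MeasureTheory.Measure (GaugeField (F.P j) 0 ↥(Matrix.specialUnitaryGroup (Fin 2) ℂ))),
  (∀ K, ν K K = T4GenFunBounds.gibbsMeasure (F.P K) ((F.scheme ℰp γ).β K)) →
  (∀ K j, j < K → ν K j = Measure.map (descend F ℰp j) (ν K (j + 1))) →
  ∀ (K K' : ℕ), K ≤ K' → ∀ (Ts T : ℕ), Ts < T → T ≤ K →
  ∀ (μ μ' : ((j : ℕ) → MeasureTheory.Measure (GaugeField (F.P j) 0 ↥(Matrix.specialUnitaryGroup (Fin 2) ℂ))))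
    (ρ ρ' : ((j : ℕ) → GaugeField (F.P j) 0 ↥(Matrix.specialUnitaryGroup (Fin 2) ℂ) → ℝ)),
  (∀ j : ℕ, Ts ≤ j → j ≤ T → μ j = ν K j ∧ μ' j = ν K' j) →
  (∀ j : ℕ, j < Ts → μ j = Measure.map (descend F ℰp j) ((μ (j + 1)).withDensity (fun U => ENNReal.ofReal (sfCut (θBal F.L γ b₀ p₀ (j + 1)) U))) ∧
    μ' j = Measure.map (descend F ℰp j) ((μ' (j + 1)).withDensity (fun U => ENNReal.ofReal (sfCut (θBal F.L γ b₀ p₀ (j + 1)) U)))) →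
  (∀ j : ℕ, Ts ≤ j → j < T → μ j = Measure.map (descend F ℰp j) (μ (j + 1)) ∧ μ' j = Measure.map (descend F ℰp j) (μ' (j + 1))) →
  (∀ j : ℕ, j ≤ T → IsFiniteMeasure (μ j) ∧ IsFiniteMeasure (μ' j)) →
  (∀ j : ℕ, j₀ ≤ j → j ≤ T → ((∀ U, PlaqSmall (θBal F.L γ b₀ p₀ j) U → 0 < ρ j U ∧ 0 < ρ' j U) ∧
    μ j = (fieldMeasure _ _ _).withDensity (fun U => ENNReal.ofReal (ρ j U)) ∧ μ' j = (fieldMeasure _ _ _).withDensity (fun U => ENNReal.ofReal (ρ' j U)) ∧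
    (∃ κ : ℝ, MemAtHeight F ℰp j (prm j) (fun U => Real.exp κ * ρ j U)) ∧ (∃ κ : ℝ, MemAtHeight F ℰp j (prm j) (fun U => Real.exp κ * ρ' j U)) ∧
    μ j {U | ¬ PlaqSmall (θBal F.L γ b₀ p₀ j) U} ≤ ENNReal.ofReal (η j) ∧ μ' j {U | ¬ PlaqSmall (θBal F.L γ b₀ p₀ j) U} ≤ ENNReal.ofReal (η j) ∧
    (ContinuousOn (ρ j) {U | PlaqSmall (θBal F.L γ b₀ p₀ j) U} ∧ ContinuousOn (ρ' j) {U | PlaqSmall (θBal F.L γ b₀ p₀ j) U}) ∧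
    (AnalyticPairWindowAt (θBal F.L γ b₀ p₀ j / 2) rA (Bρ j) (fun U => Real.log (ρ j U)) ∧
      AnalyticPairWindowAt (θBal F.L γ b₀ p₀ j / 2) rA (Bρ j) (fun U => Real.log (ρ' j U))))) →
  ∀ (w : ℝ), 0 ≤ w → w / (((F.L : ℝ) ^ Ts / γ) * θBal F.L γ b₀ p₀ Ts ^ 2) ≤ w₀ →
  (∃ k : PBond (F.P Ts) 0 → PBond (F.P Ts) 0 → ℝ, (∀ b b', 0 ≤ k b b') ∧
    (∀ b, ∑ b', k b b' * Real.exp (κ * (b.src.tdist b'.src : ℝ)) ≤ w) ∧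
    HClauseSq (θBal F.L γ b₀ p₀ Ts / 4) (rA / 2) k (fun U => Real.log (ρ Ts U) - Real.log (ρ' Ts U))) →
  ∀ (j : ℕ), j₁ ≤ j → j + 1 ≤ Ts →
  ∃ (c' : Plaq (F.P j) 0 → ℝ) (a' w' : ℝ), 0 ≤ a' ∧ 0 ≤ w' ∧
    a' + θ * (w' / (((F.L : ℝ) ^ j / γ) * θBal F.L γ b₀ p₀ j ^ 2)) ≤
      (Ctr + εd (T - (Ts + 1)) + C * (w / (((F.L : ℝ) ^ Ts / γ) * θBal F.L γ b₀ p₀ Ts ^ 2))) *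
        (w / (((F.L : ℝ) ^ Ts / γ) * θBal F.L γ b₀ p₀ Ts ^ 2)) + δ j ∧
    (∀ p, |c' p| ≤ a') ∧
    ∃ k' : PBond (F.P j) 0 → PBond (F.P j) 0 → ℝ, (∀ b b', 0 ≤ k' b b') ∧
      (∀ b, ∑ b', k' b b' * Real.exp (κ * (b.src.tdist b'.src : ℝ)) ≤ w') ∧
      HClauseSq (θBal F.L γ b₀ p₀ j / 4) r k'
        (fun U => Real.log (ρ j U) - Real.log (ρ' j U) - ((F.L : ℝ) ^ j / γ) * ∑ p, c' p * (1 - reTr (GaugeField.plaqHol U p)))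

/-- S3ᴴ · BACKWARD STABILITY ON FINITE RUNS, H-CURRENCY, SUP-OSCILLATION FORM (TN-OSC): S3 v17.2's frame with (β) in block ⑧, the H-seed at
`T`, and the conclusion = the inner-window sup-oscillation of `h_j` relative to `1` at path profile `b₀∕8`, RHS `(Cs·x_T + δ j)·β_j·(2·#Plaq_j + #PBond_j²)` (v0.2: (P-b′) v1.1's θ-free count kills the `1∕θ_j`).
DERIVED (junction `directTransport_supR : OneStepTransportUH → BackwardStabilityFinSupH` over P-b′ + brick T + GRAnchorFree). NOT PRINTED. XL. -/
def BackwardStabilityFinSupH : Prop :=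
  ∃ pW : ℝ, ∃ γ₁ : ℝ, 0 < γ₁ ∧ ∀ (F : T3Family) (γ : ℝ), 0 < γ → γ ≤ γ₁ →
  ∀ (b₀ p₀ κ : ℝ) (j₀ : ℕ) (prm : ℕ → ClassParams) (η : ℕ → ℝ) (rA : ℝ) (Bρ : ℕ → ℝ), 0 < b₀ → 0 < p₀ → pW ≤ p₀ → AdmissibleClassParams F γ b₀ p₀ prm → 0 < κ →
  (∀ j, 0 ≤ η j) → Summable η → Summable (fun i => ∑' k, η (k + i)) →
  Tendsto (fun j => (∑' k, η (k + j)) * ((1 + 2 * ((F.L : ℝ) ^ j / γ) * (Fintype.card (Plaq (F.P j) 0) : ℝ)) * (Fintype.card (PBond (F.P j) 0) : ℝ) ^ 2)) atTop (𝓝 0) →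
  0 < rA →
  ∃ (Cs w₀ : ℝ) (δ : ℕ → ℝ) (j₁ : ℕ), 0 ≤ Cs ∧ 0 < w₀ ∧ (∀ j, 0 ≤ δ j) ∧ Summable δ ∧ Summable (fun i => ∑' k, δ (k + i)) ∧
  Tendsto (fun j => (∑' k, δ (k + j)) * ((1 + 2 * ((F.L : ℝ) ^ j / γ) * (Fintype.card (Plaq (F.P j) 0) : ℝ)) * (Fintype.card (PBond (F.P j) 0) : ℝ) ^ 2)) atTop (𝓝 0) ∧
  j₀ ≤ j₁ ∧
  ∀ (ν : ℕ → (j : ℕ) → MeasureTheory.Measure (GaugeField (F.P j) 0 ↥(Matrix.specialUnitaryGroup (Fin 2) ℂ))),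
  (∀ K, ν K K = T4GenFunBounds.gibbsMeasure (F.P K) ((F.scheme ℰp γ).β K)) →
  (∀ K j, j < K → ν K j = Measure.map (descend F ℰp j) (ν K (j + 1))) →
  ∀ (K K' : ℕ), K ≤ K' → ∀ (T Tt : ℕ), T < Tt → Tt ≤ K →
  ∀ (μ μ' : ((j : ℕ) → MeasureTheory.Measure (GaugeField (F.P j) 0 ↥(Matrix.specialUnitaryGroup (Fin 2) ℂ))))
    (ρ ρ' : ((j : ℕ) → GaugeField (F.P j) 0 ↥(Matrix.specialUnitaryGroup (Fin 2) ℂ) → ℝ)),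
  (∀ j : ℕ, T ≤ j → j ≤ Tt → μ j = ν K j ∧ μ' j = ν K' j) →
  (∀ j : ℕ, j < T → μ j = Measure.map (descend F ℰp j) ((μ (j + 1)).withDensity (fun U => ENNReal.ofReal (sfCut (θBal F.L γ b₀ p₀ (j + 1)) U))) ∧
    μ' j = Measure.map (descend F ℰp j) ((μ' (j + 1)).withDensity (fun U => ENNReal.ofReal (sfCut (θBal F.L γ b₀ p₀ (j + 1)) U)))) →
  (∀ j : ℕ, T ≤ j → j < Tt → μ j = Measure.map (descend F ℰp j) (μ (j + 1)) ∧ μ' j = Measure.map (descend F ℰp j) (μ' (j + 1))) →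
  (∀ j : ℕ, j ≤ Tt → IsFiniteMeasure (μ j) ∧ IsFiniteMeasure (μ' j)) →
  (∀ j : ℕ, j₀ ≤ j → j ≤ Tt → ((∀ U, PlaqSmall (θBal F.L γ b₀ p₀ j) U → 0 < ρ j U ∧ 0 < ρ' j U) ∧
    μ j = (fieldMeasure _ _ _).withDensity (fun U => ENNReal.ofReal (ρ j U)) ∧ μ' j = (fieldMeasure _ _ _).withDensity (fun U => ENNReal.ofReal (ρ' j U)) ∧
    (∃ κ : ℝ, MemAtHeight F ℰp j (prm j) (fun U => Real.exp κ * ρ j U)) ∧ (∃ κ : ℝ, MemAtHeight F ℰp j (prm j) (fun U => Real.exp κ * ρ' j U)) ∧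
    μ j {U | ¬ PlaqSmall (θBal F.L γ b₀ p₀ j) U} ≤ ENNReal.ofReal (η j) ∧ μ' j {U | ¬ PlaqSmall (θBal F.L γ b₀ p₀ j) U} ≤ ENNReal.ofReal (η j) ∧
    (ContinuousOn (ρ j) {U | PlaqSmall (θBal F.L γ b₀ p₀ j) U} ∧ ContinuousOn (ρ' j) {U | PlaqSmall (θBal F.L γ b₀ p₀ j) U}) ∧
    (AnalyticPairWindowAt (θBal F.L γ b₀ p₀ j / 2) rA (Bρ j) (fun U => Real.log (ρ j U)) ∧
      AnalyticPairWindowAt (θBal F.L γ b₀ p₀ j / 2) rA (Bρ j) (fun U => Real.log (ρ' j U))))) →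
  ∀ (wT : ℝ), 0 ≤ wT → wT / (((F.L : ℝ) ^ T / γ) * θBal F.L γ b₀ p₀ T ^ 2) ≤ w₀ →
  (∃ kT : PBond (F.P T) 0 → PBond (F.P T) 0 → ℝ, (∀ b b', 0 ≤ kT b b') ∧
    (∀ b, ∑ b', kT b b' * Real.exp (κ * (b.src.tdist b'.src : ℝ)) ≤ wT) ∧
    HClauseSq (θBal F.L γ b₀ p₀ T / 4) (rA / 2) kT (fun U => Real.log (ρ T U) - Real.log (ρ' T U))) →
  ∀ (j : ℕ), j₁ ≤ j → j ≤ T →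
  ∀ U : GaugeField (F.P j) 0 ↥(Matrix.specialUnitaryGroup (Fin 2) ℂ), PlaqSmall (θBal F.L γ (Real.sqrt (b₀ / 8)) (p₀ / 2) j) U →
    |(Real.log (ρ j U) - Real.log (ρ' j U)) - (Real.log (ρ j 1) - Real.log (ρ' j 1))| ≤
      (Cs * (wT / (((F.L : ℝ) ^ T / γ) * θBal F.L γ b₀ p₀ T ^ 2)) + δ j) *
        (((F.L : ℝ) ^ j / γ) * (2 * (Fintype.card (Plaq (F.P j) 0) : ℝ) + (Fintype.card (PBond (F.P j) 0) : ℝ) ^ 2))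

/-- Sanity: S1aᴴ implies S1a's text (v17.2 :211) — dropping the (β) conjunct. -/
theorem runClassMembership_of_H (h : RunClassMembershipH) :
    ∀ (L : ℕ), ∃ pm : ℝ, 0 < pm ∧ ∀ (p₀ : ℝ), pm ≤ p₀ → ∃ b₀ : ℝ, 0 < b₀ ∧ ∃ γ₁ : ℝ, 0 < γ₁ ∧ ∀ (F : T3Family) (γ : ℝ), F.L = L → 0 < γ → γ ≤ γ₁ →
    ∃ (j₀ : ℕ) (prm : ℕ → ClassParams), AdmissibleClassParams F γ b₀ p₀ prm ∧
      ∀ (ν : ℕ → (j : ℕ) → Measure (GaugeField (F.P j) 0 (Matrix.specialUnitaryGroup (Fin 2) ℂ))),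
        (∀ K, ν K K = T4GenFunBounds.gibbsMeasure (F.P K) ((F.scheme ℰp γ).β K)) →
        (∀ K j, j < K → ν K j = Measure.map (descend F ℰp j) (ν K (j + 1))) →
        ∀ (K Ts : ℕ), Ts ≤ K → ∀ (μ : (j : ℕ) → Measure (GaugeField (F.P j) 0 (Matrix.specialUnitaryGroup (Fin 2) ℂ))),
          (∀ j, Ts ≤ j → μ j = ν K j) →
          (∀ j, j < Ts → μ j = Measure.map (descend F ℰp j) ((μ (j + 1)).withDensity (fun U => ENNReal.ofReal (sfCut (θBal F.L γ b₀ p₀ (j + 1)) U)))) →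
          ∃ ρ : (j : ℕ) → GaugeField (F.P j) 0 (Matrix.specialUnitaryGroup (Fin 2) ℂ) → ℝ,
            ∀ (j : ℕ) (hjK : j ≤ K), j₀ ≤ j →
              (∀ U, PlaqSmall (θBal F.L γ b₀ p₀ j) U → 0 < ρ j U) ∧
              μ j = (fieldMeasure _ _ _).withDensity (fun U => ENNReal.ofReal (ρ j U)) ∧
              (∃ κ : ℝ, MemOfRun F ℰp hjK (prm j) (fun U => Real.exp κ * ρ j U)) ∧
              ContinuousOn (ρ j) {U | PlaqSmall (θBal F.L γ b₀ p₀ j) U} := by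
  intro L
  obtain ⟨pm, hpm, H⟩ := h L
  refine ⟨pm, hpm, fun p₀ hp => ?_⟩
  obtain ⟨b₀, hb₀, γ₁, hγ₁, H1⟩ := H p₀ hp
  refine ⟨b₀, hb₀, γ₁, hγ₁, fun F γ hL hγ hγ₁ => ?_⟩
  obtain ⟨j₀, prm, rA, CB, hadm, _, _, _, H2⟩ := H1 F γ hL hγ hγ₁
  refine ⟨j₀, prm, hadm, fun ν hν1 hν2 K Ts hTs μ hμ1 hμ2 => ?_⟩
  obtain ⟨ρ, hρ⟩ := H2 ν hν1 hν2 K Ts hTs μ hμ1 hμ2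
  exact ⟨ρ, fun j hjK hj => ⟨(hρ j hjK hj).1, (hρ j hjK hj).2.1, (hρ j hjK hj).2.2.1, (hρ j hjK hj).2.2.2.1⟩⟩


/-- (P-b′) w4 g22 `…OrganTangentSmallStepChordPath.exists_smallStep_chordPath_gaugeCopy` v1.1 (SIGNATURE eef18f76 → v11), BY TEXT. -/
def SmallStepChordPath : Prop :=
    ∃ pW : ℝ, ∀ (p₀ : ℝ), pW ≤ p₀ → ∀ (F : T3Family) (γ b₀ : ℝ), 0 < γ → γ ≤ 1 → 0 < b₀ → ∃ jW : ℕ, ∀ j : ℕ, jW ≤ j →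
      ∀ U : GaugeField (F.P j) 0 ↥(Matrix.specialUnitaryGroup (Fin 2) ℂ), PlaqSmall (θBal F.L γ (Real.sqrt b₀) (p₀ / 2) j) U →
        ∀ δ : ℝ, 0 < δ → ∀ [DecidableEq (PBond (F.P j) 0)],
          ∃ (u : GaugeTransf (F.P j) 0 ↥(Matrix.specialUnitaryGroup (Fin 2) ℂ)) (path : List (PBond (F.P j) 0 × (Fin 3 → ℝ))),
            (∀ q ∈ path, ‖q.2‖ ≤ δ) ∧
            (∀ b : PBond (F.P j) 0, path.countP (fun q => decide (q.1 = b)) ≤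
              ⌈1 / (Real.sqrt (θBal F.L γ b₀ p₀ j) / 16)⌉₊ *
                (⌈Real.pi / 2 * (3 * (Real.sqrt (θBal F.L γ b₀ p₀ j) / 16) ^ 2 / 2) / δ⌉₊ + 2)) ∧
            List.foldl (fun (W : GaugeField (F.P j) 0 ↥(Matrix.specialUnitaryGroup (Fin 2) ℂ)) (q : PBond (F.P j) 0 × (Fin 3 → ℝ)) =>
                update W q.1 (W q.1 * expPt q.2)) 1 path = GaugeField.gaugeAct u U ∧
            (∀ m : ℕ, m ≤ path.length → PlaqSmall (θBal F.L γ b₀ p₀ j)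
              (List.foldl (fun (W : GaugeField (F.P j) 0 ↥(Matrix.specialUnitaryGroup (Fin 2) ℂ)) (q : PBond (F.P j) 0 × (Fin 3 → ℝ)) =>
                update W q.1 (W q.1 * expPt q.2)) 1 (path.take m))) ∧
            ∀ m : ℕ, m ≤ path.length → ∀ (b : PBond (F.P j) 0) (w : Fin 3 → ℝ),
              PlaqSmall (θBal F.L γ b₀ p₀ j + 4 * dist1 (expPt w))
                (update (List.foldl (fun (W : GaugeField (F.P j) 0 ↥(Matrix.specialUnitaryGroup (Fin 2) ℂ)) (q : PBond (F.P j) 0 × (Fin 3 → ℝ)) =>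
                  update W q.1 (W q.1 * expPt q.2)) 1 (path.take m)) b
                  ((List.foldl (fun (W : GaugeField (F.P j) 0 ↥(Matrix.specialUnitaryGroup (Fin 2) ℂ)) (q : PBond (F.P j) 0 × (Fin 3 → ℝ)) =>
                    update W q.1 (W q.1 * expPt q.2)) 1 (path.take m)) b * expPt w))

/-- S4bᴼ · WINDOW TV FROM INNER-WINDOW SUP-OSCILLATION — the statement of ✓p798125 LEAD w3 g24 pen 10
`Summit.QuantumFields.YangMills.Theorems.RunPairOrganWindowTVOfSupOsc.windowTV_of_supOsc` VERBATIM (closed BY NAME below: `stub_windowTVOsc`);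
the S4b the v18 composition eats (TN-OSC: pen 10 consumes only `sup_{inner window} |r U − r 1| ≤ τ`, no chains). PROVED in the tree. -/
def WindowTVOsc : Prop :=
  ∀ ε : ℝ, 0 < ε → ∃ δ₀ : ℝ, 0 < δ₀ ∧ ∀ (F : T3Family) (j : ℕ) (θin θ τ ηr : ℝ), 0 < θin → θin ≤ θ → 0 ≤ τ → τ ≤ δ₀ → 0 ≤ ηr → ηr ≤ δ₀ →
    ∀ (μ μ' : MeasureTheory.Measure (GaugeField (F.P j) 0 ↥(Matrix.specialUnitaryGroup (Fin 2) ℂ)))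
      (ρ ρ' : GaugeField (F.P j) 0 ↥(Matrix.specialUnitaryGroup (Fin 2) ℂ) → ℝ),
      IsProbabilityMeasure μ → IsProbabilityMeasure μ' → (∀ U, PlaqSmall θ U → 0 < ρ U ∧ 0 < ρ' U) →
      μ = (fieldMeasure _ _ _).withDensity (fun U => ENNReal.ofReal (ρ U)) → μ' = (fieldMeasure _ _ _).withDensity (fun U => ENNReal.ofReal (ρ' U)) →
      (∀ U : GaugeField (F.P j) 0 ↥(Matrix.specialUnitaryGroup (Fin 2) ℂ), PlaqSmall θin U →
        |(Real.log (ρ U) - Real.log (ρ' U)) - (Real.log (ρ 1) - Real.log (ρ' 1))| ≤ τ) →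
      μ {U | ¬ PlaqSmall θin U} ≤ ENNReal.ofReal ηr → μ' {U | ¬ PlaqSmall θin U} ≤ ENNReal.ofReal ηr →
      ∀ A : Set (GaugeField (F.P j) 0 ↥(Matrix.specialUnitaryGroup (Fin 2) ℂ)), MeasurableSet A → |μ.real A - μ'.real A| ≤ ε


end V18Texts


/-! ## Registered stubs -/

/-- S1aᴴ · v18 OPEN STUB (L; REPLACES v17.2's `stub_runClassMembership` — a RE-TYPING of the open S1a, not a closure): run class membership WITH
the per-height analyticity clause (β) ([Balaban1985UV3] p.263 (c)).  S1a's text is DERIVED: `runClassMembership_of_H stub_runClassMembershipH`. -/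
theorem stub_runClassMembershipH : RunClassMembershipH := by
  sorry

/-- v12 · EXTERNAL CRUX BY NAME (route `FirstExitWindow`, item stmt-QuantumFields-26243 `FirstExitWindowTailL`, XL, its own lines): the ONLY
input of S1b after w3 g32's door ✓p685792/✓p686194.  Registered here as the line's stub in place of S1b. -/
theorem stub_firstExitWindowTailL : Summit.QuantumFields.YangMills.Theses.FirstExitWindow.FirstExitWindowTailL := by
  sorry

/-- S1b is CLOSED MODULO 26243 (v12): w3 g32's landed door `runWindowTailsL_of_firstExitWindowTailL` (✓p686194, Theorems
`FluctuationComparisonRegPrIntLRunPairOrganRunWindowTailsOfFirstExit`, Prop `RunWindowTailsL` byte-identical to `RunWindowTails` v10) applied to the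
external crux. -/
theorem stub_runWindowTails : RunWindowTails :=
  Summit.QuantumFields.YangMills.Theorems.FluctuationComparisonRegPrIntL.RunPairOrgan.RunWindowTailsDoor.runWindowTailsL_of_firstExitWindowTailL
    stub_firstExitWindowTailL

/-! ### S2 stage table (v6, LINE g15-2): `RunPairSeed` ⇐ S2α (classical two-depth) + S2β (fluctuation part small) + the PROVED
diagonal schedule.  The seed's adaptive height `J K` and its `σ K` with `J K · σ K → 0` are MANUFACTURED here from fixed-height data. -/

theorem stub_classicalPerHeight : ClassicalPerHeight := by
  sorry

/-- GLUE (v9, kernel-checked): the plain per-height form S2α′ gives S2α — tail suprema, a summed antitone rate (Tannery), and the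
clustering factor absorbed into the height profile through the finite diameter of the bond set. -/
theorem classicalTwoDepth_of_perHeight (h : ClassicalPerHeight) : ClassicalTwoDepth := by
  classical
  intro L b₀ p₀ hb₀ hp₀
  obtain ⟨ε₁, hε₁, H⟩ := h L b₀ p₀ hb₀ hp₀
  refine ⟨ε₁, hε₁, fun ε₀ hε₀ hε₀1 => ?_⟩
  obtain ⟨γ₁, hγ₁, H⟩ := H ε₀ hε₀ hε₀1
  refine ⟨γ₁, hγ₁, 1, one_pos, fun F γ hFL hγ hγ1 => ?_⟩
  have HJ := H F γ hFL hγ hγ1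
  choose A hA0 hAt hAb using HJ
  -- tail suprema Ā J n := sup_{k ≥ n} A J k
  have hbdd : ∀ J n, BddAbove (A J '' Set.Ici n) := fun J n =>
    (hAt J).bddAbove_range.mono (Set.image_subset_range _ _)
  have hne : ∀ J n, (A J '' Set.Ici n).Nonempty := fun J n => ⟨A J n, n, Set.mem_Ici.2 le_rfl, rfl⟩
  let Ab : ℕ → ℕ → ℝ := fun J n => sSup (A J '' Set.Ici n)
  have hA_le : ∀ J n k, n ≤ k → A J k ≤ Ab J n := fun J n k hk => le_csSup (hbdd J n) ⟨k, Set.mem_Ici.2 hk, rfl⟩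
  have hAb_le : ∀ J n (c : ℝ), (∀ k, n ≤ k → A J k ≤ c) → Ab J n ≤ c := fun J n c hc =>
    csSup_le (hne J n) (by rintro _ ⟨k, hk, rfl⟩; exact hc k (Set.mem_Ici.1 hk))
  have hAb0 : ∀ J n, 0 ≤ Ab J n := fun J n => (hA0 J n).trans (hA_le J n n le_rfl)
  have hAb_anti : ∀ J, Antitone (Ab J) := fun J n m hnm =>
    hAb_le J m _ (fun k hk => hA_le J n k (hnm.trans hk))
  have hAb_t : ∀ J, Tendsto (Ab J) atTop (𝓝 0) := by
    intro J
    rw [Metric.tendsto_atTop]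
    intro e he
    obtain ⟨N, hN⟩ := (Metric.tendsto_atTop.1 (hAt J)) (e / 2) (half_pos he)
    refine ⟨N, fun n hn => ?_⟩
    rw [Real.dist_eq, sub_zero, abs_of_nonneg (hAb0 J n)]
    have : Ab J n ≤ e / 2 := hAb_le J n _ (fun k hk => by
      have h := hN k (hn.trans hk)
      rw [Real.dist_eq, sub_zero] at h
      exact (le_abs_self _).trans h.le)
    linarith
  -- weights and the summed rate
  let c : ℕ → ℝ := fun J => ((1 : ℝ) / 2) ^ J / (Ab J 0 + 1)
  have hc0 : ∀ J, 0 < c J := fun J => div_pos (pow_pos (by norm_num) J) (by linarith [hAb0 J 0])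
  have hterm0 : ∀ J n, 0 ≤ c J * Ab J n := fun J n => mul_nonneg (hc0 J).le (hAb0 J n)
  have hterm_le : ∀ J n, c J * Ab J n ≤ ((1 : ℝ) / 2) ^ J := by
    intro J n
    have h1 : Ab J n ≤ Ab J 0 + 1 := (hAb_anti J (Nat.zero_le n)).trans (by linarith)
    have h2 : Ab J n / (Ab J 0 + 1) ≤ 1 := (div_le_one (by linarith [hAb0 J 0])).2 h1
    calc c J * Ab J n = ((1 : ℝ) / 2) ^ J * (Ab J n / (Ab J 0 + 1)) := by
            show ((1 : ℝ) / 2) ^ J / (Ab J 0 + 1) * Ab J n = _; ring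
      _ ≤ ((1 : ℝ) / 2) ^ J * 1 := mul_le_mul_of_nonneg_left h2 (pow_nonneg (by norm_num) J)
      _ = ((1 : ℝ) / 2) ^ J := mul_one _
  have hgeom : Summable (fun J : ℕ => ((1 : ℝ) / 2) ^ J) :=
    summable_geometric_of_lt_one (by norm_num) (by norm_num)
  have hsum : ∀ n, Summable (fun J => c J * Ab J n) := fun n =>
    Summable.of_nonneg_of_le (fun J => hterm0 J n) (fun J => hterm_le J n) hgeom
  let τ : ℕ → ℝ := fun n => ∑' J, c J * Ab J n
  have hτ0 : ∀ n, 0 ≤ τ n := fun n => tsum_nonneg (fun J => hterm0 J n)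
  have hτa : Antitone τ := fun n m hnm =>
    Summable.tsum_le_tsum (fun J => mul_le_mul_of_nonneg_left (hAb_anti J hnm) (hc0 J).le) (hsum m) (hsum n)
  have hτt : Tendsto τ atTop (𝓝 0) := by
    have h := tendsto_tsum_of_dominated_convergence (f := fun n J => c J * Ab J n) (g := fun _ => (0 : ℝ))
      (bound := fun J => ((1 : ℝ) / 2) ^ J) hgeom
      (fun J => by simpa using (hAb_t J).const_mul (c J))
      (Eventually.of_forall fun n J => by rw [Real.norm_eq_abs, abs_of_nonneg (hterm0 J n)]; exact hterm_le J n)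
    simpa using h
  have hτ_ge : ∀ J n, c J * Ab J n ≤ τ n := fun J n =>
    (hsum n).le_tsum J (fun i _ => hterm0 i n)
  -- finite diameter of the bond set at each height
  have hDm : ∀ J, ∃ Dm : ℝ, ∀ b b' : PBond (F.P J) 0, (b.src.tdist b'.src : ℝ) ≤ Dm := by
    intro J
    obtain ⟨M, hM⟩ := Finite.exists_le (fun q : PBond (F.P J) 0 × PBond (F.P J) 0 => (q.1.src.tdist q.2.src : ℝ))
    exact ⟨M, fun b b' => hM (b, b')⟩
  choose Dm hDm using hDm
  refine ⟨fun J => Real.exp (Dm J) / c J, τ, fun J => (div_pos (Real.exp_pos _) (hc0 J)).le, hτ0, hτa, hτt, ?_⟩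
  intro J K K' hJK hJK' hKK' b b' U V W Z hU hV hW hZ h1 h2 h3 h4
  have hD := hAb J K K' hJK hJK' hKK' b b' U V W Z hU hV hW hZ h1 h2 h3 h4
  refine hD.trans ?_
  have step1 : A J (K - J) ≤ Ab J (K - J) := hA_le J _ _ le_rfl
  have step2 : Ab J (K - J) ≤ τ (K - J) / c J := by
    rw [le_div_iff₀ (hc0 J), mul_comm]; exact hτ_ge J _
  have step3 : Real.exp (-(Dm J)) ≤ Real.exp (-(1 * (b.src.tdist b'.src : ℝ))) :=
    Real.exp_le_exp.2 (by rw [one_mul]; exact neg_le_neg (hDm J b b'))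
  have hE : Real.exp (Dm J) * Real.exp (-(Dm J)) = 1 := by
    rw [← Real.exp_add, add_neg_cancel, Real.exp_zero]
  have hnn : 0 ≤ Real.exp (Dm J) / c J * τ (K - J) :=
    mul_nonneg (div_pos (Real.exp_pos _) (hc0 J)).le (hτ0 _)
  calc A J (K - J) ≤ τ (K - J) / c J := step1.trans step2
    _ = Real.exp (Dm J) / c J * τ (K - J) * Real.exp (-(Dm J)) := by
        rw [show Real.exp (Dm J) / c J * τ (K - J) * Real.exp (-(Dm J))
            = τ (K - J) / c J * (Real.exp (Dm J) * Real.exp (-(Dm J))) by ring, hE, mul_one]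
    _ ≤ Real.exp (Dm J) / c J * τ (K - J) * Real.exp (-(1 * (b.src.tdist b'.src : ℝ))) :=
        mul_le_mul_of_nonneg_left step3 hnn

/-- v11 hygiene (idea-crit-5 #225 (iv)): the CONVERSE S2α ⇒ S2α′ is trivial (`A_J n := P J · τ n`, the clustering factor `e^{-κ d} ≤ 1`
dropped), so S2α′ ⟺ S2α — the plain per-height form is a REFORMULATION of S2α, not a weakening. -/
theorem classicalPerHeight_of_twoDepth (h : ClassicalTwoDepth) : ClassicalPerHeight := by
  intro L b₀ p₀ hb₀ hp₀
  obtain ⟨ε₁, hε₁, H⟩ := h L b₀ p₀ hb₀ hp₀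
  refine ⟨ε₁, hε₁, fun ε₀ hε₀ hε₀1 => ?_⟩
  obtain ⟨γ₁, hγ₁, κ, hκ, H⟩ := H ε₀ hε₀ hε₀1
  refine ⟨γ₁, hγ₁, fun F γ hFL hγ hγ1 J => ?_⟩
  obtain ⟨P, τ, hP0, hτ0, -, hτt, HA⟩ := H F γ hFL hγ hγ1
  refine ⟨fun n => P J * τ n, fun n => mul_nonneg (hP0 J) (hτ0 n), by simpa using hτt.const_mul (P J), ?_⟩
  intro K K' hJK hJK' hKK' b b' U V W Z hU hV hW hZ h1 h2 h3 h4
  refine (HA J K K' hJK hJK' hKK' b b' U V W Z hU hV hW hZ h1 h2 h3 h4).trans ?_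
  have hexp : Real.exp (-(κ * (b.src.tdist b'.src : ℝ))) ≤ 1 :=
    Real.exp_le_one_iff.mpr (neg_nonpos.mpr (mul_nonneg hκ.le (Nat.cast_nonneg _)))
  simpa using mul_le_of_le_one_right (mul_nonneg (hP0 J) (hτ0 (K - J))) hexp

/-- S2α is DERIVED (v9) from its plain per-height form S2α′. -/
theorem stub_classicalTwoDepth : ClassicalTwoDepth :=
  classicalTwoDepth_of_perHeight stub_classicalPerHeight

theorem stub_fluctuationPartSmall : FluctuationPartSmall := by
  sorry

/-- DIAGONAL SCHEDULE (proved glue, pure real analysis): along a height schedule `J K → ∞` with `J K ≤ K`, ANY profile `f ≥ 0`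
evaluated at `J K` times an antitone null sequence evaluated at the depth `K - J K` is `≤ 1/(J K + 1)` after the factor `J K`. -/
theorem diagonalSchedule (f τ : ℕ → ℝ) (hf : ∀ n, 0 ≤ f n) (hτ0 : ∀ n, 0 ≤ τ n) (hτa : Antitone τ)
    (hτ : Tendsto τ atTop (𝓝 0)) :
    ∃ J : ℕ → ℕ, (∀ K, J K ≤ K) ∧ Tendsto J atTop atTop ∧
      Tendsto (fun K => (J K : ℝ) * (f (J K) + 1) * τ (K - J K)) atTop (𝓝 0) := by
  classical
  -- envelope of `f` up to `N` and the budget `g N`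
  let S : ℕ → ℝ := fun N => ∑ n ∈ Finset.range (N + 1), f n
  have hSf : ∀ N, f N ≤ S N := fun N =>
    Finset.single_le_sum (f := f) (fun n _ => hf n) (Finset.self_mem_range_succ N)
  have hS0 : ∀ N, 0 ≤ S N := fun N => Finset.sum_nonneg fun n _ => hf n
  let g : ℕ → ℝ := fun N => ((N : ℝ) + 1) ^ 2 * (S N + 1)
  have hg : ∀ N, 0 < g N := fun N =>
    mul_pos (pow_pos (by positivity) 2) (by linarith [hS0 N])
  have hex : ∀ N, ∃ n, τ n ≤ 1 / g N := fun N => by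
    have h := (hτ.eventually (gt_mem_nhds (one_div_pos.2 (hg N)))).exists
    obtain ⟨n, hn⟩ := h
    exact ⟨n, hn.le⟩
  let nN : ℕ → ℕ := fun N => Nat.find (hex N)
  have hnN : ∀ N, τ (nN N) ≤ 1 / g N := fun N => Nat.find_spec (hex N)
  let J : ℕ → ℕ := fun K => Nat.findGreatest (fun N => nN N + N ≤ K) K
  refine ⟨J, fun K => Nat.findGreatest_le K, ?_, ?_⟩
  · refine tendsto_atTop_atTop.2 fun N => ⟨nN N + N, fun K hK => ?_⟩
    exact Nat.le_findGreatest (le_trans (Nat.le_add_left N (nN N)) hK) hK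
  · have hbound : ∀ K, (J K : ℝ) * (f (J K) + 1) * τ (K - J K) ≤ 1 / ((J K : ℝ) + 1) := by
      intro K
      by_cases h0 : J K = 0
      · rw [h0]; simp
      · have hP : nN (J K) + J K ≤ K := (Nat.findGreatest_eq_iff.1 rfl).2.1 h0
        have hdepth : nN (J K) ≤ K - J K := by omega
        have hτle : τ (K - J K) ≤ 1 / g (J K) := le_trans (hτa hdepth) (hnN (J K))
        have hN0 : (0 : ℝ) ≤ J K := Nat.cast_nonneg _
        have hf1 : 0 ≤ f (J K) + 1 := by linarith [hf (J K)]
        calc (J K : ℝ) * (f (J K) + 1) * τ (K - J K)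
            ≤ (J K : ℝ) * (f (J K) + 1) * (1 / g (J K)) :=
              mul_le_mul_of_nonneg_left hτle (mul_nonneg hN0 hf1)
          _ = (J K : ℝ) * ((f (J K) + 1) / (S (J K) + 1)) / ((J K : ℝ) + 1) ^ 2 := by
              simp only [g]; field_simp
          _ ≤ (J K : ℝ) * 1 / ((J K : ℝ) + 1) ^ 2 := by
              gcongr
              · exact (div_le_one (by linarith [hS0 (J K)])).2 (by linarith [hSf (J K)])
          _ ≤ 1 / ((J K : ℝ) + 1) := by
              rw [div_le_div_iff₀ (by positivity) (by positivity)]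
              nlinarith
    have hnonneg : ∀ K, 0 ≤ (J K : ℝ) * (f (J K) + 1) * τ (K - J K) := fun K =>
      mul_nonneg (mul_nonneg (Nat.cast_nonneg _) (by linarith [hf (J K)])) (hτ0 _)
    have hJ : Tendsto J atTop atTop := by
      refine tendsto_atTop_atTop.2 fun N => ⟨nN N + N, fun K hK => ?_⟩
      exact Nat.le_findGreatest (le_trans (Nat.le_add_left N (nN N)) hK) hK
    have hlim : Tendsto (fun K => 1 / ((J K : ℝ) + 1)) atTop (𝓝 0) :=
      tendsto_one_div_add_atTop_nhds_zero_nat.comp hJ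
    exact squeeze_zero hnonneg hbound hlim

/-- The diagonal schedule with the seed height STRICTLY below the cut-off (`J K < K` for `K ≥ 1`): shift the schedule of
`diagonalSchedule` by one (`J' K := J (K - 1)`); the product bound survives because `τ` is antitone. -/
theorem diagonalScheduleStrict (f τ : ℕ → ℝ) (hf : ∀ n, 0 ≤ f n) (hτ0 : ∀ n, 0 ≤ τ n) (hτa : Antitone τ)
    (hτ : Tendsto τ atTop (𝓝 0)) :
    ∃ J : ℕ → ℕ, (∀ K, 1 ≤ K → J K < K) ∧ (∀ K, J K ≤ K) ∧ Tendsto J atTop atTop ∧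
      Tendsto (fun K => (J K : ℝ) * (f (J K) + 1) * τ (K - J K)) atTop (𝓝 0) := by
  obtain ⟨J, hJle, hJ, hprod⟩ := diagonalSchedule f τ hf hτ0 hτa hτ
  refine ⟨fun K => J (K - 1), fun K hK => lt_of_le_of_lt (hJle (K - 1)) (Nat.sub_lt hK one_pos),
    fun K => (hJle _).trans (Nat.sub_le K 1), hJ.comp (tendsto_sub_atTop_nat 1), ?_⟩
  have h := hprod.comp (tendsto_sub_atTop_nat 1)
  refine squeeze_zero' (Eventually.of_forall fun K => ?_) (Eventually.of_forall fun K => ?_) h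
  · exact mul_nonneg (mul_nonneg (Nat.cast_nonneg _) (by linarith [hf (J (K - 1))])) (hτ0 _)
  · show (J (K - 1) : ℝ) * (f (J (K - 1)) + 1) * τ (K - J (K - 1)) ≤
        (J (K - 1) : ℝ) * (f (J (K - 1)) + 1) * τ (K - 1 - J (K - 1))
    exact mul_le_mul_of_nonneg_left (hτa (Nat.sub_le_sub_right (Nat.sub_le K 1) _))
      (mul_nonneg (Nat.cast_nonneg _) (by linarith [hf (J (K - 1))]))

/-- S2 DERIVED (v6): the run-pair seed from the stage table. -/
theorem runPairSeed_of_table (hα : ClassicalTwoDepth) (hβ : FluctuationPartSmall) : RunPairSeed := by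
  intro L
  obtain ⟨pS, hβL⟩ := hβ L
  refine ⟨pS, fun b₀ p₀ hb₀ hpS hp₀ => ?_⟩
  obtain ⟨εa, hεa, Ha⟩ := hα L b₀ p₀ hb₀ hp₀
  obtain ⟨εb, hεb, Hb⟩ := hβL b₀ p₀ hb₀ hpS hp₀
  obtain ⟨γa, hγa, κa, hκa, Ha⟩ := Ha (min εa εb) (lt_min hεa hεb) (min_le_left _ _)
  obtain ⟨γb, hγb, κb, hκb, Hb⟩ := Hb (min εa εb) (lt_min hεa hεb) (min_le_right _ _)
  refine ⟨min γa γb, lt_min hγa hγb, min κa κb, lt_min hκa hκb, fun F γ hFL hγ hγ1 => ?_⟩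
  obtain ⟨P, τ, hP0, hτ0, hτa, hτt, HA⟩ := Ha F γ hFL hγ (hγ1.trans (min_le_left _ _))
  obtain ⟨φ, hφ0, hφt, HB⟩ := Hb F γ hFL hγ (hγ1.trans (min_le_right _ _))
  obtain ⟨J, hJlt, hJle, hJ, hprod⟩ := diagonalScheduleStrict P τ hP0 hτ0 hτa hτt
  -- the seed's σ
  have hφJ : Tendsto (fun K => (J K : ℝ) * φ (J K)) atTop (𝓝 0) := hφt.comp hJ
  have hJ1 : ∀ᶠ K in atTop, 1 ≤ J K := (tendsto_atTop.1 hJ) 1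
  have hPτ : Tendsto (fun K => P (J K) * τ (K - J K)) atTop (𝓝 0) := by
    refine squeeze_zero' (Eventually.of_forall fun K => mul_nonneg (hP0 _) (hτ0 _)) ?_ hprod
    filter_upwards [hJ1] with K hK
    have h1 : (1 : ℝ) ≤ J K := by exact_mod_cast hK
    have : P (J K) * τ (K - J K) ≤ (P (J K) + 1) * τ (K - J K) :=
      mul_le_mul_of_nonneg_right (by linarith) (hτ0 _)
    calc P (J K) * τ (K - J K) ≤ (P (J K) + 1) * τ (K - J K) := this
      _ = 1 * ((P (J K) + 1) * τ (K - J K)) := (one_mul _).symm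
      _ ≤ (J K : ℝ) * ((P (J K) + 1) * τ (K - J K)) :=
          mul_le_mul_of_nonneg_right h1 (mul_nonneg (by linarith [hP0 (J K)]) (hτ0 _))
      _ = (J K : ℝ) * (P (J K) + 1) * τ (K - J K) := by ring
  have hφ' : Tendsto (fun K => φ (J K)) atTop (𝓝 0) := by
    refine squeeze_zero' (Eventually.of_forall fun K => hφ0 _) ?_ hφJ
    filter_upwards [hJ1] with K hK
    have h1 : (1 : ℝ) ≤ J K := by exact_mod_cast hK
    calc φ (J K) = 1 * φ (J K) := (one_mul _).symm
      _ ≤ (J K : ℝ) * φ (J K) := mul_le_mul_of_nonneg_right h1 (hφ0 _)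
  refine ⟨J, fun K => P (J K) * τ (K - J K) + 2 * φ (J K), hJlt, hJle, hJ,
    fun K => add_nonneg (mul_nonneg (hP0 _) (hτ0 _)) (mul_nonneg zero_le_two (hφ0 _)), ?_, ?_, ?_⟩
  · simpa using hPτ.add (hφ'.const_mul 2)
  · have : Tendsto (fun K => (J K : ℝ) * (P (J K) + 1) * τ (K - J K) + 2 * ((J K : ℝ) * φ (J K))) atTop (𝓝 0) := by
      simpa using hprod.add (hφJ.const_mul 2)
    refine squeeze_zero' (Eventually.of_forall fun K => mul_nonneg (Nat.cast_nonneg _)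
      (add_nonneg (mul_nonneg (hP0 _) (hτ0 _)) (mul_nonneg zero_le_two (hφ0 _)))) (Eventually.of_forall fun K => ?_) this
    have hJK0 : (0 : ℝ) ≤ J K := Nat.cast_nonneg _
    have : (J K : ℝ) * (P (J K) * τ (K - J K)) ≤ (J K : ℝ) * ((P (J K) + 1) * τ (K - J K)) :=
      mul_le_mul_of_nonneg_left (mul_le_mul_of_nonneg_right (by linarith) (hτ0 _)) hJK0
    nlinarith [this]
  · intro ν hν1 hν2 K K' hKK' ρ₁ ρ₂ hpos hd₁ hd₂ hc₁ hc₂ b b' U V W Z hU hV hW hZ h1 h2 h3 h4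
    have hJK : J K ≤ K := hJle K
    have hJK' : J K ≤ K' := hJK.trans hKK'
    have HAx := HA (J K) K K' hJK hJK' hKK' b b' U V W Z hU hV hW hZ h1 h2 h3 h4
    have HB1 := HB ν hν1 hν2 (J K) K hJK ρ₁ (fun U hU => (hpos U hU).1) hd₁ hc₁ b b' U V W Z hU hV hW hZ h1 h2 h3 h4
    have HB2 := HB ν hν1 hν2 (J K) K' hJK' ρ₂ (fun U hU => (hpos U hU).2) hd₂ hc₂ b b' U V W Z hU hV hW hZ h1 h2 h3 h4
    -- clustering factors: κ := min κa κb
    have hd0 : (0 : ℝ) ≤ (b.src.tdist b'.src : ℝ) := Nat.cast_nonneg _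
    have hea : Real.exp (-(κa * (b.src.tdist b'.src : ℝ))) ≤ Real.exp (-(min κa κb * (b.src.tdist b'.src : ℝ))) :=
      Real.exp_le_exp.2 (neg_le_neg (mul_le_mul_of_nonneg_right (min_le_left _ _) hd0))
    have heb : Real.exp (-(κb * (b.src.tdist b'.src : ℝ))) ≤ Real.exp (-(min κa κb * (b.src.tdist b'.src : ℝ))) :=
      Real.exp_le_exp.2 (neg_le_neg (mul_le_mul_of_nonneg_right (min_le_right _ _) hd0))
    set E := Real.exp (-(min κa κb * (b.src.tdist b'.src : ℝ))) with hE
    set βK := (F.scheme ℰp γ).β K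
    set βK' := (F.scheme ℰp γ).β K'
    set mU := minActionRegPr F (J K) K hJK (min εa εb) U
    set mV := minActionRegPr F (J K) K hJK (min εa εb) V
    set mW := minActionRegPr F (J K) K hJK (min εa εb) W
    set mZ := minActionRegPr F (J K) K hJK (min εa εb) Z
    set nU := minActionRegPr F (J K) K' hJK' (min εa εb) U
    set nV := minActionRegPr F (J K) K' hJK' (min εa εb) V
    set nW := minActionRegPr F (J K) K' hJK' (min εa εb) W
    set nZ := minActionRegPr F (J K) K' hJK' (min εa εb) Z
    have hA : |(βK * mU - βK' * nU) - (βK * mV - βK' * nV) - ((βK * mW - βK' * nW) - (βK * mZ - βK' * nZ))|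
        ≤ P (J K) * τ (K - J K) * E :=
      HAx.trans (mul_le_mul_of_nonneg_left hea (mul_nonneg (hP0 _) (hτ0 _)))
    have hB1 : |((Real.log (ρ₁ U) + βK * mU) - (Real.log (ρ₁ V) + βK * mV))
        - ((Real.log (ρ₁ W) + βK * mW) - (Real.log (ρ₁ Z) + βK * mZ))| ≤ φ (J K) * E :=
      HB1.trans (mul_le_mul_of_nonneg_left heb (hφ0 _))
    have hB2 : |((Real.log (ρ₂ U) + βK' * nU) - (Real.log (ρ₂ V) + βK' * nV))
        - ((Real.log (ρ₂ W) + βK' * nW) - (Real.log (ρ₂ Z) + βK' * nZ))| ≤ φ (J K) * E :=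
      HB2.trans (mul_le_mul_of_nonneg_left heb (hφ0 _))
    have key : (Real.log (ρ₁ U) - Real.log (ρ₂ U)) - (Real.log (ρ₁ V) - Real.log (ρ₂ V)) -
        ((Real.log (ρ₁ W) - Real.log (ρ₂ W)) - (Real.log (ρ₁ Z) - Real.log (ρ₂ Z)))
        = (((Real.log (ρ₁ U) + βK * mU) - (Real.log (ρ₁ V) + βK * mV))
            - ((Real.log (ρ₁ W) + βK * mW) - (Real.log (ρ₁ Z) + βK * mZ)))
          - (((Real.log (ρ₂ U) + βK' * nU) - (Real.log (ρ₂ V) + βK' * nV))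
            - ((Real.log (ρ₂ W) + βK' * nW) - (Real.log (ρ₂ Z) + βK' * nZ)))
          - ((βK * mU - βK' * nU) - (βK * mV - βK' * nV) - ((βK * mW - βK' * nW) - (βK * mZ - βK' * nZ))) := by ring
    rw [key]
    calc _ ≤ |(((Real.log (ρ₁ U) + βK * mU) - (Real.log (ρ₁ V) + βK * mV))
            - ((Real.log (ρ₁ W) + βK * mW) - (Real.log (ρ₁ Z) + βK * mZ)))
          - (((Real.log (ρ₂ U) + βK' * nU) - (Real.log (ρ₂ V) + βK' * nV))
            - ((Real.log (ρ₂ W) + βK' * nW) - (Real.log (ρ₂ Z) + βK' * nZ)))|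
          + |(βK * mU - βK' * nU) - (βK * mV - βK' * nV) - ((βK * mW - βK' * nW) - (βK * mZ - βK' * nZ))| := abs_sub _ _
      _ ≤ (|((Real.log (ρ₁ U) + βK * mU) - (Real.log (ρ₁ V) + βK * mV))
            - ((Real.log (ρ₁ W) + βK * mW) - (Real.log (ρ₁ Z) + βK * mZ))|
          + |((Real.log (ρ₂ U) + βK' * nU) - (Real.log (ρ₂ V) + βK' * nV))
            - ((Real.log (ρ₂ W) + βK' * nW) - (Real.log (ρ₂ Z) + βK' * nZ))|)
          + |(βK * mU - βK' * nU) - (βK * mV - βK' * nV) - ((βK * mW - βK' * nW) - (βK * mZ - βK' * nZ))| :=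
          add_le_add_left (abs_sub _ _) _
      _ ≤ (φ (J K) * E + φ (J K) * E) + P (J K) * τ (K - J K) * E := add_le_add (add_le_add hB1 hB2) hA
      _ = (P (J K) * τ (K - J K) + 2 * φ (J K)) * E := by ring

theorem stub_runPairSeed : RunPairSeed :=
  runPairSeed_of_table stub_classicalTwoDepth stub_fluctuationPartSmall

/-- O1ᵘ-H v2 · v18 OPEN STUB (XL; REPLACES v17.2's `stub_oneStepContractionRun` — a RE-TYPING of the open organ stub in the Hessian currency, not a
closure; NOT PRINTED as a theorem — [Balaban1985UV3] p.263 (c) + [Balaban1988RG2] (0.3)–(0.12) give the analyticity ∕ localisation it would be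
assembled from).  The v17.2 text `OneStepContractionRun` and its PROVED edge `finiteChain_supR` stay below for the record (v17 verdict: the sup-currency
`∀ κ` organ is at best unfounded). -/
theorem stub_oneStepTransportUH : OneStepTransportUH := by
  sorry

/-- FC · FINITE BACKWARD CHAIN (M; adapt the landed proof of 23158 `backwardLiouvilleRigidity_backwardChainLemmaAdm_proof`, p660990):
iterating O1 from the top `T` (data `c = 0, a = 0, w = ω_T`) down to `j` gives `V_j ≤ e^{Σε+Σεd}(θω_T/p_T² + Σ_{k≥j}δ_k)` under the two
smallness side conditions, and the one-bond oscillation of `L_j` is `≤ V_j·(p_j²/θ + 2β_j#Plaq_j) ≤ V_j·2·(1/θ + 2β_j#Plaq_j)` once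
`p_j² ≤ 2θ·β_j#Plaq_j` (fold into `j₁`); S3's `ε` is `ε + εd` shifted by `log 2`, its `C` is O1's.
v16 (κ-CEILING organ O1-R1): `finiteChain_supR` = the landed `finiteChain_sup` (p682954 + p683255) re-run with the organ consumed at rate `min κ κ₀` —
the same abstract chain `finiteChain_core`, threshold height, marginal weights and termination `osc_of_datum` BY NAME; only the top datum is
converted from rate `κ` to rate `min κ κ₀` (`e^{-κ t} ≤ e^{-(min κ κ₀) t}` for `t ≥ 0`).  PROVED. -/
theorem finiteChain_supR : OneStepContractionRun → BackwardStabilityFinSup := by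
  classical
  rintro ⟨γ₁, hγ₁, H⟩
  refine ⟨min γ₁ 1, lt_min hγ₁ one_pos, ?_⟩
  intro F γ hγ hle b₀ p₀ κ j₀ prm η hb₀ hp₀ hadm hκ hη0 hηs hηs2 hηt
  have hγ₁' : γ ≤ γ₁ := hle.trans (min_le_left _ _)
  have hγ1 : γ ≤ 1 := hle.trans (min_le_right _ _)
  -- v16 (O1-R1, κ-ceiling): the organ delivers a class ceiling `κ₀`; the chain runs at rate `min κ κ₀` (the top hypothesis at rate `κ`
  -- implies the one at rate `min κ κ₀` by monotonicity of `Real.exp`; S3's conclusion is κ-free).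
  obtain ⟨κ₀, hκ₀, H'⟩ := H F γ hγ hγ₁' b₀ p₀ j₀ prm η hb₀ hp₀ hadm hη0 hηs hηs2 hηt
  have hκ' : 0 < min κ κ₀ := lt_min hκ hκ₀
  obtain ⟨θ, C, w₀, ε, εd, δ, j₁, hθ, hC, hw₀, hεδ, hεs, hεds, hδs, hDs, hD0, hj₀₁, hstep⟩ := H' (min κ κ₀) hκ' (min_le_right _ _)
  obtain ⟨j₂, hj₂⟩ := Summit.QuantumFields.YangMills.Theorems.FluctuationComparisonRegPrIntL.RunPairOrgan.exists_threshold_height F hγ hγ1 hb₀ hθ p₀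
  have hite : HasSum (fun k : ℕ => if k = 0 then Real.log 2 else 0) (Real.log 2) := hasSum_ite_eq 0 _
  have hlog2 : 0 < Real.log 2 := Real.log_pos one_lt_two
  refine ⟨θ / b₀ ^ 2, C, w₀, fun k => ε k + εd k + (if k = 0 then Real.log 2 else 0), δ, max j₁ j₂,
    by positivity, hC, hw₀, fun k => ⟨?_, (hεδ k).2.2⟩, (hεs.add hεds).add hite.summable, hδs, hDs, hD0,
    hj₀₁.trans (le_max_left _ _), ?_⟩
  · have h1 := (hεδ k).1
    have h2 := (hεδ k).2.1
    have h3 : (0 : ℝ) ≤ (if k = 0 then Real.log 2 else 0) := by split_ifs <;> linarith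
    show 0 ≤ ε k + εd k + (if k = 0 then Real.log 2 else 0)
    linarith
  intro ν hGν hCν K K' hKK' T Tt ωT hTt hTtK hωT μ μ' ρ ρ' hanch hcut hcons hfin hcl hseed j hj hjT hsmall hquad b U V hU hV hUV
  have hj₁ : j₁ ≤ j := (le_max_left _ _).trans hj
  have hj₂' : j₂ ≤ j := (le_max_right _ _).trans hj
  -- the total loss `E` and the factor `2 = e^{log 2}`
  set E : ℝ := ∑' k, ε k + ∑' k, εd k with hEdef
  have hsumε' : ∑' k, (ε k + εd k + (if k = 0 then Real.log 2 else 0)) = E + Real.log 2 := by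
    rw [(hεs.add hεds).tsum_add hite.summable, hεs.tsum_add hεds, hite.tsum_eq]
  have hexpE : Real.exp ((E + Real.log 2) + 1) = Real.exp (E + 1) * 2 := by
    rw [show (E + Real.log 2) + 1 = (E + 1) + Real.log 2 by ring, Real.exp_add, Real.exp_log two_pos]
  have hexp_le : Real.exp (E + 1) ≤ Real.exp ((E + Real.log 2) + 1) := Real.exp_le_exp.mpr (by linarith)
  have hG : 0 < Real.exp (E + 1) := Real.exp_pos _
  simp only [hsumε'] at hsmall hquad ⊢
  -- marginal weights
  have hm0 : ∀ i, 0 ≤ θ / ((F.L : ℝ) ^ i / γ * θBal F.L γ b₀ p₀ i ^ 2) := fun i => by positivity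
  have hmj : 0 < θ / ((F.L : ℝ) ^ j / γ * θBal F.L γ b₀ p₀ j ^ 2) := by
    have hθB := T3MinimiserStabilityReduction.θBal_pos (L := F.L) F.hL.2.le hγ hγ1 hb₀ p₀ j
    have hL0 : (0 : ℝ) < F.L := by exact_mod_cast (zero_lt_one.trans F.hL.2)
    exact div_pos hθ (mul_pos (div_pos (pow_pos hL0 j) hγ) (pow_pos hθB 2))
  have hmT : θ / ((F.L : ℝ) ^ T / γ * θBal F.L γ b₀ p₀ T ^ 2) ≤ θ / b₀ ^ 2 :=
    Summit.QuantumFields.YangMills.Theorems.FluctuationComparisonRegPrIntL.RunPairOrgan.marginalWeight_le F hγ hγ1 hb₀ hp₀ hθ.le T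
  set B : ℝ := θ / ((F.L : ℝ) ^ T / γ * θBal F.L γ b₀ p₀ T ^ 2) * ωT with hBdef
  have hB0 : 0 ≤ B := mul_nonneg (hm0 T) hωT
  have hBle : B ≤ θ / b₀ ^ 2 * ωT := mul_le_mul_of_nonneg_right hmT hωT
  have hθ' : 0 < θ / b₀ ^ 2 := by positivity
  have hDt0 : 0 ≤ ∑' k, δ (k + j) := tsum_nonneg fun k => (hεδ _).2.2
  have hDD0 : 0 ≤ ∑' i, ∑' k, δ (k + (i + j)) := tsum_nonneg fun i => tsum_nonneg fun k => (hεδ _).2.2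
  -- the reflected loss sum: the depths `Tt − (k+2)`, `k ∈ [j, T)`, are distinct and `≥ Tt − 1 − T`
  have hEsum : ∑ k ∈ Finset.Ico j T, (ε k + εd (Tt - (k + 2))) ≤ E := by
    rw [Finset.sum_add_distrib]
    refine add_le_add (hεs.sum_le_tsum _ fun k _ => (hεδ k).1) ?_
    have hsub : Finset.Ico j T ⊆ Finset.Ico j (Tt - 1) := Finset.Ico_subset_Ico le_rfl (by omega)
    calc ∑ k ∈ Finset.Ico j T, εd (Tt - (k + 2))
        = ∑ k ∈ Finset.Ico j T, εd ((Tt - 1) - (k + 1)) :=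
          Finset.sum_congr rfl fun k _ => by congr 1; omega
      _ ≤ ∑ k ∈ Finset.Ico j (Tt - 1), εd ((Tt - 1) - (k + 1)) :=
          Finset.sum_le_sum_of_subset_of_nonneg hsub fun k _ _ => (hεδ _).2.1
      _ ≤ ∑' n, εd n := Summit.QuantumFields.YangMills.Theorems.FluctuationComparisonRegPrIntL.RunPairOrgan.sum_Ico_reflect_le_tsum (fun n => (hεδ n).2.1) hεds j (Tt - 1)
  -- the two smallness conditions in the chain's currency
  have hsmall' : Real.exp (E + 1) * (B + ∑' k, δ (k + j)) ≤ w₀ :=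
    le_trans (mul_le_mul hexp_le (by linarith) (by linarith) (Real.exp_pos _).le) hsmall
  have hquad' : C * (Real.exp (E + 1) * (((T - j : ℕ) : ℝ) * B + ∑' i, ∑' k, δ (k + (i + j)))) ≤ 1 := by
    have hTj : ((T - j : ℕ) : ℝ) ≤ (T : ℝ) := by exact_mod_cast Nat.sub_le T j
    have h1 : ((T - j : ℕ) : ℝ) * B ≤ (T : ℝ) * (θ / b₀ ^ 2 * ωT) :=
      mul_le_mul hTj hBle hB0 (Nat.cast_nonneg _)
    have h2 : Real.exp (E + 1) * (((T - j : ℕ) : ℝ) * B + ∑' i, ∑' k, δ (k + (i + j))) ≤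
        Real.exp ((E + Real.log 2) + 1) * ((T : ℝ) * (θ / b₀ ^ 2 * ωT) + ∑' i, ∑' k, δ (k + (i + j))) :=
      mul_le_mul hexp_le (by linarith) (by positivity) (Real.exp_pos _).le
    exact le_trans (mul_le_mul_of_nonneg_left h2 hC) hquad
  -- the chain (the organ is applied with its top `Tt`; the step `i+1 → i` needs `i + 2 ≤ Tt`, i.e. `i + 1 ≤ T < Tt`)
  obtain ⟨a, w, ha, hw, hVle, c, hcB, h4⟩ := Summit.QuantumFields.YangMills.Theorems.FluctuationComparisonRegPrIntL.RunPairOrgan.finiteChain_core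
    (fun i a w => ∃ c : Plaq (F.P i) 0 → ℝ, (∀ p, |c p| ≤ a) ∧ (∀ (b b' : PBond (F.P i) 0) U V W Z, PlaqSmall (θBal F.L γ b₀ p₀ i) U → PlaqSmall (θBal F.L γ b₀ p₀ i) V → PlaqSmall (θBal F.L γ b₀ p₀ i) W → PlaqSmall (θBal F.L γ b₀ p₀ i) Z → (∀ e, e ≠ b → U e = V e) → (∀ e, e ≠ b' → U e = W e) → (∀ e, e ≠ b' → V e = Z e) → (∀ e, e ≠ b → W e = Z e) → |(Real.log (ρ i U) - Real.log (ρ' i U) - ((F.L : ℝ) ^ i / γ) * ∑ p, c p * (1 - reTr (GaugeField.plaqHol U p))) - (Real.log (ρ i V) - Real.log (ρ' i V) - ((F.L : ℝ) ^ i / γ) * ∑ p, c p * (1 - reTr (GaugeField.plaqHol V p))) - ((Real.log (ρ i W) - Real.log (ρ' i W) - ((F.L : ℝ) ^ i / γ) * ∑ p, c p * (1 - reTr (GaugeField.plaqHol W p))) - (Real.log (ρ i Z) - Real.log (ρ' i Z) - ((F.L : ℝ) ^ i / γ) * ∑ p, c p * (1 - reTr (GaugeField.plaqHol Z p))))| ≤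 w * Real.exp (-(min κ κ₀ * (b.src.tdist b'.src : ℝ)))))
    (fun i => θ / ((F.L : ℝ) ^ i / γ * θBal F.L γ b₀ p₀ i ^ 2))
    (fun i => ε i + εd (Tt - (i + 2))) δ C w₀ B E j T
    hm0 (fun i => add_nonneg (hεδ i).1 (hεδ _).2.1) (fun i => (hεδ i).2.2) hC hB0 hδs hDs hEsum hjT
    ⟨0, ωT, le_rfl, hωT, by simp [hBdef], fun _ => 0, fun p => by simp, by
      intro b₁ b₂ U₁ V₁ W₁ Z₁ hU₁ hV₁ hW₁ hZ₁ h₁ h₂ h₃ h₄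
      simp only [zero_mul, Finset.sum_const_zero, mul_zero, sub_zero]
      exact (hseed b₁ b₂ U₁ V₁ W₁ Z₁ hU₁ hV₁ hW₁ hZ₁ h₁ h₂ h₃ h₄).trans
        (mul_le_mul_of_nonneg_left (Real.exp_le_exp.mpr
          (neg_le_neg (mul_le_mul_of_nonneg_right (min_le_left κ κ₀) (Nat.cast_nonneg _)))) hωT)⟩
    (by
      intro i hji hiT a w ha hw hside hD
      obtain ⟨c, hcB, h4⟩ := hD
      obtain ⟨c', a', w', ha', hw', hV', hcB', h4'⟩ :=
        hstep ν hGν hCν K K' hKK' T Tt hTt hTtK μ μ' ρ ρ' hanch hcut hcons hfin hcl i (hj₁.trans hji) (by omega) (by omega) c a w ha hw hside ⟨hcB, h4⟩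
      refine ⟨a', w', ha', hw', ?_, c', hcB', h4'⟩
      linarith [hV'])
    hsmall' hquad'
  -- termination at height `j`
  have hW0 : 0 ≤ Real.exp (E + 1) * (B + ∑' k, δ (k + j)) := mul_nonneg hG.le (add_nonneg hB0 hDt0)
  have hosc := Summit.QuantumFields.YangMills.Theorems.FluctuationComparisonRegPrIntL.RunPairOrgan.osc_of_datum F (ρ j) (ρ' j) c ha hw hγ hκ'.le hθ' hW0 hmj hVle (hj₂ j hj₂') hcB h4 b U V hU hV hUV
  have hX0 : 0 ≤ 1 / (θ / b₀ ^ 2) + 2 * ((F.L : ℝ) ^ j / γ) * (Fintype.card (Plaq (F.P j) 0) : ℝ) := by positivity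
  refine hosc.trans ?_
  rw [hexpE]
  have h2W : 2 * (Real.exp (E + 1) * (B + ∑' k, δ (k + j))) ≤ Real.exp (E + 1) * 2 * (θ / b₀ ^ 2 * ωT + ∑' k, δ (k + j)) := by
    have := mul_le_mul_of_nonneg_left (add_le_add_right hBle (∑' k, δ (k + j))) hG.le
    linarith
  exact mul_le_mul_of_nonneg_right h2W hX0

/-- S4a is CLOSED in the tree BY NAME (v8): width seat ym-line-sfw-p2-w3 g31 landed
`Theorems/FluctuationComparisonRegPrIntLRunPairOrganInnerWindowChains.lean`, discharging the verbatim copy of `InnerWindowChains` by the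
termination line's tree theorem `FlatRatioTermination.innerWindowChains`. -/
theorem stub_innerWindowChains : InnerWindowChains :=
  Summit.QuantumFields.YangMills.Theorems.FluctuationComparisonRegPrIntL.RunPairOrgan.stub_innerWindowChains

/-- S4b is CLOSED in the tree BY NAME: p671363 (width seat ym-line-sfw-p2-w3 g29, 21:49Z) landed
`Summits/QuantumFields/YangMills/Theorems/FluctuationComparisonRegPrIntLRunPairOrganWindowTV.lean`, discharging the verbatim copy of
`WindowTV` by `FlatRatioTermination.stub_windowTV` (p647765); definitionally equal, so the stub is closed by that theorem. -/
theorem stub_windowTV : WindowTV :=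
  Summit.QuantumFields.YangMills.Theorems.FluctuationComparisonRegPrIntL.RunPairOrgan.stub_windowTV

/-- S4bᴼ is CLOSED in the tree BY NAME (v18): ✓p798125 LEAD w3 g24 pen 10 `Theorems/FluctuationComparisonRegPrIntLRunPairOrganWindowTVOfSupOsc.lean`;
`WindowTVOsc` is that theorem's statement verbatim (definitionally equal). -/
theorem stub_windowTVOsc : WindowTVOsc :=
  Summit.QuantumFields.YangMills.Theorems.RunPairOrganWindowTVOfSupOsc.windowTV_of_supOsc

/-- S4c is CLOSED in the tree BY NAME: p670105 (commit dc0300a2215d) landed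
`Summits/QuantumFields/YangMills/Theorems/FluctuationComparisonRegPrIntLRunPairOrganIntegralOfTV.lean`; the statement there is a
verbatim copy of `IntegralOfTV` (definitionally equal), so the stub is discharged by the landed theorem. -/
theorem stub_integralOfTV : IntegralOfTV :=
  Summit.QuantumFields.YangMills.Theorems.FluctuationComparisonRegPrIntL.RunPairOrgan.stub_integralOfTV

/-! ## §V18.J THE JUNCTION O1ᵘ-H v2 ⟹ S3ᴴ (BY TEXT = crux workfile `JunctionDirectTransport.lean` v1.2 §C–§F incl. px19 g18's five `linarith only` budget edits,
kernel-checked, 0 sorry; §B = ✓p799177 `…OrganTangentAnchorFreeOscillation` BY NAME; to be replaced by `import` of px19 g18's Theorems lift at text freeze — LEAD №11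
ORDERING lifts-before-emission).  REPLACES v17.2's `stub_finiteChain` ∕ `backwardStabilityFinSup_of_stubs`. -/

section V18Junction

open Function
open T4CubeChartGnomonic (SU2)
open T4HaarSU2ExpChart (expPoint)
open T4CubeChartExp (expPt toE)
open B15SU2ChartHolomorphic (expPointC coe_expPoint_eq_expPointC)
open Summit.QuantumFields.YangMills.Theorems.OrganTangentTelescopeWindowPath (firstDiff_step_on clause_update_of_HClauseSq)
open Summit.QuantumFields.YangMills.Theorems.OrganTangentSmallStepOneBond (plaqDev_update_le)
open Summit.QuantumFields.YangMills.Theorems.OrganTangentAnchorFreeOscillation (osc_flat_window_path_le)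
open scoped BigOperators


/-! ## §C Small helpers -/

section Helpers

variable {α β : Type*} [Fintype α] [DecidableEq α]

/-- `∑_b #{steps at b} = #steps`. -/
theorem sum_countP_fst_eq_length (l : List (α × β)) :
    ∑ b, l.countP (fun q => decide (q.1 = b)) = l.length := by
  induction l with
  | nil => simp
  | cons a l ih =>
    simp only [List.countP_cons, List.length_cons, Finset.sum_add_distrib, ih]
    have : ∑ b : α, (if decide (a.1 = b) = true then 1 else 0) = 1 := by
      simp [Finset.sum_ite_eq]
    omega

end Helpers

/-- `dist1 (expPt v) ≤ √3·‖v‖` (sup-norm coordinates). -/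
theorem dist1_expPt_le_sqrt3_mul_norm (v : Fin 3 → ℝ) : dist1 (expPt v) ≤ Real.sqrt 3 * ‖v‖ :=
  T4ExpWindowSmallField.dist1_expPt_le_of_mem_cube (T4CubePoincare.mem_cube_iff.2 fun i => by
    rw [← Real.norm_eq_abs]; exact norm_le_pi_norm v i)

/-- A row-mass bound dominates every letter: `0 ≤ k`, `κ ≥ 0` ⇒ `k b b′ ≤ ∑_{b″} k b b″·e^{κ d} ≤ w`. -/
theorem letter_le_rowMass {P : Params} {j : ℕ} {k : PBond P j → PBond P j → ℝ} {κ w : ℝ} (hκ : 0 ≤ κ)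
    (hk : ∀ b b', 0 ≤ k b b') (hrow : ∀ b, ∑ b', k b b' * Real.exp (κ * (b.src.tdist b'.src : ℝ)) ≤ w) (b b' : PBond P j) :
    k b b' ≤ w := by
  have h1 : k b b' ≤ k b b' * Real.exp (κ * (b.src.tdist b'.src : ℝ)) :=
    le_mul_of_one_le_right (hk b b') (Real.one_le_exp (mul_nonneg hκ (Nat.cast_nonneg _)))
  have h2 : k b b' * Real.exp (κ * (b.src.tdist b'.src : ℝ)) ≤ ∑ b'', k b b'' * Real.exp (κ * (b.src.tdist b''.src : ℝ)) :=
    Finset.single_le_sum (f := fun b'' => k b b'' * Real.exp (κ * (b.src.tdist b''.src : ℝ)))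
      (fun b'' _ => mul_nonneg (hk b b'') (Real.exp_nonneg _)) (Finset.mem_univ b')
  exact h1.trans (h2.trans (hrow b))

/-- Row-mass bounds are monotone in the rate: `κ′ ≤ κ` ⇒ `∑ k·e^{κ′d} ≤ ∑ k·e^{κd} ≤ w`. -/
theorem rowMass_mono {P : Params} {j : ℕ} {k : PBond P j → PBond P j → ℝ} {κ κ' w : ℝ} (hκ : κ' ≤ κ)
    (hk : ∀ b b', 0 ≤ k b b') (hrow : ∀ b, ∑ b', k b b' * Real.exp (κ * (b.src.tdist b'.src : ℝ)) ≤ w) (b : PBond P j) :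
    ∑ b', k b b' * Real.exp (κ' * (b.src.tdist b'.src : ℝ)) ≤ w := by
  refine (Finset.sum_le_sum fun b' _ => ?_).trans (hrow b)
  exact mul_le_mul_of_nonneg_left (Real.exp_le_exp.2 (mul_le_mul_of_nonneg_right hκ (Nat.cast_nonneg _))) (hk b b')

/-- `θBal` is linear in `b₀`: the path profile `b₀∕8`. -/
theorem θBal_div8 (L : ℕ) (γ b₀ p₀ : ℝ) (i : ℕ) : θBal L γ (b₀ / 8) p₀ i = θBal L γ b₀ p₀ i / 8 := by
  rw [show b₀ / 8 = (1 / 8) * b₀ by ring, T3InteriorExcision.θBal_mul]; ring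


/-! ## §D The per-height core: OUTPUT clause + gauge invariance + (P-b′)'s chord path ⇒ sup-oscillation of the clause's `R` -/

section Core

open Summit.QuantumFields.YangMills.Theorems.OrganTangentFlatAnchorEven (flatBond_apply_inv_eq)

/-- Count arithmetic: (P-b′) v1.1's per-bond multiplicity at path profile `θ∕8` with step `δ := σ·θ∕4`, times `σ`, is `≤ 10∕√θ`
(`θ ≤ 1`, `σ ≤ 1∕16`, `π ≤ 4`). -/
theorem count_mul_sigma_le {θ σ : ℝ} (hθ : 0 < θ) (hθ1 : θ ≤ 1) (hσ : 0 < σ) (hσ1 : σ ≤ 1 / 16) :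
    ((⌈1 / (Real.sqrt (θ / 8) / 16)⌉₊ *
        (⌈Real.pi / 2 * (3 * (Real.sqrt (θ / 8) / 16) ^ 2 / 2) / (σ * (θ / 4))⌉₊ + 2) : ℕ) : ℝ) * σ ≤ 10 / Real.sqrt θ := by
  have hs0 : 0 < Real.sqrt (θ / 8) := Real.sqrt_pos.2 (by positivity)
  have hs2 : Real.sqrt (θ / 8) ^ 2 = θ / 8 := Real.sq_sqrt (by positivity)
  have ht0 : 0 < Real.sqrt θ := Real.sqrt_pos.2 hθ
  have ht1 : Real.sqrt θ ≤ 1 := Real.sqrt_le_one.mpr hθ1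
  have h3s : Real.sqrt θ ≤ 3 * Real.sqrt (θ / 8) := by
    have h := Real.sqrt_le_sqrt (show θ ≤ 9 * (θ / 8) by linarith)
    rwa [Real.sqrt_mul (by norm_num : (0:ℝ) ≤ 9), show Real.sqrt 9 = 3 by
      rw [show (9:ℝ) = 3 ^ 2 by norm_num, Real.sqrt_sq (by norm_num : (0:ℝ) ≤ 3)]] at h
  -- first factor `⌈16∕s⌉₊ ≤ 49∕√θ`
  have hA : (⌈1 / (Real.sqrt (θ / 8) / 16)⌉₊ : ℝ) ≤ 49 / Real.sqrt θ := by
    have hx : 0 ≤ 1 / (Real.sqrt (θ / 8) / 16) := by positivity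
    have h1 := Nat.ceil_lt_add_one hx
    have h2 : 1 / (Real.sqrt (θ / 8) / 16) ≤ 48 / Real.sqrt θ := by
      rw [div_div_eq_mul_div, one_mul, div_le_div_iff₀ hs0 ht0]
      nlinarith [h3s]
    have h3 : (1:ℝ) ≤ 1 / Real.sqrt θ := by rw [le_div_iff₀ ht0]; linarith
    calc (⌈1 / (Real.sqrt (θ / 8) / 16)⌉₊ : ℝ) ≤ 1 / (Real.sqrt (θ / 8) / 16) + 1 := h1.le
      _ ≤ 48 / Real.sqrt θ + 1 / Real.sqrt θ := add_le_add h2 h3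
      _ = 49 / Real.sqrt θ := by ring
  -- second factor times `σ`: `(⌈3π∕(2048σ)⌉₊ + 2)·σ ≤ 1∕5`
  have hq : Real.pi / 2 * (3 * (Real.sqrt (θ / 8) / 16) ^ 2 / 2) / (σ * (θ / 4)) = 3 * Real.pi / (2048 * σ) := by
    rw [div_pow, hs2]; field_simp; ring
  have hB : ((⌈Real.pi / 2 * (3 * (Real.sqrt (θ / 8) / 16) ^ 2 / 2) / (σ * (θ / 4))⌉₊ : ℝ) + 2) * σ ≤ 1 / 5 := by
    rw [hq]
    have hx : 0 ≤ 3 * Real.pi / (2048 * σ) := by positivity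
    have h1 := Nat.ceil_lt_add_one hx
    have hpi := Real.pi_le_four
    calc ((⌈3 * Real.pi / (2048 * σ)⌉₊ : ℝ) + 2) * σ ≤ (3 * Real.pi / (2048 * σ) + 1 + 2) * σ := by
          apply mul_le_mul_of_nonneg_right _ hσ.le; linarith
      _ = 3 * Real.pi / 2048 + 3 * σ := by field_simp; ring
      _ ≤ 1 / 5 := by nlinarith
  push_cast
  calc (⌈1 / (Real.sqrt (θ / 8) / 16)⌉₊ : ℝ) *
        ((⌈Real.pi / 2 * (3 * (Real.sqrt (θ / 8) / 16) ^ 2 / 2) / (σ * (θ / 4))⌉₊ : ℝ) + 2) * σ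
      = (⌈1 / (Real.sqrt (θ / 8) / 16)⌉₊ : ℝ) *
        (((⌈Real.pi / 2 * (3 * (Real.sqrt (θ / 8) / 16) ^ 2 / 2) / (σ * (θ / 4))⌉₊ : ℝ) + 2) * σ) := by ring
    _ ≤ 49 / Real.sqrt θ * (1 / 5) := mul_le_mul hA hB (by positivity) (by positivity)
    _ ≤ 10 / Real.sqrt θ := by rw [div_mul_div_comm, div_le_div_iff₀ (by positivity) ht0]; nlinarith

variable {F : T3Family} {γ b₀ p₀ : ℝ} {j : ℕ}

/-- ★ THE PER-HEIGHT CORE.  An H-clause for a gauge-invariant `R` on the `θ_j∕4`-window with cap `rr` and letters `k ≤ K`, and (P-b′)'s chord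
path at profile `b₀∕8` with step `σ·θ_j∕4` (`σ ≤ rr`, `σ ≤ 1∕16`, `θ_j ≤ 1`) from `1` to a gauge copy of `U`, give
`|R U − R 1| ≤ 150·K·#PBond_j²∕θ_j` (TN-ANCHOR-FREE + TN-OSC: `osc_flat_window_path_le`, `n·σ ≤ 10·#PBond_j∕√θ_j`). [bookkeeping] -/
theorem supOsc_core [DecidableEq (PBond (F.P j) 0)]
    (hθ : 0 < θBal F.L γ b₀ p₀ j) (hθ1 : θBal F.L γ b₀ p₀ j ≤ 1)
    {rr K σ : ℝ} (hK : 0 ≤ K) (hσ : 0 < σ) (hσr : σ ≤ rr) (hσ1 : σ ≤ 1 / 16)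
    {k : PBond (F.P j) 0 → PBond (F.P j) 0 → ℝ} {R : GaugeField (F.P j) 0 SU2 → ℝ}
    (hk : ∀ b b', 0 ≤ k b b' ∧ k b b' ≤ K)
    (hcl : HClauseSq (θBal F.L γ b₀ p₀ j / 4) rr k R) (hinv : GaugeField.GaugeInvariant R)
    (U : GaugeField (F.P j) 0 SU2) (u : GaugeTransf (F.P j) 0 SU2) (path : List (PBond (F.P j) 0 × (Fin 3 → ℝ)))
    (hsz : ∀ q ∈ path, ‖q.2‖ ≤ σ * (θBal F.L γ b₀ p₀ j / 4))
    (hcount : ∀ b : PBond (F.P j) 0, path.countP (fun q => decide (q.1 = b)) ≤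
      ⌈1 / (Real.sqrt (θBal F.L γ (b₀ / 8) p₀ j) / 16)⌉₊ *
        (⌈Real.pi / 2 * (3 * (Real.sqrt (θBal F.L γ (b₀ / 8) p₀ j) / 16) ^ 2 / 2) / (σ * (θBal F.L γ b₀ p₀ j / 4))⌉₊ + 2))
    (hend : List.foldl (fun (W : GaugeField (F.P j) 0 SU2) (q : PBond (F.P j) 0 × (Fin 3 → ℝ)) => update W q.1 (W q.1 * expPt q.2)) 1 path =
      GaugeField.gaugeAct u U)
    (hpre : ∀ m : ℕ, m ≤ path.length → PlaqSmall (θBal F.L γ (b₀ / 8) p₀ j)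
      (List.foldl (fun (W : GaugeField (F.P j) 0 SU2) (q : PBond (F.P j) 0 × (Fin 3 → ℝ)) => update W q.1 (W q.1 * expPt q.2)) 1 (path.take m)))
    (hexc : ∀ m : ℕ, m ≤ path.length → ∀ (b : PBond (F.P j) 0) (w : Fin 3 → ℝ),
      PlaqSmall (θBal F.L γ (b₀ / 8) p₀ j + 4 * dist1 (expPt w))
        (update (List.foldl (fun (W : GaugeField (F.P j) 0 SU2) (q : PBond (F.P j) 0 × (Fin 3 → ℝ)) => update W q.1 (W q.1 * expPt q.2)) 1 (path.take m)) b
          ((List.foldl (fun (W : GaugeField (F.P j) 0 SU2) (q : PBond (F.P j) 0 × (Fin 3 → ℝ)) => update W q.1 (W q.1 * expPt q.2)) 1 (path.take m)) b *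
            expPt w))) :
    |R U - R 1| ≤ 150 * K * (Fintype.card (PBond (F.P j) 0) : ℝ) ^ 2 / θBal F.L γ b₀ p₀ j := by
  have h8 : θBal F.L γ (b₀ / 8) p₀ j = θBal F.L γ b₀ p₀ j / 8 := θBal_div8 F.L γ b₀ p₀ j
  rw [h8] at hcount hpre hexc
  set θj := θBal F.L γ b₀ p₀ j with hθj
  have hθW : 0 < θj / 4 := by positivity
  -- `R U = R (U^u) = R (end of the path)`
  have hRU : R U = R (List.foldl (fun (W : GaugeField (F.P j) 0 SU2) (q : PBond (F.P j) 0 × (Fin 3 → ℝ)) =>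
      update W q.1 (W q.1 * expPt q.2)) 1 path) := by rw [hend, hinv u U]
  have hinv' : ∀ (b : PBond (F.P j) 0) (g : SU2), R (update 1 b g⁻¹) = R (update 1 b g) := fun b g => flatBond_apply_inv_eq hinv b g
  have hk' : ∀ p ∈ path, ∀ q ∈ path, 0 ≤ k p.1 q.1 ∧ k p.1 q.1 ≤ K := fun p _ q _ => hk p.1 q.1
  have hsz' : ∀ q ∈ path, ‖q.2‖ / (θj / 4) ≤ σ := fun q hq => by rw [div_le_iff₀ hθW]; exact hsz q hq
  have hs3 : Real.sqrt 3 ≤ 2 := by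
    rw [show (2:ℝ) = Real.sqrt 4 by rw [show (4:ℝ) = 2 ^ 2 by norm_num, Real.sqrt_sq (by norm_num : (0:ℝ) ≤ 2)]]
    exact Real.sqrt_le_sqrt (by norm_num)
  have hd3 : ∀ q ∈ path, 4 * dist1 (expPt q.2) ≤ θj / 8 := by
    intro q hq
    have h3 : dist1 (expPt q.2) ≤ 2 * (σ * (θj / 4)) :=
      (dist1_expPt_le_sqrt3_mul_norm q.2).trans (mul_le_mul hs3 (hsz q hq) (norm_nonneg _) (by norm_num))
    nlinarith [hσ1, hθ]
  have hdist : ∀ q ∈ path, dist1 (expPt q.2) < θj / 4 := fun q hq => by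
    have := hd3 q hq; nlinarith [GaugeGroup.dist1_nonneg (expPt q.2), hθ]
  have hgood : ∀ n ≤ path.length,
      PlaqSmall (θj / 4) ((path.take n).foldl (fun U p => update U p.1 (U p.1 * expPt p.2)) (1 : GaugeField (F.P j) 0 SU2)) ∧
      ∀ q ∈ path, PlaqSmall (θj / 4) (update ((path.take n).foldl (fun U p => update U p.1 (U p.1 * expPt p.2)) (1 : GaugeField (F.P j) 0 SU2)) q.1
        (((path.take n).foldl (fun U p => update U p.1 (U p.1 * expPt p.2)) (1 : GaugeField (F.P j) 0 SU2)) q.1 * expPt q.2)) := by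
    intro n hn
    exact ⟨T3PrintedMinimiserExistence.plaqSmall_of_le (by linarith) (hpre n hn),
      fun q hq => T3PrintedMinimiserExistence.plaqSmall_of_le (by linarith [hd3 q hq]) (hexc n hn q.1 q.2)⟩
  have hosc := osc_flat_window_path_le hθW hcl hinv' hK hσ.le hσr path hk' hsz' hdist hgood
  -- length: `n ≤ #PBond·N`, `N·σ ≤ 10∕√θ_j`
  set n := path.length with hn
  have hlen : (n : ℝ) * σ ≤ (Fintype.card (PBond (F.P j) 0) : ℝ) * (10 / Real.sqrt θj) := by
    have hsum := sum_countP_fst_eq_length path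
    have h1 : n ≤ Fintype.card (PBond (F.P j) 0) * (⌈1 / (Real.sqrt (θj / 8) / 16)⌉₊ *
        (⌈Real.pi / 2 * (3 * (Real.sqrt (θj / 8) / 16) ^ 2 / 2) / (σ * (θj / 4))⌉₊ + 2)) := by
      rw [hn, ← hsum]
      calc ∑ b, path.countP (fun q => decide (q.1 = b))
          ≤ ∑ _b : PBond (F.P j) 0, ⌈1 / (Real.sqrt (θj / 8) / 16)⌉₊ *
              (⌈Real.pi / 2 * (3 * (Real.sqrt (θj / 8) / 16) ^ 2 / 2) / (σ * (θj / 4))⌉₊ + 2) := Finset.sum_le_sum fun b _ => hcount b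
        _ = _ := by rw [Finset.sum_const, smul_eq_mul, Finset.card_univ]
    have h2 := count_mul_sigma_le hθ hθ1 hσ hσ1
    calc (n : ℝ) * σ ≤ ((Fintype.card (PBond (F.P j) 0) * (⌈1 / (Real.sqrt (θj / 8) / 16)⌉₊ *
        (⌈Real.pi / 2 * (3 * (Real.sqrt (θj / 8) / 16) ^ 2 / 2) / (σ * (θj / 4))⌉₊ + 2)) : ℕ) : ℝ) * σ :=
          mul_le_mul_of_nonneg_right (by exact_mod_cast h1) hσ.le
      _ = (Fintype.card (PBond (F.P j) 0) : ℝ) * (((⌈1 / (Real.sqrt (θj / 8) / 16)⌉₊ *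
        (⌈Real.pi / 2 * (3 * (Real.sqrt (θj / 8) / 16) ^ 2 / 2) / (σ * (θj / 4))⌉₊ + 2) : ℕ) : ℝ) * σ) := by push_cast; ring
      _ ≤ (Fintype.card (PBond (F.P j) 0) : ℝ) * (10 / Real.sqrt θj) := mul_le_mul_of_nonneg_left h2 (Nat.cast_nonneg _)
  have hsq : ((n : ℝ) * σ) ^ 2 ≤ (Fintype.card (PBond (F.P j) 0) : ℝ) ^ 2 * (100 / θj) := by
    have h0 : 0 ≤ (n : ℝ) * σ := by positivity
    calc ((n : ℝ) * σ) ^ 2 ≤ ((Fintype.card (PBond (F.P j) 0) : ℝ) * (10 / Real.sqrt θj)) ^ 2 := pow_le_pow_left₀ h0 hlen 2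
      _ = (Fintype.card (PBond (F.P j) 0) : ℝ) ^ 2 * (100 / θj) := by rw [mul_pow, div_pow, Real.sq_sqrt hθ.le]; norm_num
  rw [hRU]
  refine hosc.trans ?_
  rcases Nat.eq_zero_or_pos n with hn0 | hn1
  · rw [hn0]; simp only [Nat.cast_zero, zero_mul]; positivity
  · have hσn : σ ≤ (n : ℝ) * σ := le_mul_of_one_le_left hσ.le (by exact_mod_cast hn1)
    have hsplit : (n : ℝ) * (K * σ / 2 + (n : ℝ) * (K * σ)) * σ = K / 2 * (((n : ℝ) * σ) * σ) + K * ((n : ℝ) * σ) ^ 2 := by ring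
    rw [hsplit]
    have hKn : K / 2 * (((n : ℝ) * σ) * σ) ≤ K / 2 * ((n : ℝ) * σ) ^ 2 := by
      refine mul_le_mul_of_nonneg_left ?_ (by positivity)
      rw [sq]; exact mul_le_mul_of_nonneg_left hσn (by positivity)
    calc K / 2 * (((n : ℝ) * σ) * σ) + K * ((n : ℝ) * σ) ^ 2 ≤ K / 2 * ((n : ℝ) * σ) ^ 2 + K * ((n : ℝ) * σ) ^ 2 := add_le_add hKn le_rfl
      _ = 3 / 2 * K * ((n : ℝ) * σ) ^ 2 := by ring
      _ ≤ 3 / 2 * K * ((Fintype.card (PBond (F.P j) 0) : ℝ) ^ 2 * (100 / θj)) := mul_le_mul_of_nonneg_left hsq (by positivity)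
      _ = 150 * K * (Fintype.card (PBond (F.P j) 0) : ℝ) ^ 2 / θj := by ring

end Core

/-! ## §E The junction `directTransport_supR : O1ᵘ-H v2 → (P-b′) → S3ᴴ` -/

/-- Pure arithmetic of the `j < T` assembly. -/
theorem assemble_lt {θ M A xT δj Y a' w' βj θj NP NB core marg : ℝ}
    (hθ : 0 < θ) (hM : M = 150 / θ + 150) (hβj : 0 < βj) (hθj : 0 < θj) (hθj1 : θj ≤ 1) (hNP : 0 ≤ NP)
    (ha' : 0 ≤ a') (haY : a' ≤ Y) (hwY : θ * w' ≤ Y * (βj * θj ^ 2)) (hYA : Y ≤ A * xT + δj)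
    (hcore : core ≤ 150 * w' * NB ^ 2 / θj) (hmarg : marg ≤ βj * (2 * NP) * a') :
    core + marg ≤ (M * A * xT + M * δj) * (βj * (2 * NP + NB ^ 2)) := by
  have hY0 : 0 ≤ Y := ha'.trans haY
  have hMθ : 0 ≤ 150 / θ := by positivity
  have hM1 : 150 / θ ≤ M := by rw [hM]; linarith
  have hM2 : 1 ≤ M := by rw [hM]; linarith
  have hM0 : 0 ≤ M := zero_le_one.trans hM2
  have hw' : w' ≤ Y * (βj * θj ^ 2) / θ := by rw [le_div_iff₀ hθ]; linarith
  have h1 : core ≤ M * Y * (βj * NB ^ 2) := by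
    refine hcore.trans ?_
    have h2 : 150 * w' * NB ^ 2 / θj ≤ 150 * (Y * (βj * θj ^ 2) / θ) * NB ^ 2 / θj := by gcongr
    refine h2.trans ?_
    have e : 150 * (Y * (βj * θj ^ 2) / θ) * NB ^ 2 / θj = (150 / θ) * Y * (βj * NB ^ 2) * θj := by
      field_simp
    rw [e]
    have h3 : (150 / θ) * Y * (βj * NB ^ 2) * θj ≤ (150 / θ) * Y * (βj * NB ^ 2) * 1 :=
      mul_le_mul_of_nonneg_left hθj1 (by positivity)
    rw [mul_one] at h3
    exact h3.trans (mul_le_mul_of_nonneg_right (mul_le_mul_of_nonneg_right hM1 hY0) (by positivity))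
  have h2 : marg ≤ M * Y * (βj * (2 * NP)) := by
    refine hmarg.trans ?_
    have h3 : βj * (2 * NP) * a' ≤ βj * (2 * NP) * Y := mul_le_mul_of_nonneg_left haY (by positivity)
    refine h3.trans ?_
    rw [mul_comm (βj * (2 * NP)) Y, mul_assoc]
    exact le_mul_of_one_le_left (by positivity) hM2
  have h3 : M * Y * (βj * NB ^ 2) + M * Y * (βj * (2 * NP)) = M * Y * (βj * (2 * NP + NB ^ 2)) := by ring
  have h4 : M * Y * (βj * (2 * NP + NB ^ 2)) ≤ M * (A * xT + δj) * (βj * (2 * NP + NB ^ 2)) :=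
    mul_le_mul_of_nonneg_right (mul_le_mul_of_nonneg_left hYA hM0) (by positivity)
  calc core + marg ≤ M * Y * (βj * NB ^ 2) + M * Y * (βj * (2 * NP)) := add_le_add h1 h2
    _ = M * Y * (βj * (2 * NP + NB ^ 2)) := h3
    _ ≤ M * (A * xT + δj) * (βj * (2 * NP + NB ^ 2)) := h4
    _ = (M * A * xT + M * δj) * (βj * (2 * NP + NB ^ 2)) := by ring

/-- Pure arithmetic of the `j = T` assembly. -/
theorem assemble_eq {θ M A xT δj wT βj θj NP NB core : ℝ}
    (hθ : 0 < θ) (hM : M = 150 / θ + 150) (hA1 : 1 ≤ A) (hδ : 0 ≤ δj) (hxT : 0 ≤ xT) (hβj : 0 < βj) (hθj : 0 < θj)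
    (hθj1 : θj ≤ 1) (hNP : 0 ≤ NP) (hwx : wT = xT * (βj * θj ^ 2)) (hcore : core ≤ 150 * wT * NB ^ 2 / θj) :
    core ≤ (M * A * xT + M * δj) * (βj * (2 * NP + NB ^ 2)) := by
  have hMθ : 0 ≤ 150 / θ := by positivity
  have hM150 : 150 ≤ M := by rw [hM]; linarith
  have hM0 : 0 ≤ M := le_trans (by norm_num) hM150
  have hMA : 150 ≤ M * A := by nlinarith
  refine hcore.trans ?_
  have e : 150 * wT * NB ^ 2 / θj = 150 * xT * (βj * NB ^ 2) * θj := by rw [hwx]; field_simp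
  rw [e]
  have h1 : 150 * xT * (βj * NB ^ 2) * θj ≤ 150 * xT * (βj * NB ^ 2) * 1 := mul_le_mul_of_nonneg_left hθj1 (by positivity)
  rw [mul_one] at h1
  refine h1.trans ?_
  calc 150 * xT * (βj * NB ^ 2) ≤ (M * A) * xT * (βj * NB ^ 2) := by gcongr
    _ ≤ (M * A * xT + M * δj) * (βj * NB ^ 2) := by
        apply mul_le_mul_of_nonneg_right _ (by positivity); nlinarith
    _ ≤ (M * A * xT + M * δj) * (βj * (2 * NP + NB ^ 2)) := by
        apply mul_le_mul_of_nonneg_left _ (by positivity)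
        apply mul_le_mul_of_nonneg_left _ hβj.le
        nlinarith

/-- ★★ THE JUNCTION (v18 H-currency, TN-OSC edition): O1ᵘ-H v2's direct transport from the seed height `T` to every `j ∈ [j₁, T)` (and the
seed clause itself at `j = T`), the gauge invariance of the organ's remainder (✓p794698) and its flat inversion-evenness (✓p793256),
(P-b′)'s volume-uniform chord path inside the `θ_j∕8`-window, and TN-ANCHOR-FREE + TN-OSC give S3ᴴ with `Cs := (150∕θ + 150)·(Ctr + Σεd + C·w₀)`,
`δ′ := (150∕θ + 150)·δ`, `w₀ := w₀`, `j₁ := max j₁ (max jW jθ)`.  [bookkeeping over hypotheses; nothing of Bałaban's asserted] -/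
theorem directTransport_supR (hO : OneStepTransportUH) (hPb : SmallStepChordPath) : BackwardStabilityFinSupH := by
  classical
  obtain ⟨pW, hPW⟩ := hPb
  obtain ⟨γ₁, hγ₁, HO⟩ := hO
  refine ⟨pW, min γ₁ 1, lt_min hγ₁ one_pos, ?_⟩
  intro F γ hγ hγle b₀ p₀ κ j₀ prm η rA Bρ hb₀ hp₀ hpW hadm hκ hη0 hηs hηt hηT hrA
  have hγ₁' : γ ≤ γ₁ := hγle.trans (min_le_left _ _)
  have hγ1 : γ ≤ 1 := hγle.trans (min_le_right _ _)
  obtain ⟨κ₀, hκ₀, HO1⟩ := HO F γ hγ hγ₁' b₀ p₀ j₀ prm η rA Bρ hb₀ hp₀ hadm hη0 hηs hηt hηT hrA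
  have hκ'0 : 0 < min κ κ₀ := lt_min hκ hκ₀
  obtain ⟨θ, r, Ctr, C, w₀, εd, δ, j₁, hθ, hr, hCtr, hC, hw₀, hεδ, hεs, hδs, hδt, hδT, hj₀₁, HO2⟩ :=
    HO1 (min κ κ₀) hκ'0 (min_le_right _ _)
  -- (P-b′) at path profile `b₀∕8`
  obtain ⟨jW, HPb⟩ := hPW p₀ hpW F γ (b₀ / 8) hγ hγ1 (by positivity)
  -- `θ_j ≤ 1` eventually
  obtain ⟨jθ, hjθ⟩ : ∃ jθ : ℕ, ∀ j, jθ ≤ j → θBal F.L γ b₀ p₀ j ≤ 1 := by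
    have ht := T3ThresholdSmallness.tendsto_θBal_atTop F.hL.2 hγ b₀ p₀
    obtain ⟨jθ, hj⟩ := Filter.eventually_atTop.1 (ht.eventually (Iio_mem_nhds one_pos))
    exact ⟨jθ, fun j hj' => (Set.mem_Iio.1 (hj j hj')).le⟩
  -- constants
  have hεdE : ∀ i, εd i ≤ ∑' i, εd i := fun i => hεs.le_tsum i (fun k _ => (hεδ k).1)
  obtain ⟨M, hM⟩ : ∃ M : ℝ, M = 150 / θ + 150 := ⟨_, rfl⟩
  have hMθ : 0 ≤ 150 / θ := by positivity
  have hM0 : 0 ≤ M := by rw [hM]; linarith only [hMθ]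
  have hE0 : 0 ≤ ∑' i, εd i := tsum_nonneg fun i => (hεδ i).1
  have hCw : 0 ≤ C * w₀ := by positivity
  obtain ⟨A, hA⟩ : ∃ A : ℝ, A = Ctr + ∑' i, εd i + C * w₀ := ⟨_, rfl⟩
  have hA1 : 1 ≤ A := by rw [hA]; linarith only [hCtr, hE0, hCw]
  have hMA0 : 0 ≤ M * A := mul_nonneg hM0 (zero_le_one.trans hA1)
  have htails : Summable (fun i => ∑' k, M * δ (k + i)) := by
    simp_rw [tsum_mul_left]; exact hδt.mul_left M
  have htend : Tendsto (fun j => (∑' k, M * δ (k + j)) * ((1 + 2 * ((F.L : ℝ) ^ j / γ) * (Fintype.card (Plaq (F.P j) 0) : ℝ)) *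
      (Fintype.card (PBond (F.P j) 0) : ℝ) ^ 2)) atTop (𝓝 0) := by
    have hfun : (fun j => (∑' k, M * δ (k + j)) * ((1 + 2 * ((F.L : ℝ) ^ j / γ) * (Fintype.card (Plaq (F.P j) 0) : ℝ)) *
        (Fintype.card (PBond (F.P j) 0) : ℝ) ^ 2))
        = fun j => M * ((∑' k, δ (k + j)) * ((1 + 2 * ((F.L : ℝ) ^ j / γ) * (Fintype.card (Plaq (F.P j) 0) : ℝ)) *
          (Fintype.card (PBond (F.P j) 0) : ℝ) ^ 2)) := by
      funext j; rw [tsum_mul_left]; ring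
    rw [hfun]; simpa using hδT.const_mul M
  refine ⟨M * A, w₀, fun j => M * δ j, max j₁ (max jW jθ), hMA0, hw₀, fun j => mul_nonneg hM0 (hεδ j).2,
    hδs.mul_left M, htails, htend, hj₀₁.trans (le_max_left _ _), ?_⟩
  intro ν hν1 hν2 K K' hKK' T Tt hTTt hTtK μ μ' ρ ρ' hruns hcut hcons hfin h8 wT hwT hxT hseed j hj₁ hjT U hU
  have hj₁' : j₁ ≤ j := (le_max_left _ _).trans hj₁
  have hjW : jW ≤ j := ((le_max_left _ _).trans (le_max_right _ _)).trans hj₁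
  have hjθ' : jθ ≤ j := ((le_max_right _ _).trans (le_max_right _ _)).trans hj₁
  have hθj1 : θBal F.L γ b₀ p₀ j ≤ 1 := hjθ j hjθ'
  have hθj : 0 < θBal F.L γ b₀ p₀ j := T3MinimiserStabilityReduction.θBal_pos F.hL.2.le hγ hγ1 hb₀ p₀ j
  have hL0 : (0 : ℝ) < F.L := by exact_mod_cast (zero_lt_one.trans F.hL.2)
  have hβj0 : 0 < (F.L : ℝ) ^ j / γ := by positivity
  have hNP : (0 : ℝ) ≤ (Fintype.card (Plaq (F.P j) 0) : ℝ) := Nat.cast_nonneg _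
  -- block ⑧ at `j`: the regular-class memberships (for gauge invariance)
  have hjTt : j ≤ Tt := hjT.trans hTTt.le
  obtain ⟨-, -, -, h8ρ, h8ρ', -⟩ := h8 j (hj₀₁.trans hj₁') hjTt
  -- step size
  set σ : ℝ := min (min r (rA / 2)) (1 / 16) with hσ
  have hσ0 : 0 < σ := lt_min (lt_min hr (half_pos hrA)) (by norm_num)
  have hσr : σ ≤ r := (min_le_left _ _).trans (min_le_left _ _)
  have hσA : σ ≤ rA / 2 := (min_le_left _ _).trans (min_le_right _ _)
  have hσ1 : σ ≤ 1 / 16 := min_le_right _ _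
  -- (P-b′)'s path for `U`
  obtain ⟨u, path, hszP, hcountP, hendP, hpreP, hexcP⟩ := HPb j hjW U hU (σ * (θBal F.L γ b₀ p₀ j / 4)) (by positivity)
  rcases Nat.lt_or_ge j T with hjlt | hjge
  · /- `j < T`: O1ᵘ-H v2's direct transport from the seed -/
    obtain ⟨kT, hkT0, hkTrow, hkTcl⟩ := hseed
    have hseed' : ∃ k : PBond (F.P T) 0 → PBond (F.P T) 0 → ℝ, (∀ b b', 0 ≤ k b b') ∧
        (∀ b, ∑ b', k b b' * Real.exp (min κ κ₀ * (b.src.tdist b'.src : ℝ)) ≤ wT) ∧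
        HClauseSq (θBal F.L γ b₀ p₀ T / 4) (rA / 2) k (fun U => Real.log (ρ T U) - Real.log (ρ' T U)) :=
      ⟨kT, hkT0, fun b => rowMass_mono (min_le_left _ _) hkT0 hkTrow b, hkTcl⟩
    obtain ⟨c', a', w', ha', hw', hY, hc', k', hk'0, hk'row, hk'cl⟩ :=
      HO2 ν hν1 hν2 K K' hKK' T Tt hTTt hTtK μ μ' ρ ρ' hruns hcut hcons hfin h8 wT hwT hxT hseed' j hj₁' (by omega)
    have hkK : ∀ b b', 0 ≤ k' b b' ∧ k' b b' ≤ w' := fun b b' => ⟨hk'0 b b', letter_le_rowMass hκ'0.le hk'0 hk'row b b'⟩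
    have hinv : GaugeField.GaugeInvariant (fun U : GaugeField (F.P j) 0 SU2 =>
        Real.log (ρ j U) - Real.log (ρ' j U) - ((F.L : ℝ) ^ j / γ) * ∑ p, c' p * (1 - reTr (GaugeField.plaqHol U p))) :=
      Summit.QuantumFields.YangMills.Theorems.OrganTangentWindowGaugeInvariance.gaugeInvariant_organDiscrepancy F h8ρ h8ρ' _ c'
    have hcore := supOsc_core hθj hθj1 hw' hσ0 hσr hσ1 hkK hk'cl hinv U u path hszP hcountP hendP hpreP hexcP
    -- the marginal at `U` and at `1`
    have hmargU : |((F.L : ℝ) ^ j / γ) * ∑ p, c' p * (1 - reTr (GaugeField.plaqHol U p))| ≤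
        ((F.L : ℝ) ^ j / γ) * (2 * (Fintype.card (Plaq (F.P j) 0) : ℝ)) * a' := by
      rw [abs_mul, abs_of_pos hβj0, mul_assoc]
      refine mul_le_mul_of_nonneg_left ?_ hβj0.le
      calc |∑ p, c' p * (1 - reTr (GaugeField.plaqHol U p))| ≤ ∑ p, |c' p * (1 - reTr (GaugeField.plaqHol U p))| :=
            Finset.abs_sum_le_sum_abs _ _
        _ ≤ ∑ _p : Plaq (F.P j) 0, a' * 2 := Finset.sum_le_sum fun p _ => by
            rw [abs_mul]
            have h12 := RegularGaugeGroup.one_sub_reTr_mem_Icc (GaugeField.plaqHol U p)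
            exact mul_le_mul (hc' p) (abs_le.2 ⟨by linarith [h12.1], h12.2⟩) (abs_nonneg _) ((abs_nonneg _).trans (hc' p))
        _ = 2 * (Fintype.card (Plaq (F.P j) 0) : ℝ) * a' := by rw [Finset.sum_const, nsmul_eq_mul, Finset.card_univ]; ring
    have hmarg1 : (∑ p, c' p * (1 - reTr (GaugeField.plaqHol (1 : GaugeField (F.P j) 0 SU2) p))) = 0 := by
      simp [T4SmallFieldWindowSandwich.plaqHol_one, GaugeGroup.reTr_one]
    -- sizes from the output budget
    have hD : 0 < ((F.L : ℝ) ^ j / γ) * θBal F.L γ b₀ p₀ j ^ 2 := by positivity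
    have hwY : θ * w' ≤ ((Ctr + εd (Tt - (T + 1)) + C * (wT / (((F.L : ℝ) ^ T / γ) * θBal F.L γ b₀ p₀ T ^ 2))) *
        (wT / (((F.L : ℝ) ^ T / γ) * θBal F.L γ b₀ p₀ T ^ 2)) + δ j) * (((F.L : ℝ) ^ j / γ) * θBal F.L γ b₀ p₀ j ^ 2) := by
      have h1 : θ * (w' / (((F.L : ℝ) ^ j / γ) * θBal F.L γ b₀ p₀ j ^ 2)) ≤ _ := le_trans (by linarith only [ha']) hY
      rwa [mul_div_assoc', div_le_iff₀ hD] at h1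
    have haY : a' ≤ (Ctr + εd (Tt - (T + 1)) + C * (wT / (((F.L : ℝ) ^ T / γ) * θBal F.L γ b₀ p₀ T ^ 2))) *
        (wT / (((F.L : ℝ) ^ T / γ) * θBal F.L γ b₀ p₀ T ^ 2)) + δ j := by
      have : 0 ≤ θ * (w' / (((F.L : ℝ) ^ j / γ) * θBal F.L γ b₀ p₀ j ^ 2)) := by positivity
      linarith only [this, hY]
    have hYA : (Ctr + εd (Tt - (T + 1)) + C * (wT / (((F.L : ℝ) ^ T / γ) * θBal F.L γ b₀ p₀ T ^ 2))) *
        (wT / (((F.L : ℝ) ^ T / γ) * θBal F.L γ b₀ p₀ T ^ 2)) + δ j ≤ A * (wT / (((F.L : ℝ) ^ T / γ) * θBal F.L γ b₀ p₀ T ^ 2)) + δ j := by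
      have h1 : εd (Tt - (T + 1)) ≤ ∑' i, εd i := hεdE _
      have h2 : C * (wT / (((F.L : ℝ) ^ T / γ) * θBal F.L γ b₀ p₀ T ^ 2)) ≤ C * w₀ := mul_le_mul_of_nonneg_left hxT hC
      have h0 : 0 ≤ wT / (((F.L : ℝ) ^ T / γ) * θBal F.L γ b₀ p₀ T ^ 2) := by positivity
      have h3 : Ctr + εd (Tt - (T + 1)) + C * (wT / (((F.L : ℝ) ^ T / γ) * θBal F.L γ b₀ p₀ T ^ 2)) ≤ A := by
        rw [hA]; linarith only [h1, h2]
      exact add_le_add (mul_le_mul_of_nonneg_right h3 h0) le_rfl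
    -- conclude
    have hdec : (Real.log (ρ j U) - Real.log (ρ' j U)) - (Real.log (ρ j 1) - Real.log (ρ' j 1))
        = ((Real.log (ρ j U) - Real.log (ρ' j U) - ((F.L : ℝ) ^ j / γ) * ∑ p, c' p * (1 - reTr (GaugeField.plaqHol U p))) -
            (Real.log (ρ j 1) - Real.log (ρ' j 1) - ((F.L : ℝ) ^ j / γ) *
              ∑ p, c' p * (1 - reTr (GaugeField.plaqHol (1 : GaugeField (F.P j) 0 SU2) p)))) +
          ((F.L : ℝ) ^ j / γ) * ∑ p, c' p * (1 - reTr (GaugeField.plaqHol U p)) := by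
      rw [hmarg1]; ring
    rw [hdec]
    exact (abs_add_le _ _).trans (assemble_lt hθ hM hβj0 hθj hθj1 hNP ha' haY hwY hYA hcore hmargU)
  · /- `j = T`: the seed clause itself -/
    obtain rfl : j = T := le_antisymm hjT hjge
    obtain ⟨kT, hkT0, hkTrow, hkTcl⟩ := hseed
    have hkK : ∀ b b', 0 ≤ kT b b' ∧ kT b b' ≤ wT := fun b b' => ⟨hkT0 b b', letter_le_rowMass hκ.le hkT0 hkTrow b b'⟩
    have hinv : GaugeField.GaugeInvariant (fun U : GaugeField (F.P j) 0 SU2 => Real.log (ρ j U) - Real.log (ρ' j U)) :=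
      Summit.QuantumFields.YangMills.Theorems.OrganTangentWindowGaugeInvariance.gaugeInvariant_organLogRatio F h8ρ h8ρ'
    have hcore := supOsc_core hθj hθj1 hwT hσ0 hσA hσ1 hkK hkTcl hinv U u path hszP hcountP hendP hpreP hexcP
    have hpos : 0 < ((F.L : ℝ) ^ j / γ) * θBal F.L γ b₀ p₀ j ^ 2 := by positivity
    have hwx : wT = wT / (((F.L : ℝ) ^ j / γ) * θBal F.L γ b₀ p₀ j ^ 2) * (((F.L : ℝ) ^ j / γ) * θBal F.L γ b₀ p₀ j ^ 2) := by
      rw [div_mul_cancel₀ _ hpos.ne']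
    exact assemble_eq hθ hM hA1 (hεδ j).2 (by positivity) hβj0 hθj hθj1 hNP hwx hcore

/-! ## §F (v1.1) (P-b′) BY NAME — the hypothesis `SmallStepChordPath` is ✓ `OrganTangentSmallStepChordPath.exists_smallStep_chordPath_gaugeCopy`
(w4 g22, tree sha16 a71eeaf6fcbd4dbe), so the junction reads: O1ᵘ-H v2 ALONE ⟹ S3ᴴ. -/

/-- (P-b′) holds in the tree (w4 g22's `exists_smallStep_chordPath_gaugeCopy`, BY NAME). -/
theorem smallStepChordPath_holds : SmallStepChordPath :=
  Summit.QuantumFields.YangMills.Theorems.OrganTangentSmallStepChordPath.exists_smallStep_chordPath_gaugeCopy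

/-- ★ THE JUNCTION, final form: the H-currency direct-transport organ O1ᵘ-H v2 gives the derived finite-run organ S3ᴴ (sup-oscillation
on the inner window), kernel-checked, no `sorry`; O1ᵘ-H v2 itself is an O-class HYPOTHESIS (not proved here or anywhere in the tree). -/
theorem backwardStabilityFinSupH_of_oneStepTransportUH (hO : OneStepTransportUH) : BackwardStabilityFinSupH :=
  directTransport_supR hO smallStepChordPath_holds


end V18Junction

/-- S3ᴴ is DERIVED (v18): the H-currency organ O1ᵘ-H v2 (open stub, O-debt) and the kernel-checked junction over the landed chord paths (P-b′)
give the finite-run organ in sup-oscillation form.  REPLACES v17.2's `backwardStabilityFinSup_of_stubs`. -/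
theorem backwardStabilityFinSupH_of_stubs : BackwardStabilityFinSupH :=
  backwardStabilityFinSupH_of_oneStepTransportUH stub_oneStepTransportUH

/-! ## v17 · SF-projected towers: construction and bookkeeping (abstract; no Bałaban input) -/

namespace SFTower


universe uT

variable {T : ℕ → Type uT} [∀ j, MeasurableSpace (T j)]

/-- The SF-projected tower below the seed height `Ts` (v17.1, SMOOTH cut): the given tower at and above `Ts`, and below it the
push-forward of the next level weighted by `χ (j+1)` (`withDensity`; `χ = 𝟙_W` recovers v17's sharp cut). -/
noncomputable def sfTowerG (D : ∀ j, T (j + 1) → T j) (χ : ∀ j, T j → ENNReal) (ν : ∀ j, Measure (T j)) (Ts : ℕ) :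
    ∀ j, Measure (T j)
  | j => if Ts ≤ j then ν j else Measure.map (D j) ((sfTowerG D χ ν Ts (j + 1)).withDensity (χ (j + 1)))
  termination_by j => Ts - j
  decreasing_by omega

theorem sfTowerG_of_le (D : ∀ j, T (j + 1) → T j) (χ : ∀ j, T j → ENNReal) (ν : ∀ j, Measure (T j)) {Ts j : ℕ} (h : Ts ≤ j) :
    sfTowerG D χ ν Ts j = ν j := by
  rw [sfTowerG]; simp [h]

theorem sfTowerG_of_lt (D : ∀ j, T (j + 1) → T j) (χ : ∀ j, T j → ENNReal) (ν : ∀ j, Measure (T j)) {Ts j : ℕ} (h : j < Ts) :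
    sfTowerG D χ ν Ts j = Measure.map (D j) ((sfTowerG D χ ν Ts (j + 1)).withDensity (χ (j + 1))) := by
  rw [sfTowerG]; simp [Nat.not_le.mpr h]

/-- Abstract bookkeeping for an SF-projected tower with weights `χ ≤ 1`: it lies below the full tower, and its mass deficit is at most
the sum of the full tower's masses of the sets `{χ_i < 1}` at the heights it was cut. -/
theorem sfTower_le_and_deficit (D : ∀ j, T (j + 1) → T j) (hD : ∀ j, Measurable (D j)) (χ : ∀ j, T j → ENNReal)
    (hχm : ∀ j, Measurable (χ j)) (hχ1 : ∀ j x, χ j x ≤ 1)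
    (ν μ : ∀ j, Measure (T j)) (Ts : ℕ)
    (hν : ∀ j, j < Ts → ν j = Measure.map (D j) (ν (j + 1)))
    (hanch : μ Ts = ν Ts)
    (hcut : ∀ j, j < Ts → μ j = Measure.map (D j) ((μ (j + 1)).withDensity (χ (j + 1)))) :
    ∀ n j, j + n = Ts → μ j ≤ ν j ∧ ν j Set.univ ≤ μ j Set.univ + ∑ i ∈ Finset.range n, ν (j + 1 + i) {x | χ (j + 1 + i) x < 1} := by
  have hwd : ∀ (k : ℕ) (m : Measure (T k)), m.withDensity (χ k) ≤ m := fun k m =>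
    (withDensity_mono (Eventually.of_forall (hχ1 k))).trans_eq (by simp)
  intro n
  induction n with
  | zero =>
    intro j hj
    simp only [add_zero] at hj
    subst hj
    simp [hanch]
  | succ n ih =>
    intro j hj
    have hjT : j < Ts := by omega
    obtain ⟨hle, hdef⟩ := ih (j + 1) (by omega)
    have hμj := hcut j hjT
    have hνj := hν j hjT
    refine ⟨?_, ?_⟩
    · rw [hμj, hνj]
      exact Measure.map_mono ((hwd _ _).trans hle) (hD j)
    · have h1 : ν j Set.univ = ν (j + 1) Set.univ := by
        rw [hνj, Measure.map_apply (hD j) MeasurableSet.univ, Set.preimage_univ]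
      have h2 : μ j Set.univ = ∫⁻ x, χ (j + 1) x ∂(μ (j + 1)) := by
        rw [hμj, Measure.map_apply (hD j) MeasurableSet.univ, Set.preimage_univ, withDensity_apply _ MeasurableSet.univ,
          Measure.restrict_univ]
      have hA : MeasurableSet {x | 1 ≤ χ (j + 1) x} := measurableSet_le measurable_const (hχm _)
      have h3a : μ (j + 1) {x | 1 ≤ χ (j + 1) x} ≤ ∫⁻ x, χ (j + 1) x ∂(μ (j + 1)) := by
        calc μ (j + 1) {x | 1 ≤ χ (j + 1) x} = ∫⁻ x in {x | 1 ≤ χ (j + 1) x}, 1 ∂(μ (j + 1)) := by simp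
          _ ≤ ∫⁻ x in {x | 1 ≤ χ (j + 1) x}, χ (j + 1) x ∂(μ (j + 1)) :=
              setLIntegral_mono (hχm _) fun x hx => hx
          _ ≤ ∫⁻ x, χ (j + 1) x ∂(μ (j + 1)) := setLIntegral_le_lintegral _ _
      have hc : {x | 1 ≤ χ (j + 1) x}ᶜ = {x | χ (j + 1) x < 1} := by
        ext x; simp [not_le]
      have h3 : μ (j + 1) Set.univ ≤ ∫⁻ x, χ (j + 1) x ∂(μ (j + 1)) + μ (j + 1) {x | χ (j + 1) x < 1} := by
        calc μ (j + 1) Set.univ = μ (j + 1) ({x | 1 ≤ χ (j + 1) x} ∪ {x | 1 ≤ χ (j + 1) x}ᶜ) := by rw [Set.union_compl_self]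
          _ ≤ μ (j + 1) {x | 1 ≤ χ (j + 1) x} + μ (j + 1) {x | 1 ≤ χ (j + 1) x}ᶜ := measure_union_le _ _
          _ ≤ ∫⁻ x, χ (j + 1) x ∂(μ (j + 1)) + μ (j + 1) {x | χ (j + 1) x < 1} := by rw [hc]; gcongr
      have h4 : μ (j + 1) {x | χ (j + 1) x < 1} ≤ ν (j + 1) {x | χ (j + 1) x < 1} := hle _
      rw [h1, h2, Finset.sum_range_succ', add_zero]
      have h5 : ∑ i ∈ Finset.range n, ν (j + 1 + (i + 1)) {x | χ (j + 1 + (i + 1)) x < 1} =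
          ∑ i ∈ Finset.range n, ν (j + 1 + 1 + i) {x | χ (j + 1 + 1 + i) x < 1} := by
        refine Finset.sum_congr rfl fun i _ => ?_
        have e : j + 1 + (i + 1) = j + 1 + 1 + i := by ring
        rw [e]
      rw [h5]
      calc ν (j + 1) Set.univ ≤ μ (j + 1) Set.univ + ∑ i ∈ Finset.range n, ν (j + 1 + 1 + i) {x | χ (j + 1 + 1 + i) x < 1} := hdef
        _ ≤ (∫⁻ x, χ (j + 1) x ∂(μ (j + 1)) + μ (j + 1) {x | χ (j + 1) x < 1}) +
              ∑ i ∈ Finset.range n, ν (j + 1 + 1 + i) {x | χ (j + 1 + 1 + i) x < 1} := by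
            gcongr
        _ ≤ (∫⁻ x, χ (j + 1) x ∂(μ (j + 1)) + ν (j + 1) {x | χ (j + 1) x < 1}) +
              ∑ i ∈ Finset.range n, ν (j + 1 + 1 + i) {x | χ (j + 1 + 1 + i) x < 1} := by
            gcongr
        _ = ∫⁻ x, χ (j + 1) x ∂(μ (j + 1)) + (∑ i ∈ Finset.range n, ν (j + 1 + 1 + i) {x | χ (j + 1 + 1 + i) x < 1} +
              ν (j + 1 + 0) {x | χ (j + 1 + 0) x < 1}) := by
            rw [add_zero]; ring

variable {α : Type*} [MeasurableSpace α]

/-- TV transfer from the normalised SF-projected laws to the full laws. -/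
theorem tv_transfer (ν ν' μ μ' : Measure α) [IsProbabilityMeasure ν] [IsProbabilityMeasure ν']
    (hle : μ ≤ ν) (hle' : μ' ≤ ν') {d d' e : ℝ} (hd : 0 ≤ d) (hd' : 0 ≤ d') (hd1 : d < 1) (hd1' : d' < 1)
    (hdef : ν Set.univ ≤ μ Set.univ + ENNReal.ofReal d) (hdef' : ν' Set.univ ≤ μ' Set.univ + ENNReal.ofReal d')
    (htv : ∀ A, MeasurableSet A → |((μ Set.univ)⁻¹ • μ).real A - ((μ' Set.univ)⁻¹ • μ').real A| ≤ e) :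
    ∀ A, MeasurableSet A → |ν.real A - ν'.real A| ≤ e + 2 * d + 2 * d' := by
  haveI : IsFiniteMeasure μ := isFiniteMeasure_of_le ν hle
  haveI : IsFiniteMeasure μ' := isFiniteMeasure_of_le ν' hle'
  -- masses
  have hm1 : μ.real Set.univ ≤ 1 := by
    have := ENNReal.toReal_mono (measure_ne_top ν _) (hle Set.univ)
    simpa [measureReal_def] using this
  have hm1' : μ'.real Set.univ ≤ 1 := by
    have := ENNReal.toReal_mono (measure_ne_top ν' _) (hle' Set.univ)
    simpa [measureReal_def] using this
  have hmd : 1 - d ≤ μ.real Set.univ := by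
    have h := ENNReal.toReal_mono (by simp [measure_ne_top]) hdef
    rw [ENNReal.toReal_add (measure_ne_top _ _) ENNReal.ofReal_ne_top, ENNReal.toReal_ofReal hd] at h
    simp only [measure_univ, ENNReal.toReal_one] at h
    rw [measureReal_def]; linarith
  have hmd' : 1 - d' ≤ μ'.real Set.univ := by
    have h := ENNReal.toReal_mono (by simp [measure_ne_top]) hdef'
    rw [ENNReal.toReal_add (measure_ne_top _ _) ENNReal.ofReal_ne_top, ENNReal.toReal_ofReal hd'] at h
    simp only [measure_univ, ENNReal.toReal_one] at h
    rw [measureReal_def]; linarith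
  have hmpos : 0 < μ.real Set.univ := by linarith
  have hmpos' : 0 < μ'.real Set.univ := by linarith
  -- the normalised measures on a set
  have hp : ∀ A, ((μ Set.univ)⁻¹ • μ).real A = μ.real A / μ.real Set.univ := by
    intro A
    rw [measureReal_def, Measure.smul_apply, smul_eq_mul, ENNReal.toReal_mul, ENNReal.toReal_inv, measureReal_def,
      measureReal_def, div_eq_inv_mul]
  have hp' : ∀ A, ((μ' Set.univ)⁻¹ • μ').real A = μ'.real A / μ'.real Set.univ := by
    intro A
    rw [measureReal_def, Measure.smul_apply, smul_eq_mul, ENNReal.toReal_mul, ENNReal.toReal_inv, measureReal_def,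
      measureReal_def, div_eq_inv_mul]
  intro A hA
  have h := htv A hA
  rw [hp, hp'] at h
  -- ν A - μ A ∈ [0, d]
  have hA1 : μ.real A ≤ ν.real A := by
    have := ENNReal.toReal_mono (measure_ne_top ν _) (hle A)
    simpa [measureReal_def] using this
  have hA1' : μ'.real A ≤ ν'.real A := by
    have := ENNReal.toReal_mono (measure_ne_top ν' _) (hle' A)
    simpa [measureReal_def] using this
  have hAc : μ.real Aᶜ ≤ ν.real Aᶜ := by
    have := ENNReal.toReal_mono (measure_ne_top ν _) (hle Aᶜ)
    simpa [measureReal_def] using this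
  have hAc' : μ'.real Aᶜ ≤ ν'.real Aᶜ := by
    have := ENNReal.toReal_mono (measure_ne_top ν' _) (hle' Aᶜ)
    simpa [measureReal_def] using this
  have hνc : ν.real A + ν.real Aᶜ = 1 := probReal_add_probReal_compl hA
  have hνc' : ν'.real A + ν'.real Aᶜ = 1 := probReal_add_probReal_compl hA
  have hμc : μ.real A + μ.real Aᶜ = μ.real Set.univ := measureReal_add_measureReal_compl hA
  have hμc' : μ'.real A + μ'.real Aᶜ = μ'.real Set.univ := measureReal_add_measureReal_compl hA
  have hA2 : ν.real A - μ.real A ≤ d := by linarith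
  have hA2' : ν'.real A - μ'.real A ≤ d' := by linarith
  -- μ A - p A ∈ [0, d]
  have hμA0 : 0 ≤ μ.real A := measureReal_nonneg
  have hμA0' : 0 ≤ μ'.real A := measureReal_nonneg
  have hpA : μ.real A / μ.real Set.univ ≤ 1 := by
    rw [div_le_one hmpos]; linarith [measureReal_nonneg (μ := μ) (s := Aᶜ)]
  have hpA' : μ'.real A / μ'.real Set.univ ≤ 1 := by
    rw [div_le_one hmpos']; linarith [measureReal_nonneg (μ := μ') (s := Aᶜ)]
  have hA3 : |μ.real A - μ.real A / μ.real Set.univ| ≤ d := by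
    have e1 : μ.real A - μ.real A / μ.real Set.univ = -((μ.real A / μ.real Set.univ) * (1 - μ.real Set.univ)) := by
      field_simp
      ring
    rw [e1, abs_neg, abs_of_nonneg (mul_nonneg (div_nonneg hμA0 hmpos.le) (by linarith))]
    calc μ.real A / μ.real Set.univ * (1 - μ.real Set.univ) ≤ 1 * (1 - μ.real Set.univ) :=
          mul_le_mul_of_nonneg_right hpA (by linarith)
      _ ≤ d := by linarith
  have hA3' : |μ'.real A - μ'.real A / μ'.real Set.univ| ≤ d' := by
    have e1 : μ'.real A - μ'.real A / μ'.real Set.univ = -((μ'.real A / μ'.real Set.univ) * (1 - μ'.real Set.univ)) := by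
      field_simp
      ring
    rw [e1, abs_neg, abs_of_nonneg (mul_nonneg (div_nonneg hμA0' hmpos'.le) (by linarith))]
    calc μ'.real A / μ'.real Set.univ * (1 - μ'.real Set.univ) ≤ 1 * (1 - μ'.real Set.univ) :=
          mul_le_mul_of_nonneg_right hpA' (by linarith)
      _ ≤ d' := by linarith
  rw [abs_le] at h hA3 hA3' ⊢
  constructor <;> linarith

/-- The normalised measure of a density measure is the density measure of the normalised density. -/
theorem normalised_withDensity (dU μ : Measure α) (ρ : α → ℝ) (hρ : μ = dU.withDensity (fun U => ENNReal.ofReal (ρ U)))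
    (h0 : μ Set.univ ≠ 0) (htop : μ Set.univ ≠ ⊤) :
    (μ Set.univ)⁻¹ • μ = dU.withDensity (fun U => ENNReal.ofReal ((μ Set.univ).toReal⁻¹ * ρ U)) := by
  have hm : 0 < (μ Set.univ).toReal := ENNReal.toReal_pos h0 htop
  have e1 : (fun U => ENNReal.ofReal ((μ Set.univ).toReal⁻¹ * ρ U)) = (μ Set.univ)⁻¹ • (fun U => ENNReal.ofReal (ρ U)) := by
    funext U
    rw [Pi.smul_apply, smul_eq_mul, ENNReal.ofReal_mul (inv_nonneg.mpr hm.le), ENNReal.ofReal_inv_of_pos hm, ENNReal.ofReal_toReal htop]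
  rw [e1, withDensity_smul' _ _ (ENNReal.inv_ne_top.mpr h0), ← hρ]

/-- Inner tails of the normalised measure. -/
theorem normalised_tail (μ ν : Measure α) (hle : μ ≤ ν) (S : Set α) {r : ℝ} (_hr : 0 ≤ r) (hS : ν S ≤ ENNReal.ofReal r)
    (hm : ENNReal.ofReal 2⁻¹ ≤ μ Set.univ) : ((μ Set.univ)⁻¹ • μ) S ≤ ENNReal.ofReal (2 * r) := by
  rw [Measure.smul_apply, smul_eq_mul]
  have hm' : (2 : ENNReal)⁻¹ ≤ μ Set.univ := by
    rwa [ENNReal.ofReal_inv_of_pos two_pos, ENNReal.ofReal_ofNat] at hm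
  have h1 : (μ Set.univ)⁻¹ ≤ 2 := by
    have := ENNReal.inv_le_inv.mpr hm'
    simpa using this
  calc (μ Set.univ)⁻¹ * μ S ≤ 2 * ENNReal.ofReal r := mul_le_mul' h1 ((hle S).trans hS)
    _ = ENNReal.ofReal (2 * r) := by rw [ENNReal.ofReal_mul (by norm_num : (0:ℝ) ≤ 2), ENNReal.ofReal_ofNat]

/-- One-bond second differences do not see a normalisation. -/
theorem log_norm_diff {c c' x y x₂ y₂ : ℝ} (hc : 0 < c) (hc' : 0 < c') (hx : 0 < x) (hy : 0 < y) (hx₂ : 0 < x₂) (hy₂ : 0 < y₂) :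
    (Real.log (c * x) - Real.log (c' * y)) - (Real.log (c * x₂) - Real.log (c' * y₂)) =
      (Real.log x - Real.log y) - (Real.log x₂ - Real.log y₂) := by
  rw [Real.log_mul hc.ne' hx.ne', Real.log_mul hc'.ne' hy.ne', Real.log_mul hc.ne' hx₂.ne', Real.log_mul hc'.ne' hy₂.ne']
  ring

/-- The normalised measure is a probability measure. -/
theorem isProbabilityMeasure_normalised (μ : Measure α) (h0 : μ Set.univ ≠ 0) (htop : μ Set.univ ≠ ⊤) :
    IsProbabilityMeasure ((μ Set.univ)⁻¹ • μ) :=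
  ⟨by rw [Measure.smul_apply, smul_eq_mul, ENNReal.inv_mul_cancel h0 htop]⟩

end SFTower

/-! ## Kernel-checked edges -/

/-- KERNEL EDGE TO ROUTE BLR (v7; v17: from the GENERIC v16 text `BackwardStabilityFinSupGen`, which is no longer derived here): the uniform
finite-run organ on all towers implies the route's KT-η-repaired DECIDING crux `BackwardStabilityAdmF` (stmt-QuantumFields-23877, BLR rev 13) BY NAME. -/
theorem backwardStabilityAdmF_of_gen (h : BackwardStabilityFinSupGen) :
    Summit.QuantumFields.YangMills.Theses.BackwardLiouvilleRigidity.BackwardStabilityAdmF := by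
  obtain ⟨γ₁, hγ₁, H⟩ := h
  refine ⟨γ₁, hγ₁, ?_⟩
  intro F γ hγ hle b₀ p₀ κ j₀ prm ω η hb hp hadm hκ hωη hη hη2 hηt μ μ' ρ ρ' hμ hμ' hcl
  obtain ⟨θ, C, w₀, ε, δ, j₁, hθ, hC, hw₀, hεδ, hεs, hδs, hDs, hD0, hj, Hc⟩ :=
    H F γ hγ hle b₀ p₀ κ j₀ prm η hb hp hadm hκ (fun j => (hωη j).2) hη hη2 hηt
  refine ⟨θ, C, w₀, ε, δ, j₁, hθ, hC, hw₀, hεδ, hεs, hδs, hDs, hD0, hj, ?_⟩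
  intro j J hj₁ hjJ hw hCc b U V hU hV hUV
  refine Hc J (J + 1) (ω J) (Nat.lt_succ_self J) (hωη J).1 μ μ' ρ ρ' (fun i _ => ⟨(hμ i).1, (hμ' i).1⟩)
    (fun i _ => ⟨(hμ i).2, (hμ' i).2⟩) ?_ ?_ j hj₁ hjJ hw hCc b U V hU hV hUV
  · intro i hi _
    obtain ⟨h1, h2, h3, h4, h5, -, h7, h8, h9⟩ := hcl i hi
    exact ⟨h1, h2, h3, h4, h5, h7, h8, h9⟩
  · exact (hcl J (hj.trans (hj₁.trans hjJ))).2.2.2.2.2.1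

/-- v10 · THE UNIT LAW OF RUN `K` READ AT ANY HEIGHT `j ≤ K` OF ITS NESTED LAWS: `∫ g dμ_K = ∫ g ∘ A_j dν_{K,j}` for every
measurable `g` on unit fields (`A_j = unitShift ∘ avg^j`; downward induction on the height by `nest` = `unitShift_iter_descend`,
[Balaban1987RG1] (0.11); the loop-product case is the tree's `integral_prod_avgObs_nestedLaw`). -/
theorem integral_comp_unitA_nestedLaw (F : T3Family) {γ : ℝ}
    (ν : ℕ → (j : ℕ) → Measure (GaugeField (F.P j) 0 (Matrix.specialUnitaryGroup (Fin 2) ℂ)))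
    (h1 : ∀ K, ν K K = T4GenFunBounds.gibbsMeasure (F.P K) ((F.scheme ℰp γ).β K))
    (h2 : ∀ K j, j < K → ν K j = Measure.map (descend F ℰp j) (ν K (j + 1)))
    {g : GaugeField (F.P 0) 0 (Matrix.specialUnitaryGroup (Fin 2) ℂ) → ℝ} (hg : Measurable g) (K : ℕ) :
    ∀ j, j ≤ K → ∫ u, g (Literature.MathematicalPhysics.QuantumFieldTheory.Balaban1983to89.T3LevelShift.unitShift F j (Averaging.iter (fun i => BlockAveraging.blockAvg (P := F.P j) (j := i) ℰp) j u)) ∂(ν K j) =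
      ∫ u, g u ∂(F.unitLaw ℰp measurableE_ℰp γ K) := by
  have hmeas : ∀ j, Measurable fun u : GaugeField (F.P j) 0 (Matrix.specialUnitaryGroup (Fin 2) ℂ) => g (Literature.MathematicalPhysics.QuantumFieldTheory.Balaban1983to89.T3LevelShift.unitShift F j (Averaging.iter (fun i => BlockAveraging.blockAvg (P := F.P j) (j := i) ℰp) j u)) := fun j =>
    hg.comp ((Literature.MathematicalPhysics.QuantumFieldTheory.Balaban1983to89.T3LevelShift.measurable_unitShift F j).comp
      (Literature.MathematicalPhysics.QuantumFieldTheory.Balaban1983to89.T4Continuum.measurable_iter _ (F.avgMeasurable_of_measurableE ℰp measurableE_ℰp j) j))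
  rw [Literature.MathematicalPhysics.QuantumFieldTheory.Balaban1983to89.T3ThresholdRemoval.integral_unitLaw measurableE_ℰp K hg]
  suffices h : ∀ d j, j + d = K → ∫ u, g (Literature.MathematicalPhysics.QuantumFieldTheory.Balaban1983to89.T3LevelShift.unitShift F j (Averaging.iter (fun i => BlockAveraging.blockAvg (P := F.P j) (j := i) ℰp) j u)) ∂(ν K j) =
      ∫ u, g (Literature.MathematicalPhysics.QuantumFieldTheory.Balaban1983to89.T3LevelShift.unitShift F K (Averaging.iter (fun i => BlockAveraging.blockAvg (P := F.P K) (j := i) ℰp) K u)) ∂T4GenFunBounds.gibbsMeasure (F.P K) ((F.scheme ℰp γ).β K) from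
    fun j hj => h (K - j) j (by omega)
  intro d
  induction d with
  | zero =>
    intro j hj
    rw [add_zero] at hj
    subst hj
    rw [h1]
  | succ d ih =>
    intro j hj
    rw [h2 K j (by omega), integral_map (measurable_descend F ℰp measurableE_ℰp j).aemeasurable (hmeas j).aestronglyMeasurable,
      ← ih (j + 1) (by omega)]
    refine integral_congr_ae (Eventually.of_forall fun u => ?_)
    show g (Literature.MathematicalPhysics.QuantumFieldTheory.Balaban1983to89.T3LevelShift.unitShift F j (Averaging.iter (fun i => BlockAveraging.blockAvg (P := F.P j) (j := i) ℰp) j (descend F ℰp j u))) = _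
    rw [unitShift_iter_descend]

/-! ## §V18.U THE RE-KEYED COMPOSITION (REPLACES v17.2's `unitLawCauchy_perL_of` ll. 1131–1420): helpers, then `unitLawCauchy_perL_of_H` -/

section V18Composition

open T4CubeChartExp (expPt)
open Summit.QuantumFields.YangMills.Theorems.OrganTangentSeedHTriple (seedTriple_of_seed_of_analytic_three)
open Summit.QuantumFields.YangMills.Theorems.OrganTangentSeedBudget (normalisedSeed_div_four_le b₀_sq_le_beta_mul_θBal_sq)
open scoped BigOperators


/-- Pure-real comparison of the v18 δ-letter `δ_j·β_j(2N + N²)` with the frame's `(Σ'δ)·(1 + 2β_jN)·N²` (`N = #PBond_j = #Plaq_j ≥ 1`). -/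
theorem deltaV_le {d D β N : ℝ} (hd : 0 ≤ d) (hdD : d ≤ D) (hβ : 0 ≤ β) (hN : 1 ≤ N) :
    d * (β * (2 * N + N ^ 2)) ≤ 3 / 2 * (D * ((1 + 2 * β * N) * N ^ 2)) := by
  have h1 : 2 * N + N ^ 2 ≤ 3 * N ^ 2 := by nlinarith
  have h2 : d * (β * (2 * N + N ^ 2)) ≤ d * (β * (3 * N ^ 2)) := by gcongr
  have h3 : 3 * N ^ 2 ≤ 3 * N ^ 3 := by nlinarith
  have hD : 0 ≤ D := hd.trans hdD
  have h4 : d * (β * (3 * N ^ 2)) ≤ D * (β * (3 * N ^ 3)) := by gcongr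
  have h5 : D * (β * (3 * N ^ 3)) ≤ 3 / 2 * (D * ((1 + 2 * β * N) * N ^ 2)) := by
    nlinarith [mul_nonneg hD (sq_nonneg N), mul_nonneg (mul_nonneg hD hβ) (pow_nonneg (zero_le_one.trans hN) 3)]
  linarith

/-- `#Plaq_j = #PBond_j` on the cell's `d = 3` lattices. -/
theorem card_plaq_eq_card_pbond (F : T3Family) (j : ℕ) :
    (Fintype.card (Plaq (F.P j) 0) : ℝ) = (Fintype.card (PBond (F.P j) 0) : ℝ) := by
  have hd : (F.P j).d = 3 := rfl
  have h1 : Fintype.card (Plaq (F.P j) 0) = 3 * Fintype.card (Site (F.P j) 0) := B10Eq41TorusHistories.card_plaq_three hd 0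
  have h2 : Fintype.card (PBond (F.P j) 0) = (F.P j).d * Fintype.card (Site (F.P j) 0) := B10StarCount.card_pbond
  rw [h1, h2, hd]

/-- `1 ≤ #PBond_j`. -/
theorem one_le_card_pbond (F : T3Family) (j : ℕ) : (1 : ℝ) ≤ (Fintype.card (PBond (F.P j) 0) : ℝ) := by
  have h2 : Fintype.card (PBond (F.P j) 0) = (F.P j).d * Fintype.card (Site (F.P j) 0) := B10StarCount.card_pbond
  have h3 : Fintype.card (Site (F.P j) 0) = (F.P j).sitesPerDir 0 ^ (F.P j).d := Site.card_site _ _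
  have h4 : (F.P j).sitesPerDir 0 = 2 * F.L ^ (F.m + j) := rfl
  have hd : (F.P j).d = 3 := rfl
  have hL : 1 ≤ F.L := F.hL.2.le
  have h5 : 1 ≤ Fintype.card (PBond (F.P j) 0) := by
    rw [h2, h3, h4, hd]
    have : 1 ≤ F.L ^ (F.m + j) := Nat.one_le_pow _ _ hL
    calc 1 ≤ 2 * F.L ^ (F.m + j) := by omega
      _ ≤ (2 * F.L ^ (F.m + j)) ^ 3 := Nat.le_self_pow (by norm_num) _
      _ ≤ 3 * (2 * F.L ^ (F.m + j)) ^ 3 := by omega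
  exact_mod_cast h5

/-- The top 4-point clause is monotone in its size. -/
theorem fourPoint_mono {P : Params} {j : ℕ} {θ ω ω' κ : ℝ} (hω : ω ≤ ω')
    {f f' : GaugeField P j ↥(Matrix.specialUnitaryGroup (Fin 2) ℂ) → ℝ}
    (h : ∀ (b b' : PBond P j) (U V W Z : GaugeField P j ↥(Matrix.specialUnitaryGroup (Fin 2) ℂ)),
      PlaqSmall θ U → PlaqSmall θ V → PlaqSmall θ W → PlaqSmall θ Z →
      (∀ e, e ≠ b → U e = V e) → (∀ e, e ≠ b' → U e = W e) → (∀ e, e ≠ b' → V e = Z e) → (∀ e, e ≠ b → W e = Z e) →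
      |(f U - f' U) - (f V - f' V) - ((f W - f' W) - (f Z - f' Z))| ≤ ω * Real.exp (-(κ * (b.src.tdist b'.src : ℝ)))) :
    ∀ (b b' : PBond P j) (U V W Z : GaugeField P j ↥(Matrix.specialUnitaryGroup (Fin 2) ℂ)),
      PlaqSmall θ U → PlaqSmall θ V → PlaqSmall θ W → PlaqSmall θ Z →
      (∀ e, e ≠ b → U e = V e) → (∀ e, e ≠ b' → U e = W e) → (∀ e, e ≠ b' → V e = Z e) → (∀ e, e ≠ b → W e = Z e) →
      |(f U - f' U) - (f V - f' V) - ((f W - f' W) - (f Z - f' Z))| ≤ ω' * Real.exp (-(κ * (b.src.tdist b'.src : ℝ))) :=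
  fun b b' U V W Z hU hV hW hZ h1 h2 h3 h4 =>
    (h b b' U V W Z hU hV hW hZ h1 h2 h3 h4).trans (mul_le_mul_of_nonneg_right hω (Real.exp_pos _).le)

/-- `√√·` tends to zero along a sequence tending to zero. -/
theorem tendsto_sqrt_sqrt {s : ℕ → ℝ} (hs : Tendsto s atTop (𝓝 0)) :
    Tendsto (fun K => Real.sqrt (Real.sqrt (s K))) atTop (𝓝 0) := by
  have h1 : Tendsto (fun K => Real.sqrt (s K)) atTop (𝓝 0) := by
    have h := (Real.continuous_sqrt.tendsto 0).comp hs
    rwa [Real.sqrt_zero] at h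
  have h := (Real.continuous_sqrt.tendsto 0).comp h1
  rwa [Real.sqrt_zero] at h


/-- v18 · PER-BLOCK-SIZE CAUCHY ESTIMATE FOR THE UNIT LAWS from the H-currency package {S1aᴴ, S1b, S2, S3ᴴ, S4c} — S3ᴴ's inner-window
sup-oscillation feeds the landed `RunPairOrganWindowTVOfSupOsc.windowTV_of_supOsc` (LEAD w3 g24 pen 10) directly; the seed of S2 (size `σ K → 0`,
rate `κs`) is converted at the seed height `T = J K₀` into S3ᴴ's H-triple by ✓`OrganTangentSeedHTriple.seedTriple_of_seed_of_analytic_three`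
(px5 g18) at weight rate `κ := κs∕5 < κs∕4` (FLAG (c-κ)), radius `rA ≤ 1∕12` and oscillation letter `CB·β_jθ_j²` (S1aᴴ v0.3's (β), N2 TEXT-SIDE);
its normalised size obeys ✓px5 `normalisedSeed_div_four_le` (✓p800785, BY NAME): `x_T = wT∕Y_T ≤ M₂·(σ K₀ + 1∕(K₀+1))^{1∕4} → 0` with
`Y_T = β_Tθ_T² ≥ b₀²` (✓`b₀_sq_le_beta_mul_θBal_sq`) and `M₂ = 800√32·(√800·⁴√6)∕rA²·(3(2(1+1∕(κs∕4−κs∕5)))³)∕4·max (1∕b₀²) (2CB)` — RATE-FREE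
(S2's `J K·σ K → 0` clause is no longer used).  Kernel-checked bookkeeping; no `sorry` outside the stubs it is fed. -/
theorem unitLawCauchy_perL_of_H (h1a : RunClassMembershipH) (h1b : RunWindowTails) (h2 : RunPairSeed) (h3 : BackwardStabilityFinSupH)
    (h4b : WindowTVOsc) (h4c : IntegralOfTV) (L : ℕ) :
    ∃ γ₁ : ℝ, 0 < γ₁ ∧ ∀ (F : T3Family) (γ : ℝ), F.L = L → 0 < γ → γ ≤ γ₁ →
    ∀ (g : GaugeField (F.P 0) 0 (Matrix.specialUnitaryGroup (Fin 2) ℂ) → ℝ), Measurable g → (∀ u, |g u| ≤ 1) →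
      CauchySeq (fun K => ∫ u, g u ∂(F.unitLaw ℰp measurableE_ℰp γ K)) := by
  classical
  obtain ⟨pm, hpm, H1a⟩ := h1a L
  obtain ⟨pW, γe, hγe, H3⟩ := h3
  obtain ⟨pV, HV⟩ := Summit.QuantumFields.YangMills.Theorems.FlatRatioTermination.stub_thresholds
  obtain ⟨pT, hpT, h1b⟩ := h1b
  obtain ⟨pS, h2L⟩ := h2 L
  obtain ⟨p₀, hp₀def⟩ : ∃ p₀ : ℝ, p₀ = max (max pm pW) (max pV (max 1 (max (2 * pT) pS))) := ⟨_, rfl⟩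
  have hpm₀ : pm ≤ p₀ := by rw [hp₀def]; exact (le_max_left _ _).trans (le_max_left _ _)
  have hpW₀ : pW ≤ p₀ := by rw [hp₀def]; exact (le_max_right _ _).trans (le_max_left _ _)
  have hpV₀ : pV ≤ p₀ := by rw [hp₀def]; exact (le_max_left _ _).trans (le_max_right _ _)
  have h1le : (1 : ℝ) ≤ p₀ := by rw [hp₀def]; exact (le_max_left _ _).trans ((le_max_right _ _).trans (le_max_right _ _))
  have h2pT : 2 * pT ≤ p₀ := by
    rw [hp₀def]; exact (le_max_left _ _).trans ((le_max_right _ _).trans ((le_max_right _ _).trans (le_max_right _ _)))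
  have hpS₀ : pS ≤ p₀ := by
    rw [hp₀def]; exact (le_max_right _ _).trans ((le_max_right _ _).trans ((le_max_right _ _).trans (le_max_right _ _)))
  have hp₀ : 0 < p₀ := lt_of_lt_of_le one_pos h1le
  have hpT₀ : pT ≤ p₀ := by linarith
  have hpT2 : pT ≤ p₀ / 2 := by linarith
  obtain ⟨b₀, hb₀, γa, hγa, H1a⟩ := H1a p₀ hpm₀
  have hb8 : 0 < b₀ / 8 := by positivity
  have hsb₀ : 0 < Real.sqrt (b₀ / 8) := Real.sqrt_pos.mpr hb8
  have hp₀2 : 0 < p₀ / 2 := by positivity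
  obtain ⟨γb, hγb, H1b⟩ := h1b L b₀ p₀ hb₀ hpT₀
  obtain ⟨γc, hγc, H1c⟩ := h1b L (Real.sqrt (b₀ / 8)) (p₀ / 2) hsb₀ hpT2
  obtain ⟨γd, hγd, κs, hκs, H2⟩ := h2L b₀ p₀ hb₀ hpS₀ hp₀
  -- S1b at the HALF window profile (deficit tails of the smooth cut)
  obtain ⟨γf, hγf, H1d⟩ := h1b L (b₀ / 2) p₀ (half_pos hb₀) hpT₀
  refine ⟨min (min (min γa γb) (min γc γd)) (min (min γe γf) 1), by positivity, ?_⟩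
  intro F γ hFL hγ hle g hg hgb
  have hγa' : γ ≤ γa := hle.trans ((min_le_left _ _).trans ((min_le_left _ _).trans (min_le_left _ _)))
  have hγb' : γ ≤ γb := hle.trans ((min_le_left _ _).trans ((min_le_left _ _).trans (min_le_right _ _)))
  have hγc' : γ ≤ γc := hle.trans ((min_le_left _ _).trans ((min_le_right _ _).trans (min_le_left _ _)))
  have hγd' : γ ≤ γd := hle.trans ((min_le_left _ _).trans ((min_le_right _ _).trans (min_le_right _ _)))
  have hγe' : γ ≤ γe := hle.trans ((min_le_right _ _).trans ((min_le_left _ _).trans (min_le_left _ _)))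
  have hγf' : γ ≤ γf := hle.trans ((min_le_right _ _).trans ((min_le_left _ _).trans (min_le_right _ _)))
  have hγ1 : γ ≤ 1 := hle.trans ((min_le_right _ _).trans (min_le_right _ _))
  have hL1 : 1 ≤ F.L := F.hL.2.le
  have hLpos : (0 : ℝ) < (F.L : ℝ) := by exact_mod_cast (show 0 < F.L by omega)
  have hβpos : ∀ i : ℕ, 0 < (F.L : ℝ) ^ i / γ := fun i => div_pos (pow_pos hLpos i) hγ
  -- nested laws of the runs and the data delivered by S1aᴴ, S1b (outer, inner and half profile), S2, S3ᴴ, the thresholds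
  obtain ⟨ν, hν1, hν2, hν3⟩ :=
    Summit.QuantumFields.YangMills.Theorems.BackwardLiouvilleRigidityHeightwiseRealisation.exists_nestedLaws F hγ.le
  obtain ⟨j₀, prm, rA, CB, hadm, hrA, hrA12, hCB, Hρ⟩ := H1a F γ hFL hγ hγa'
  have Hρ := Hρ ν hν1 hν2
  obtain ⟨η, hη0, hηs, hηs2, hηt, Hη⟩ := H1b F γ hFL hγ hγb'
  have Hη := Hη ν hν1 hν2
  obtain ⟨η', hη'0, hη's, -, -, Hη'⟩ := H1c F γ hFL hγ hγc'
  have Hη' := Hη' ν hν1 hν2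
  obtain ⟨η₂, hη₂0, hη₂s, -, -, Hη₂⟩ := H1d F γ hFL hγ hγf'
  have Hη₂ := Hη₂ ν hν1 hν2
  obtain ⟨J, σ, hJlt, hJle, hJ, hσ0, hσ, -, Hs⟩ := H2 F γ hFL hγ hγd'
  have Hs := Hs ν hν1 hν2
  -- the H-currency constants: weight rate κs/5 (FLAG (c-κ)), radius rA ≤ 1/12 and letter CB·β_jθ_j² from S1aᴴ v0.3 (N2 text-side)
  have hκ5 : 0 < κs / 5 := by positivity
  have hκ54 : κs / 5 < κs / 4 := by linarith
  have hY0 : ∀ i : ℕ, 0 < ((F.L : ℝ) ^ i / γ) * θBal F.L γ b₀ p₀ i ^ 2 := fun i =>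
    mul_pos (hβpos i) (pow_pos (T3MinimiserStabilityReduction.θBal_pos hL1 hγ hγ1 hb₀ _ _) 2)
  have hYb : ∀ i : ℕ, b₀ ^ 2 ≤ (F.L : ℝ) ^ i / γ * θBal F.L γ b₀ p₀ i ^ 2 := fun i =>
    b₀_sq_le_beta_mul_θBal_sq F hγ hγ1 hb₀.le hp₀.le i
  obtain ⟨Cs, w₀, δ, j₁, hCs, hw₀, hδ0, hδs, hDs, hD0, hj₀₁, Horg⟩ :=
    H3 F γ hγ hγe' b₀ p₀ (κs / 5) j₀ prm η rA (fun i => CB * (((F.L : ℝ) ^ i / γ) * θBal F.L γ b₀ p₀ i ^ 2))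
      hb₀ hp₀ hpW₀ hadm hκ5 hη0 hηs hηs2 hηt hrA
  obtain ⟨jV, HVj⟩ := HV p₀ hpV₀ F γ (b₀ / 8) hγ hγ1 hb8
  -- the normalised-seed constant (✓px5 g18 `OrganTangentSeedBudget.normalisedSeed_div_four_le`, ✓p800785, BY NAME) and the shifted seed
  -- sizes σ′ K := σ K + 1/(K+1) > 0
  have hκr : 0 < κs / 4 - κs / 5 := by linarith
  obtain ⟨M₂, hM₂def⟩ : ∃ M₂ : ℝ, M₂ = 800 * Real.sqrt 32 * (Real.sqrt 800 * Real.sqrt (Real.sqrt 6)) / rA ^ 2 *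
      (3 * (2 * (1 + 1 / (κs / 4 - κs / 5))) ^ 3) / 4 * max (1 / b₀ ^ 2) (2 * CB) := ⟨_, rfl⟩
  have hS3 : 0 ≤ (3 * (2 * (1 + 1 / (κs / 4 - κs / 5))) ^ 3 : ℝ) := by positivity
  have hM₂ : 0 ≤ M₂ := by rw [hM₂def]; positivity
  have hσ'0 : ∀ K : ℕ, 0 < σ K + 1 / ((K : ℝ) + 1) := fun K => add_pos_of_nonneg_of_pos (hσ0 K) (by positivity)
  have hσ' : Tendsto (fun K : ℕ => σ K + 1 / ((K : ℝ) + 1)) atTop (𝓝 0) := by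
    have h := hσ.add tendsto_one_div_add_atTop_nhds_zero_nat
    rwa [add_zero] at h
  have hs4 : Tendsto (fun K : ℕ => Real.sqrt (Real.sqrt (σ K + 1 / ((K : ℝ) + 1)))) atTop (𝓝 0) := tendsto_sqrt_sqrt hσ'
  -- positivity facts and the letters V_j := β_j·(2·#Plaq_j + #PBond_j²)
  have hV0 : ∀ i : ℕ, 0 ≤ ((F.L : ℝ) ^ i / γ) * (2 * (Fintype.card (Plaq (F.P i) 0) : ℝ) + (Fintype.card (PBond (F.P i) 0) : ℝ) ^ 2) :=
    fun i => by positivity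
  have hDt0 : ∀ i, 0 ≤ ∑' k, δ (k + i) := fun i => tsum_nonneg fun k => hδ0 _
  have hδle : ∀ i, δ i ≤ ∑' k, δ (k + i) := fun i => by
    have hs : Summable fun k => δ (k + i) := (summable_nat_add_iff i).mpr hδs
    have h := hs.le_tsum 0 (fun k _ => hδ0 _)
    simpa using h
  -- the sequences that tend to zero in the height j
  have hδV_key : ∀ i : ℕ, δ i * (((F.L : ℝ) ^ i / γ) * (2 * (Fintype.card (Plaq (F.P i) 0) : ℝ) +
      (Fintype.card (PBond (F.P i) 0) : ℝ) ^ 2)) ≤ 3 / 2 * ((∑' k, δ (k + i)) * ((1 + 2 * ((F.L : ℝ) ^ i / γ) *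
      (Fintype.card (Plaq (F.P i) 0) : ℝ)) * (Fintype.card (PBond (F.P i) 0) : ℝ) ^ 2)) := by
    intro i
    rw [card_plaq_eq_card_pbond F i]
    exact deltaV_le (hδ0 i) (hδle i) (hβpos i).le (one_le_card_pbond F i)
  have hδV_lim : Tendsto (fun i => δ i * (((F.L : ℝ) ^ i / γ) * (2 * (Fintype.card (Plaq (F.P i) 0) : ℝ) +
      (Fintype.card (PBond (F.P i) 0) : ℝ) ^ 2))) atTop (𝓝 0) := by
    have hg := hD0.const_mul (3 / 2 : ℝ)
    rw [mul_zero] at hg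
    exact squeeze_zero (fun i => mul_nonneg (hδ0 i) (hV0 i)) hδV_key hg
  have hη'_lim : Tendsto η' atTop (𝓝 0) := hη's.tendsto_atTop_zero
  have hη₂t_lim : Tendsto (fun j => ∑' k, η₂ (k + (j + 1))) atTop (𝓝 0) := (tendsto_sum_nat_add η₂).comp (tendsto_add_atTop_nat 1)
  -- the unit-scale expectations form a Cauchy sequence
  rw [Metric.cauchySeq_iff']
  intro t ht
  obtain ⟨δ₀, hδ₀, HTV⟩ := h4b (t / 8) (by positivity)
  -- choice of the height j
  have evj : ∀ᶠ j : ℕ in atTop, max (max j₀ j₁) jV ≤ j ∧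
      δ j * (((F.L : ℝ) ^ j / γ) * (2 * (Fintype.card (Plaq (F.P j) 0) : ℝ) + (Fintype.card (PBond (F.P j) 0) : ℝ) ^ 2)) ≤ δ₀ / 2 ∧
      η' j ≤ δ₀ / 2 ∧ ∑' k, η₂ (k + (j + 1)) ≤ 1 / 4 ∧ ∑' k, η₂ (k + (j + 1)) ≤ t / 16 := by
    have e1 : ∀ᶠ j : ℕ in atTop, δ j * (((F.L : ℝ) ^ j / γ) * (2 * (Fintype.card (Plaq (F.P j) 0) : ℝ) +
        (Fintype.card (PBond (F.P j) 0) : ℝ) ^ 2)) ≤ δ₀ / 2 := hδV_lim.eventually (ge_mem_nhds (by positivity))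
    have e4 : ∀ᶠ j : ℕ in atTop, η' j ≤ δ₀ / 2 := hη'_lim.eventually (ge_mem_nhds (by positivity))
    have e5 : ∀ᶠ j : ℕ in atTop, ∑' k, η₂ (k + (j + 1)) ≤ 1 / 4 := hη₂t_lim.eventually (ge_mem_nhds (by norm_num))
    have e6 : ∀ᶠ j : ℕ in atTop, ∑' k, η₂ (k + (j + 1)) ≤ t / 16 := hη₂t_lim.eventually (ge_mem_nhds (by positivity))
    exact (eventually_ge_atTop _).and (e1.and (e4.and (e5.and e6)))
  obtain ⟨j, hjmax, hjδ, hjη, hjd4, hjdt⟩ := evj.exists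
  have hj₀ : j₀ ≤ j := ((le_max_left _ _).trans (le_max_left _ _)).trans hjmax
  have hj₁ : j₁ ≤ j := ((le_max_right _ _).trans (le_max_left _ _)).trans hjmax
  have hjV : jV ≤ j := (le_max_right _ _).trans hjmax
  -- choice of the first cut-off K₀ (the seed must be small: x_T ≤ w₀ and Cs·x_T·V_j ≤ δ₀/2)
  have evK : ∀ᶠ K : ℕ in atTop, j ≤ J K ∧ M₂ * Real.sqrt (Real.sqrt (σ K + 1 / ((K : ℝ) + 1))) ≤ w₀ ∧
      Cs * (M₂ * Real.sqrt (Real.sqrt (σ K + 1 / ((K : ℝ) + 1)))) *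
        (((F.L : ℝ) ^ j / γ) * (2 * (Fintype.card (Plaq (F.P j) 0) : ℝ) + (Fintype.card (PBond (F.P j) 0) : ℝ) ^ 2)) ≤ δ₀ / 2 := by
    have e1 : ∀ᶠ K : ℕ in atTop, M₂ * Real.sqrt (Real.sqrt (σ K + 1 / ((K : ℝ) + 1))) ≤ w₀ := by
      have h := hs4.const_mul M₂
      rw [mul_zero] at h
      exact h.eventually (ge_mem_nhds hw₀)
    have e2 : ∀ᶠ K : ℕ in atTop, Cs * (M₂ * Real.sqrt (Real.sqrt (σ K + 1 / ((K : ℝ) + 1)))) *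
        (((F.L : ℝ) ^ j / γ) * (2 * (Fintype.card (Plaq (F.P j) 0) : ℝ) + (Fintype.card (PBond (F.P j) 0) : ℝ) ^ 2)) ≤ δ₀ / 2 := by
      have h := ((hs4.const_mul M₂).const_mul Cs).mul_const
        (((F.L : ℝ) ^ j / γ) * (2 * (Fintype.card (Plaq (F.P j) 0) : ℝ) + (Fintype.card (PBond (F.P j) 0) : ℝ) ^ 2))
      simp only [mul_zero, zero_mul] at h
      exact h.eventually (ge_mem_nhds (by positivity))
    exact (hJ.eventually (eventually_ge_atTop j)).and (e1.and e2)
  obtain ⟨K₀, HK₀⟩ := eventually_atTop.mp (evK.and (eventually_ge_atTop 1))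
  refine ⟨K₀, fun K' hK' => ?_⟩
  obtain ⟨⟨hjJ, hKw, hKδ⟩, hK₀1⟩ := HK₀ K₀ le_rfl
  have hTKlt : J K₀ < K₀ := hJlt K₀ hK₀1
  have hTK : J K₀ ≤ K₀ := hTKlt.le
  have hTK' : J K₀ ≤ K' := hTK.trans hK'
  have hjK : j ≤ K₀ := hjJ.trans hTK
  have hjK' : j ≤ K' := hjK.trans hK'
  -- v17 (R-c + R-a): the SF-projected towers of the two runs below the seed height `J K₀` (constructed, not assumed)
  have hD : ∀ i, Measurable (descend F ℰp i : GaugeField (F.P (i + 1)) 0 (Matrix.specialUnitaryGroup (Fin 2) ℂ) → GaugeField (F.P i) 0 (Matrix.specialUnitaryGroup (Fin 2) ℂ)) :=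
    fun i => measurable_descend F ℰp measurableE_ℰp i
  have hχm : ∀ i, Measurable ((fun i => fun U : GaugeField (F.P i) 0 (Matrix.specialUnitaryGroup (Fin 2) ℂ) => ENNReal.ofReal (sfCut (θBal F.L γ b₀ p₀ i) U)) i) := fun i => ENNReal.measurable_ofReal.comp (measurable_sfCut _)
  have hχ1 : ∀ i U, (fun i => fun U : GaugeField (F.P i) 0 (Matrix.specialUnitaryGroup (Fin 2) ℂ) => ENNReal.ofReal (sfCut (θBal F.L γ b₀ p₀ i) U)) i U ≤ 1 := fun i U => ENNReal.ofReal_le_one.mpr (sfCut_le_one _ _)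
  set μ₁ := SFTower.sfTowerG (fun i => descend F ℰp i) (fun i => fun U : GaugeField (F.P i) 0 (Matrix.specialUnitaryGroup (Fin 2) ℂ) => ENNReal.ofReal (sfCut (θBal F.L γ b₀ p₀ i) U)) (ν K₀) (J K₀) with hμ₁def
  set μ₂ := SFTower.sfTowerG (fun i => descend F ℰp i) (fun i => fun U : GaugeField (F.P i) 0 (Matrix.specialUnitaryGroup (Fin 2) ℂ) => ENNReal.ofReal (sfCut (θBal F.L γ b₀ p₀ i) U)) (ν K') (J K₀) with hμ₂def
  have hanch₁ : ∀ i, J K₀ ≤ i → μ₁ i = ν K₀ i := fun i hi => SFTower.sfTowerG_of_le _ _ _ hi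
  have hanch₂ : ∀ i, J K₀ ≤ i → μ₂ i = ν K' i := fun i hi => SFTower.sfTowerG_of_le _ _ _ hi
  have hcut₁ : ∀ i, i < J K₀ → μ₁ i = Measure.map (descend F ℰp i) ((μ₁ (i + 1)).withDensity ((fun i => fun U : GaugeField (F.P i) 0 (Matrix.specialUnitaryGroup (Fin 2) ℂ) => ENNReal.ofReal (sfCut (θBal F.L γ b₀ p₀ i) U)) (i + 1))) :=
    fun i hi => SFTower.sfTowerG_of_lt _ _ _ hi
  have hcut₂ : ∀ i, i < J K₀ → μ₂ i = Measure.map (descend F ℰp i) ((μ₂ (i + 1)).withDensity ((fun i => fun U : GaugeField (F.P i) 0 (Matrix.specialUnitaryGroup (Fin 2) ℂ) => ENNReal.ofReal (sfCut (θBal F.L γ b₀ p₀ i) U)) (i + 1))) :=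
    fun i hi => SFTower.sfTowerG_of_lt _ _ _ hi
  have hT₁ := SFTower.sfTower_le_and_deficit (fun i => descend F ℰp i) hD (fun i => fun U : GaugeField (F.P i) 0 (Matrix.specialUnitaryGroup (Fin 2) ℂ) => ENNReal.ofReal (sfCut (θBal F.L γ b₀ p₀ i) U)) hχm hχ1 (ν K₀) μ₁ (J K₀)
    (fun i hi => hν2 K₀ i (lt_of_lt_of_le hi hTK)) (hanch₁ _ le_rfl) hcut₁
  have hT₂ := SFTower.sfTower_le_and_deficit (fun i => descend F ℰp i) hD (fun i => fun U : GaugeField (F.P i) 0 (Matrix.specialUnitaryGroup (Fin 2) ℂ) => ENNReal.ofReal (sfCut (θBal F.L γ b₀ p₀ i) U)) hχm hχ1 (ν K') μ₂ (J K₀)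
    (fun i hi => hν2 K' i (lt_of_lt_of_le hi hTK')) (hanch₂ _ le_rfl) hcut₂
  have hle₁ : ∀ i, μ₁ i ≤ ν K₀ i := by
    intro i
    by_cases hi : J K₀ ≤ i
    · rw [hanch₁ i hi]
    · exact (hT₁ (J K₀ - i) i (by omega)).1
  have hle₂ : ∀ i, μ₂ i ≤ ν K' i := by
    intro i
    by_cases hi : J K₀ ≤ i
    · rw [hanch₂ i hi]
    · exact (hT₂ (J K₀ - i) i (by omega)).1
  obtain ⟨ρ₁, hρ₁⟩ := Hρ K₀ (J K₀) hTK μ₁ hanch₁ hcut₁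
  obtain ⟨ρ₂, hρ₂⟩ := Hρ K' (J K₀) hTK' μ₂ hanch₂ hcut₂
  -- the seed at height T := J K₀: S2's 4-point clause (the towers ARE the runs there), docked into the H-triple by ✓px5
  have hθT : 0 < θBal F.L γ b₀ p₀ (J K₀) := T3MinimiserStabilityReduction.θBal_pos hL1 hγ hγ1 hb₀ _ _
  have hBρ : 0 < CB * (((F.L : ℝ) ^ (J K₀) / γ) * θBal F.L γ b₀ p₀ (J K₀) ^ 2) := mul_pos hCB (hY0 _)
  obtain ⟨p1T, w1T, m1T, c1T, a1T⟩ := hρ₁ (J K₀) hTK (hj₀.trans hjJ)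
  obtain ⟨p2T, w2T, m2T, c2T, a2T⟩ := hρ₂ (J K₀) hTK' (hj₀.trans hjJ)
  rw [hanch₁ _ le_rfl] at w1T
  rw [hanch₂ _ le_rfl] at w2T
  have hseed := fourPoint_mono (le_add_of_nonneg_right (by positivity : (0 : ℝ) ≤ 1 / ((K₀ : ℝ) + 1)))
    (Hs K₀ K' hK' (ρ₁ (J K₀)) (ρ₂ (J K₀)) (fun U hU => ⟨p1T U hU, p2T U hU⟩) w1T w2T c1T c2T)
  obtain ⟨kT, hkT0, hkTrow, hkTcl⟩ :=
    seedTriple_of_seed_of_analytic_three F (J K₀) 0 hθT hrA hrA12 hBρ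
      (hσ'0 K₀) hκ54 (fun U => Real.log (ρ₁ (J K₀) U)) (fun U => Real.log (ρ₂ (J K₀) U)) hseed a1T a2T
  -- the seed weight and its normalised size x_T
  obtain ⟨wT, hwTdef⟩ : ∃ wT : ℝ, wT = 800 * Real.sqrt (32 * (CB * (((F.L : ℝ) ^ (J K₀) / γ) * θBal F.L γ b₀ p₀ (J K₀) ^ 2) +
      CB * (((F.L : ℝ) ^ (J K₀) / γ) * θBal F.L γ b₀ p₀ (J K₀) ^ 2))) *
      Real.sqrt (800 * Real.sqrt (6 * (CB * (((F.L : ℝ) ^ (J K₀) / γ) * θBal F.L γ b₀ p₀ (J K₀) ^ 2) +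
      CB * (((F.L : ℝ) ^ (J K₀) / γ) * θBal F.L γ b₀ p₀ (J K₀) ^ 2)))) / rA ^ 2 *
      Real.sqrt (Real.sqrt (σ K₀ + 1 / ((K₀ : ℝ) + 1))) * (3 * (2 * (1 + 1 / (κs / 4 - κs / 5))) ^ 3) / 4 := ⟨_, rfl⟩
  have hwT0 : 0 ≤ wT := by rw [hwTdef]; positivity
  have hxle : wT / (((F.L : ℝ) ^ (J K₀) / γ) * θBal F.L γ b₀ p₀ (J K₀) ^ 2) ≤ M₂ * Real.sqrt (Real.sqrt (σ K₀ + 1 / ((K₀ : ℝ) + 1))) := by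
    rw [hwTdef, hM₂def]
    exact normalisedSeed_div_four_le hb₀ (hYb _) hCB.le hS3
  have hx0 : 0 ≤ wT / (((F.L : ℝ) ^ (J K₀) / γ) * θBal F.L γ b₀ p₀ (J K₀) ^ 2) := div_nonneg hwT0 (hY0 _).le
  have hxw : wT / (((F.L : ℝ) ^ (J K₀) / γ) * θBal F.L γ b₀ p₀ (J K₀) ^ 2) ≤ w₀ := hxle.trans hKw
  -- the organ S3ᴴ, seeded at height J K₀, run down to height j in the SF-projected currency: inner-window sup-oscillation
  have hosc := Horg ν hν1 hν2 K₀ K' hK' (J K₀) K₀ hTKlt le_rfl μ₁ μ₂ ρ₁ ρ₂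
    (fun i hi _ => ⟨hanch₁ i hi, hanch₂ i hi⟩)
    (fun i hi => ⟨hcut₁ i hi, hcut₂ i hi⟩)
    (fun i hi hiK => by
      rw [hanch₁ i hi, hanch₂ i hi, hanch₁ (i + 1) (by omega), hanch₂ (i + 1) (by omega)]
      exact ⟨hν2 K₀ i hiK, hν2 K' i (lt_of_lt_of_le hiK hK')⟩)
    (fun i _ => by
      haveI := hν3 K₀ i
      haveI := hν3 K' i
      exact ⟨isFiniteMeasure_of_le (ν K₀ i) (hle₁ i), isFiniteMeasure_of_le (ν K' i) (hle₂ i)⟩)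
    (fun i hi hiT => by
      obtain ⟨p1, w1, m1, c1, a1⟩ := hρ₁ i hiT hi
      obtain ⟨p2, w2, m2, c2, a2⟩ := hρ₂ i (hiT.trans hK') hi
      exact ⟨fun U hU => ⟨p1 U hU, p2 U hU⟩, w1, w2, m1.imp fun _ h => ⟨K₀, hiT, h⟩, m2.imp fun _ h => ⟨K', hiT.trans hK', h⟩,
        ((hle₁ i) _).trans (Hη K₀ i hiT), ((hle₂ i) _).trans (Hη K' i (hiT.trans hK')), ⟨c1, c2⟩,
        ⟨a1, a2⟩⟩)
    wT hwT0 hxw ⟨kT, hkT0, fun b => (hkTrow b).trans (le_of_eq hwTdef.symm), hkTcl⟩ j hj₁ hjJ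
  -- v17: masses and deficits of the SF-projected laws at the termination height j
  have hn : j + (J K₀ - j) = J K₀ := by omega
  have hηsj : Summable fun k => η₂ (k + (j + 1)) := (summable_nat_add_iff (j + 1)).mpr hη₂s
  have hsumη : ∀ (Kr : ℕ), J K₀ ≤ Kr → (∀ i, i ≤ Kr → ν Kr i {U | ¬ PlaqSmall (θBal F.L γ (b₀ / 2) p₀ i) U} ≤ ENNReal.ofReal (η₂ i)) →
      ∑ i ∈ Finset.range (J K₀ - j), ν Kr (j + 1 + i) {x | (fun i => fun U : GaugeField (F.P i) 0 (Matrix.specialUnitaryGroup (Fin 2) ℂ) => ENNReal.ofReal (sfCut (θBal F.L γ b₀ p₀ i) U)) (j + 1 + i) x < 1} ≤ ENNReal.ofReal (∑' k, η₂ (k + (j + 1))) := by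
    intro Kr hKr Hr
    calc ∑ i ∈ Finset.range (J K₀ - j), ν Kr (j + 1 + i) {x | (fun i => fun U : GaugeField (F.P i) 0 (Matrix.specialUnitaryGroup (Fin 2) ℂ) => ENNReal.ofReal (sfCut (θBal F.L γ b₀ p₀ i) U)) (j + 1 + i) x < 1}
        ≤ ∑ i ∈ Finset.range (J K₀ - j), ENNReal.ofReal (η₂ (j + 1 + i)) := Finset.sum_le_sum fun i hi => by
            rw [Finset.mem_range] at hi
            refine (measure_mono fun U hU => ?_).trans (Hr (j + 1 + i) (by omega))
            simp only [Set.mem_setOf_eq, ENNReal.ofReal_lt_one] at hU ⊢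
            rw [θBal_half]
            exact not_plaqSmall_of_sfCut_lt_one (T3MinimiserStabilityReduction.θBal_pos F.hL.2.le hγ hγ1 hb₀ _ _) hU
      _ = ENNReal.ofReal (∑ i ∈ Finset.range (J K₀ - j), η₂ (j + 1 + i)) := (ENNReal.ofReal_sum_of_nonneg fun i _ => hη₂0 _).symm
      _ ≤ ENNReal.ofReal (∑' k, η₂ (k + (j + 1))) := ENNReal.ofReal_le_ofReal (by
            calc ∑ i ∈ Finset.range (J K₀ - j), η₂ (j + 1 + i) = ∑ i ∈ Finset.range (J K₀ - j), η₂ (i + (j + 1)) :=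
                  Finset.sum_congr rfl fun i _ => by rw [add_comm]
              _ ≤ ∑' k, η₂ (k + (j + 1)) := hηsj.sum_le_tsum _ fun i _ => hη₂0 _)
  have hdef₁ : ν K₀ j Set.univ ≤ μ₁ j Set.univ + ENNReal.ofReal (∑' k, η₂ (k + (j + 1))) :=
    (hT₁ (J K₀ - j) j hn).2.trans (add_le_add le_rfl (hsumη K₀ hTK fun i hi => Hη₂ K₀ i hi))
  have hdef₂ : ν K' j Set.univ ≤ μ₂ j Set.univ + ENNReal.ofReal (∑' k, η₂ (k + (j + 1))) :=
    (hT₂ (J K₀ - j) j hn).2.trans (add_le_add le_rfl (hsumη K' hTK' fun i hi => Hη₂ K' i hi))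
  have hd0 : 0 ≤ ∑' k, η₂ (k + (j + 1)) := tsum_nonneg fun k => hη₂0 _
  have hd1 : ∑' k, η₂ (k + (j + 1)) < 1 := by linarith
  haveI hP₀ := hν3 K₀ j
  haveI hP₀' := hν3 K' j
  have hmass : ∀ (νr μr : Measure (GaugeField (F.P j) 0 (Matrix.specialUnitaryGroup (Fin 2) ℂ))), IsProbabilityMeasure νr → μr ≤ νr →
      νr Set.univ ≤ μr Set.univ + ENNReal.ofReal (∑' k, η₂ (k + (j + 1))) →
      μr Set.univ ≠ 0 ∧ μr Set.univ ≠ ⊤ ∧ ENNReal.ofReal 2⁻¹ ≤ μr Set.univ := by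
    intro νr μr hνr hle hdef
    haveI := hνr
    have htop : μr Set.univ ≠ ⊤ := ((hle Set.univ).trans_lt (measure_lt_top _ _)).ne
    have h := ENNReal.toReal_mono (by simp [htop]) hdef
    rw [ENNReal.toReal_add htop ENNReal.ofReal_ne_top, ENNReal.toReal_ofReal hd0] at h
    simp only [measure_univ, ENNReal.toReal_one] at h
    have hhalf : (2 : ℝ)⁻¹ ≤ (μr Set.univ).toReal := by linarith
    refine ⟨fun h0 => by rw [h0, ENNReal.toReal_zero] at hhalf; linarith, htop, (ENNReal.ofReal_le_iff_le_toReal htop).mpr hhalf⟩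
  obtain ⟨hm₁0, hm₁t, hm₁h⟩ := hmass (ν K₀ j) (μ₁ j) hP₀ (hle₁ j) hdef₁
  obtain ⟨hm₂0, hm₂t, hm₂h⟩ := hmass (ν K' j) (μ₂ j) hP₀' (hle₂ j) hdef₂
  haveI hP₁ : IsProbabilityMeasure ((μ₁ j Set.univ)⁻¹ • μ₁ j) := SFTower.isProbabilityMeasure_normalised _ hm₁0 hm₁t
  haveI hP₂ : IsProbabilityMeasure ((μ₂ j Set.univ)⁻¹ • μ₂ j) := SFTower.isProbabilityMeasure_normalised _ hm₂0 hm₂t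
  have hc₁ : 0 < (μ₁ j Set.univ).toReal⁻¹ := inv_pos.mpr (ENNReal.toReal_pos hm₁0 hm₁t)
  have hc₂ : 0 < (μ₂ j Set.univ).toReal⁻¹ := inv_pos.mpr (ENNReal.toReal_pos hm₂0 hm₂t)
  -- termination at height j: the inner window θin := θBal (√(b₀/8)) (p₀/2) j sits inside θ_j/8 (thresholds, b₀ ↦ b₀/8)
  have hθj : 0 < θBal F.L γ b₀ p₀ j := T3MinimiserStabilityReduction.θBal_pos hL1 hγ hγ1 hb₀ _ _
  have hθin : 0 < θBal F.L γ (Real.sqrt (b₀ / 8)) (p₀ / 2) j := T3MinimiserStabilityReduction.θBal_pos hL1 hγ hγ1 hsb₀ _ _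
  have hθinle : θBal F.L γ (Real.sqrt (b₀ / 8)) (p₀ / 2) j ≤ θBal F.L γ b₀ p₀ j := by
    obtain ⟨-, -, h3, -⟩ := HVj j hjV
    rw [θBal_div8] at h3
    have hsq : 0 ≤ 32 * (Real.sqrt (θBal F.L γ b₀ p₀ j / 8) / 16) ^ 2 := by positivity
    linarith
  have hτ0 : 0 ≤ (Cs * (wT / (((F.L : ℝ) ^ (J K₀) / γ) * θBal F.L γ b₀ p₀ (J K₀) ^ 2)) + δ j) *
      (((F.L : ℝ) ^ j / γ) * (2 * (Fintype.card (Plaq (F.P j) 0) : ℝ) + (Fintype.card (PBond (F.P j) 0) : ℝ) ^ 2)) :=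
    mul_nonneg (add_nonneg (mul_nonneg hCs hx0) (hδ0 j)) (hV0 j)
  have hτD : (Cs * (wT / (((F.L : ℝ) ^ (J K₀) / γ) * θBal F.L γ b₀ p₀ (J K₀) ^ 2)) + δ j) *
      (((F.L : ℝ) ^ j / γ) * (2 * (Fintype.card (Plaq (F.P j) 0) : ℝ) + (Fintype.card (PBond (F.P j) 0) : ℝ) ^ 2)) ≤ δ₀ := by
    have h1 : Cs * (wT / (((F.L : ℝ) ^ (J K₀) / γ) * θBal F.L γ b₀ p₀ (J K₀) ^ 2)) *
        (((F.L : ℝ) ^ j / γ) * (2 * (Fintype.card (Plaq (F.P j) 0) : ℝ) + (Fintype.card (PBond (F.P j) 0) : ℝ) ^ 2)) ≤ δ₀ / 2 :=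
      (mul_le_mul_of_nonneg_right (mul_le_mul_of_nonneg_left hxle hCs) (hV0 j)).trans hKδ
    rw [add_mul, ← add_halves δ₀]
    exact add_le_add h1 hjδ
  obtain ⟨p1, w1, m1, c1, -⟩ := hρ₁ j hjK hj₀
  obtain ⟨p2, w2, m2, c2, -⟩ := hρ₂ j hjK' hj₀
  have h1w : PlaqSmall (θBal F.L γ b₀ p₀ j) (1 : GaugeField (F.P j) 0 (Matrix.specialUnitaryGroup (Fin 2) ℂ)) :=
    T3DescentFibreTower.plaqSmall_one hθj
  have hηr0 : 0 ≤ 2 * η' j := mul_nonneg zero_le_two (hη'0 j)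
  have hηrD : 2 * η' j ≤ δ₀ := (le_div_iff₀' zero_lt_two).mp hjη
  have hsup : ∀ U : GaugeField (F.P j) 0 (Matrix.specialUnitaryGroup (Fin 2) ℂ), PlaqSmall (θBal F.L γ (Real.sqrt (b₀ / 8)) (p₀ / 2) j) U →
      |(Real.log ((μ₁ j Set.univ).toReal⁻¹ * ρ₁ j U) - Real.log ((μ₂ j Set.univ).toReal⁻¹ * ρ₂ j U)) -
        (Real.log ((μ₁ j Set.univ).toReal⁻¹ * ρ₁ j (1 : GaugeField (F.P j) 0 (Matrix.specialUnitaryGroup (Fin 2) ℂ))) -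
          Real.log ((μ₂ j Set.univ).toReal⁻¹ * ρ₂ j (1 : GaugeField (F.P j) 0 (Matrix.specialUnitaryGroup (Fin 2) ℂ))))| ≤
      (Cs * (wT / (((F.L : ℝ) ^ (J K₀) / γ) * θBal F.L γ b₀ p₀ (J K₀) ^ 2)) + δ j) *
        (((F.L : ℝ) ^ j / γ) * (2 * (Fintype.card (Plaq (F.P j) 0) : ℝ) + (Fintype.card (PBond (F.P j) 0) : ℝ) ^ 2)) :=
    fun U hU => by
      have hUo : PlaqSmall (θBal F.L γ b₀ p₀ j) U := T3PrintedMinimiserExistence.plaqSmall_of_le hθinle hU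
      rw [SFTower.log_norm_diff hc₁ hc₂ (p1 U hUo) (p2 U hUo) (p1 1 h1w) (p2 1 h1w)]
      exact hosc U hU
  -- WindowTV-osc (✓pen 10, BY NAME through `stub_windowTVOsc`) on the normalised SF-projected laws (two-stage `have`: the frame first, then the laws)
  have hTV1 := HTV F j (θBal F.L γ (Real.sqrt (b₀ / 8)) (p₀ / 2) j) (θBal F.L γ b₀ p₀ j) _ (2 * η' j) hθin hθinle hτ0 hτD hηr0 hηrD
  have hTVn := hTV1 ((μ₁ j Set.univ)⁻¹ • μ₁ j) ((μ₂ j Set.univ)⁻¹ • μ₂ j)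
    (fun U => (μ₁ j Set.univ).toReal⁻¹ * ρ₁ j U) (fun U => (μ₂ j Set.univ).toReal⁻¹ * ρ₂ j U) hP₁ hP₂
    (fun U hU => ⟨mul_pos hc₁ (p1 U hU), mul_pos hc₂ (p2 U hU)⟩)
    (SFTower.normalised_withDensity _ _ _ w1 hm₁0 hm₁t) (SFTower.normalised_withDensity _ _ _ w2 hm₂0 hm₂t) hsup
    (SFTower.normalised_tail _ _ (hle₁ j) _ (hη'0 j) (Hη' K₀ j hjK) hm₁h)
    (SFTower.normalised_tail _ _ (hle₂ j) _ (hη'0 j) (Hη' K' j hjK') hm₂h)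
  have hTVj := SFTower.tv_transfer (ν K₀ j) (ν K' j) (μ₁ j) (μ₂ j) (hle₁ j) (hle₂ j) hd0 hd0 hd1 hd1 hdef₁ hdef₂ hTVn
  -- the observable pulled up to height j (v10: any measurable `g`, `|g| ≤ 1`, on unit fields)
  have hAj : Measurable fun u : GaugeField (F.P j) 0 (Matrix.specialUnitaryGroup (Fin 2) ℂ) => g (Literature.MathematicalPhysics.QuantumFieldTheory.Balaban1983to89.T3LevelShift.unitShift F j (Averaging.iter (fun i => BlockAveraging.blockAvg (P := F.P j) (j := i) ℰp) j u)) :=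
    hg.comp ((Literature.MathematicalPhysics.QuantumFieldTheory.Balaban1983to89.T3LevelShift.measurable_unitShift F j).comp
      (Literature.MathematicalPhysics.QuantumFieldTheory.Balaban1983to89.T4Continuum.measurable_iter _ (F.avgMeasurable_of_measurableE ℰp measurableE_ℰp j) j))
  have hint := h4c F j (ν K₀ j) (ν K' j) (hν3 K₀ j) (hν3 K' j) (t / 8 + 2 * (∑' k, η₂ (k + (j + 1))) + 2 * (∑' k, η₂ (k + (j + 1)))) (by positivity) hTVj
    (fun u => g (Literature.MathematicalPhysics.QuantumFieldTheory.Balaban1983to89.T3LevelShift.unitShift F j (Averaging.iter (fun i => BlockAveraging.blockAvg (P := F.P j) (j := i) ℰp) j u))) hAj (fun u => hgb _)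
  beta_reduce at hint
  rw [integral_comp_unitA_nestedLaw F ν hν1 hν2 hg K₀ j hjK, integral_comp_unitA_nestedLaw F ν hν1 hν2 hg K' j hjK'] at hint
  rw [Real.dist_eq, abs_sub_comm]
  linarith

end V18Composition

/-- KERNEL COMPOSITION (leaf BY NAME; v10: `γ₁ := 1` by refinement, exactly as `Theses.UnitScaleTilt.closes`): run `K + n` of `F` at `γ`
is run `K` of `F.refine n` at `γL^{-n}` (tree `T3ThresholdRemoval.expectAt_refine`, generic measurable `ℰ`), `(F.refine n).L = F.L` by `rfl`, so the
per-`L` Cauchy estimate `unitLawCauchy_perL F.L` applied to the refined family and the bounded measurable `coarseObs` gives `HasContinuumLimit`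
for EVERY `γ > 0`. -/
theorem yM3TorusSU2_of
    (hC : ∀ L : ℕ, ∃ γ₁ : ℝ, 0 < γ₁ ∧ ∀ (F : T3Family) (γ : ℝ), F.L = L → 0 < γ → γ ≤ γ₁ →
      ∀ (g : GaugeField (F.P 0) 0 (Matrix.specialUnitaryGroup (Fin 2) ℂ) → ℝ), Measurable g → (∀ u, |g u| ≤ 1) →
        CauchySeq (fun K => ∫ u, g u ∂(F.unitLaw ℰp measurableE_ℰp γ K))) :
    Literature.MathematicalPhysics.QuantumFieldTheory.Balaban1983to89.T3YM3TorusStatement.YM3TorusSU2 := by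
  refine ⟨1, one_pos, fun F γ hγ _ => ?_⟩
  obtain ⟨γ₁, hγ₁, H⟩ := hC F.L
  have hL : (1 : ℝ) < F.L := by exact_mod_cast F.hL.2
  have hL0 : (0 : ℝ) < F.L := zero_lt_one.trans hL
  obtain ⟨n, hn⟩ := ((tendsto_pow_atTop_nhds_zero_of_lt_one (inv_nonneg.mpr hL0.le)
    (inv_lt_one_of_one_lt₀ hL)).eventually (ge_mem_nhds (div_pos hγ₁ hγ))).exists
  have hpos : 0 < γ * ((F.L : ℝ)⁻¹) ^ n := mul_pos hγ (pow_pos (inv_pos.mpr hL0) n)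
  have hle : γ * ((F.L : ℝ)⁻¹) ^ n ≤ γ₁ := by
    have e := mul_le_mul_of_nonneg_left hn hγ.le
    rwa [mul_div_cancel₀ _ hγ.ne'] at e
  rw [Literature.MathematicalPhysics.QuantumFieldTheory.Balaban1983to89.T3ContinuumYM3Torus.continuumYM3Torus_iff_hasContinuumLimit_SU
    F ℰp measurableE_ℰp hγ.le]
  intro Cs
  have hc := H (F.refine n) _ rfl hpos hle (Literature.MathematicalPhysics.QuantumFieldTheory.Balaban1983to89.T3ThresholdRemoval.coarseObs F n ℰp Cs)
    (Literature.MathematicalPhysics.QuantumFieldTheory.Balaban1983to89.T3ThresholdRemoval.measurable_coarseObs F n ℰp measurableE_ℰp Cs) (Literature.MathematicalPhysics.QuantumFieldTheory.Balaban1983to89.T3ThresholdRemoval.abs_coarseObs_le_one F n ℰp Cs)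
  obtain ⟨l, hl⟩ := cauchySeq_tendsto_of_complete hc
  refine ⟨l, (tendsto_add_atTop_iff_nat n).mp ?_⟩
  have hkey : (fun K => (F.scheme ℰp γ).expectAt (K + n) Cs) = fun K =>
      ∫ u, Literature.MathematicalPhysics.QuantumFieldTheory.Balaban1983to89.T3ThresholdRemoval.coarseObs F n ℰp Cs u ∂(F.refine n).unitLaw ℰp measurableE_ℰp (γ * ((F.L : ℝ)⁻¹) ^ n) K :=
    funext fun K => Literature.MathematicalPhysics.QuantumFieldTheory.Balaban1983to89.T3ThresholdRemoval.expectAt_refine F n ℰp measurableE_ℰp hγ.le K Cs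
  rw [hkey]
  exact hl

/-- v18 · PER-BLOCK-SIZE CAUCHY ESTIMATE at the v18 stubs {S1aᴴ, 26243 (⇒ S1b), S2α′ + S2β (⇒ S2), O1ᵘ-H v2 (⇒ S3ᴴ by the junction), S4bᴼ ✓, S4c ✓}
(re-pointed; v17.2 went through {S1a, 26243, S2α′, S2β, O1}). -/
theorem unitLawCauchy_perL (L : ℕ) : ∃ γ₁ : ℝ, 0 < γ₁ ∧ ∀ (F : T3Family) (γ : ℝ), F.L = L → 0 < γ → γ ≤ γ₁ →
    ∀ (g : GaugeField (F.P 0) 0 (Matrix.specialUnitaryGroup (Fin 2) ℂ) → ℝ), Measurable g → (∀ u, |g u| ≤ 1) →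
      CauchySeq (fun K => ∫ u, g u ∂(F.unitLaw ℰp measurableE_ℰp γ K)) :=
  unitLawCauchy_perL_of_H stub_runClassMembershipH stub_runWindowTails stub_runPairSeed backwardStabilityFinSupH_of_stubs
    stub_windowTVOsc stub_integralOfTV L

/-- ★ KERNEL COMPOSITION (leaf BY NAME) at the v18 registered-stub candidates {S1aᴴ `stub_runClassMembershipH`, 26243 `stub_firstExitWindowTailL`,
S2α′ `stub_classicalPerHeight`, S2β `stub_fluctuationPartSmall`, O1ᵘ-H v2 `stub_oneStepTransportUH`} — re-pointed; sorries = these five, zero elsewhere. -/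
theorem yM3TorusSU2_of_stubs :
    Literature.MathematicalPhysics.QuantumFieldTheory.Balaban1983to89.T3YM3TorusStatement.YM3TorusSU2 :=
  yM3TorusSU2_of unitLawCauchy_perL

/-- v13∕v18 · THE S2α′ PLUG (kernel-checked; re-pointed to the H package): ANY proof `h` of the text `ClassicalPerHeight` closes the R3 leaf BY NAME
given the other v18 inputs {S1aᴴ, 26243, S2β, O1ᵘ-H v2}. -/
theorem yM3TorusSU2_of_classicalPerHeight (h : ClassicalPerHeight) :
    Literature.MathematicalPhysics.QuantumFieldTheory.Balaban1983to89.T3YM3TorusStatement.YM3TorusSU2 :=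
  yM3TorusSU2_of (unitLawCauchy_perL_of_H stub_runClassMembershipH stub_runWindowTails
    (runPairSeed_of_table (classicalTwoDepth_of_perHeight h) stub_fluctuationPartSmall) backwardStabilityFinSupH_of_stubs
    stub_windowTVOsc stub_integralOfTV)

/-- v14∕v18 · THE SEED-TABLE PLUG (kernel-checked; re-pointed): ANY proofs of the texts `ClassicalPerHeight` (S2α′) and `FluctuationPartSmall` (S2β)
close the R3 leaf BY NAME given the other v18 inputs {S1aᴴ, 26243, O1ᵘ-H v2}. -/
theorem yM3TorusSU2_of_seedTables (hα : ClassicalPerHeight) (hβ : FluctuationPartSmall) :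
    Literature.MathematicalPhysics.QuantumFieldTheory.Balaban1983to89.T3YM3TorusStatement.YM3TorusSU2 :=
  yM3TorusSU2_of (unitLawCauchy_perL_of_H stub_runClassMembershipH stub_runWindowTails
    (runPairSeed_of_table (classicalTwoDepth_of_perHeight hα) hβ) backwardStabilityFinSupH_of_stubs
    stub_windowTVOsc stub_integralOfTV)

/-- v14∕v18 · THE S2β PLUG (kernel-checked; re-pointed): ANY proof `h` of the text `FluctuationPartSmall` closes the R3 leaf BY NAME given the other
v18 inputs {S1aᴴ, 26243, S2α′, O1ᵘ-H v2}. -/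
theorem yM3TorusSU2_of_fluctuationPartSmall (h : FluctuationPartSmall) :
    Literature.MathematicalPhysics.QuantumFieldTheory.Balaban1983to89.T3YM3TorusStatement.YM3TorusSU2 :=
  yM3TorusSU2_of_seedTables stub_classicalPerHeight h

/-- v18 · THE O1ᵘ-H PLUG (kernel-checked): ANY proof of the text `OneStepTransportUH` together with ANY proof of S1aᴴ closes the R3 leaf BY NAME
given the other v18 inputs {26243, S2α′, S2β} — the junction + the re-keyed composition, no further glue. -/
theorem yM3TorusSU2_of_oneStepTransportUH (hO : OneStepTransportUH) (h1a : RunClassMembershipH) :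
    Literature.MathematicalPhysics.QuantumFieldTheory.Balaban1983to89.T3YM3TorusStatement.YM3TorusSU2 :=
  yM3TorusSU2_of fun L => unitLawCauchy_perL_of_H h1a stub_runWindowTails stub_runPairSeed
    (backwardStabilityFinSupH_of_oneStepTransportUH hO) stub_windowTVOsc stub_integralOfTV L

/- v17: the v7–v16 edge `backwardStabilityAdmF_of_stubs` (O1 + FC ⇒ 23877) is WITHDRAWN — the anchored SF-projected organ O1 v17 yields only
the anchored S3, while 23877 quantifies over all infinite class towers; `backwardStabilityAdmF_of_gen` records what the generic text would give.
v18: unchanged — S3ᴴ is anchored and finite-run like S3. -/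

end Summit.QuantumFields.YangMills.Cruxes.FluctuationComparisonRegPrIntL.RunPairOrgan
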